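import Mathlib.Analysis.Subadditive
import Mathlib.Algebra.Group.Conj
import Mathlib.Data.Real.Pointwise
import Mathlib.Data.List.ChainOfFn
import Mathlib.Data.Fin.Tuple.Basic
import Mathlib.Data.Fin.SuccPred
import Mathlib.Algebra.BigOperators.Fin
import Literature.GroupTheory.CombinatorialGroupTheory.RandomSclFreeGroup
import Literature.GroupTheory.CombinatorialGroupTheory.CommutatorLength
import Literature.Probability.Moments.AdaptedIndicatorChernoff
import Mathlib.GroupTheory.Perm.Cycle.Factors
import Mathlib.Algebra.BigOperators.Fin
import HarnessLib

/-!
# Random rigidity of scl (Calegari–Walker 2013): proofs, part 1 — the background of §§2–3, 5.1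

Groundwork towards `CalegariWalker2013_randomRigidity` (`RandomSclFreeGroup.lean`), following the
architecture of the printed proof in D. Calegari, A. Walker, *Random rigidity in the free group*,
Geom. Topol. 17 (2013) 1707–1744 [CalegariWalker2013] (arXiv:1104.1768, read §2 pp. 5–7, §3
pp. 8–9, §4 pp. 10–13, §5.1 p. 15). Everything here is PROVED.

* §3.1 (Def. 3.1). `cl` is attained and subadditive on `[G,G]`
  (`exists_list_length_eq_commutatorLength`, `commutatorLength_mul_le`,
  `commutatorLength_pow_le`), hence `n ↦ cl(gⁿ)` is subadditive and
  **`cl(gⁿ)/n → scl(g)`** (`tendsto_commutatorLength_pow_div`, Fekete's lemma via Mathlib's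
  `Subadditive.tendsto_lim`): the body `⨅ k, cl(g^{k+1})/(k+1)` of `stableCommutatorLength` IS the
  limit `lim_n cl(gⁿ)/n` of Def. 3.1. API: `stableCommutatorLength_le_div`,
  `le_stableCommutatorLength_of_forall_le_div`.
* §5.1 (Def. 5.1, Thm. 5.2). Quasimorphisms `φ : G → ℝ` of defect `≤ D`
  (`|φ(ab) − φ(a) − φ(b)| ≤ D`) that are homogeneous (`φ(aⁿ) = n φ(a)`; we only use `n : ℕ`, which
  the printed `n ∈ ℤ` implies): `φ(1) = 0`, `φ(a⁻¹) = −φ(a)`, conjugation invariance, Bavard's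
  lemma `|φ([a,b])| ≤ D`, `|φ(c₁⋯c_m)| ≤ (2m − 1) D` for commutators `cᵢ`, and the elementary
  direction of **Bavard duality**, `φ(g) ≤ 2 D · scl(g)` on `[G,G]`
  (`le_stableCommutatorLength_of_homogeneous_quasimorphism`) — the inequality
  "`scl(v) ≥ φ(v) / 2D(φ)`" by which loc. cit. §5.2 certifies lower bounds.
* §2.1/§2.3. `|F_n| = 2k(2k−1)^{n−1}` for `n ≥ 1` (`card_reducedWords`), via the adjacency
  criterion for reduced words (`reduce_ofFn_eq_self_iff`) and the recursion
  `|F_{n+2}| = |F_{n+1}| (2k−1)`; and the first clause of Sharp's theorem (Thm. 2.1):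
  `F_n' = ∅` for odd `n` (`commutatorWords_eq_empty_of_odd`).
* §3.1 again ("`scl` vanishes on `⟨g − hgh⁻¹, gⁿ − ng⟩`"): `cl` and `scl` are class functions and
  even (`commutatorLength_conj`, `commutatorLength_inv`, `stableCommutatorLength_conj`,
  `stableCommutatorLength_inv`), `scl(gᵐ) = m scl(g)` (`stableCommutatorLength_pow`), and the
  tubing identity `∏ᵢ hᵢ v^{nᵢ} hᵢ⁻¹ = c₁⋯c_b v^{Σnᵢ}` with `cl(v^{Σnᵢ}) ≤ cl(∏ᵢ hᵢv^{nᵢ}hᵢ⁻¹) + b`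
  (`exists_prod_map_conj_pow_eq`, `commutatorLength_pow_sum_le`) — the algebra of gluing the `b`
  boundary components of an admissible surface (towards Lemma 3.4).
* §2.5, **Lemma 2.9** (`inv_occurrences_separated`): in a reduced word no copy of `σ ≠ 1`
  overlaps — or even abuts — a copy of `σ⁻¹` (via `eq_nil_of_isReduced_of_invRev_eq`: a non-empty
  reduced word is not its own inverse, and `not_isReduced_append_invRev`).
* §2.4, **Lemma 2.4** (the counts `u_m(a,b)` behind the decay of correlations): reduced words of
  length `n + 1` with prescribed first letter number `(2k−1)ⁿ` (`card_reducedWords_filter_head`);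
  with both end letters prescribed, `N_n(a,b)`, the transfer recursion
  `N_{n+1}(a,b) + N_n(a,b⁻¹) = (2k−1)ⁿ` (`card_filter_ends_succ_add`), the closed form
  `2k N_n(a,b) = (2k−1)ⁿ − (−1)ⁿ + 2k(−1)ⁿ[b = a⁽ⁿ⁾]` (`two_mul_card_filter_ends`), Lemma 2.4 (i)
  (`card_filter_ends_eq_of_ne`), the exact defect `N_n(a,a⁽ⁿ⁾) = N_n(a,b) + (−1)ⁿ`
  (`card_filter_ends_alt_eq`) and Lemma 2.4 (ii) `|N_n(a,a⁽ⁿ⁾)/N_n(a,b) − 1| ≤ (2k−2)^{−(n−1)}`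
  (`abs_card_filter_ends_div_sub_one_le`).
* §2.4 ("the expected number of copies of `σ` in `v` is `(n − |σ| + 1)/|F_{|σ|}|`"): appending or
  prepending a letter multiplies counts by `2k − 1` (`card_filter_init`, `card_filter_tail`), a
  reduced word has `(2k−1)ᵗ` reduced right-extensions (`card_filter_prefix`), and the subword of
  a uniform `w ∈ F_n` at a fixed position is exactly uniform on `F_L`:
  `|{w ∈ F_n : w[i,i+L) = σ}| = (2k−1)^{n−L}`, `· |F_L| = |F_n|` (`card_filter_window'`,
  `card_filter_window_mul_card`).
* Non-vacuity of the model: `F_n' ≠ ∅` for `k ≥ 2` and even `n ≥ 4` (`commutatorWords_nonempty`,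
  witnessed by `[x₁ᵃ, x₂]`).
* §2.5, **Lemma 2.10** (counting core): with a prescribed prefix there are `(2k−1)^{n−|p|}` reduced
  words (`card_filter_prefix'`, `≤` for arbitrary `p`: `card_filter_prefix_le`), of which at most
  `(2k−1)^{n−|p|−|x|}` carry a prescribed `x` right after the prefix
  (`card_filter_prefix_window_le`); so conditional on `v_{<i}` a window takes a given value with
  probability `≤ (2k−1)^{−|x|}` (`card_filter_prefix_window_mul_le`).
* §2.4, Lemmas 2.4–2.5 (the transfer count behind the decay of correlations): with a reduced
  prefix `p`, a free gap of length `g + 1` and a reduced window `x` right after it, the count is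
  EXACTLY `N · (2k−1)^{n−|p|−(g+1)−|x|}`, `N = #{reduced a u b : |u| = g+1}` (`a` = last letter of
  `p`, `b` = first of `x`; `card_filter_prefix_gap_window`, with `append_mem_reducedWords_iff`);
  hence the conditional law of a window given ANY reduced past is within the factor
  `1 ± (2k+1)(2k−1)^{−(g+2)}` of uniform (`card_fibre_window_mul`, `conditional_window_two_sided`).
* §2.4, **Lemma 2.5 (finite form), PROVED**: for `k ≥ 2`, a reduced `σ` and `T` windows at
  positions separated by a free gap `g + 1`, the number of words of `F_n` in which `≥ (1+δ)Tp₊`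
  (resp. `≤ (1−δ)Tp₋`) of the windows read `σ` is `≤ |F_n| exp(−δ²Tp±/4)`,
  `p± = ((2k−1)^{g+2} ± (2k+1))/(2k(2k−1)^{g+ℓ+2})` (`card_filter_windowCount_ge_le`,
  `card_filter_windowCount_le_le`), by the adapted Chernoff bound of
  `Literature.Probability.Moments.AdaptedIndicatorChernoff`.
* Towards Thm. 2.1 (Sharp): the weighted counts `C_n(χ) = ∑_{w ∈ F_n} ∏ χ(wᵢ)` of a weight
  with `χ(x)χ(x⁻¹) = 1` (a character of the abelianisation) satisfy the **cogrowth recurrence**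
  `C_{n+3} = a C_{n+2} − (2k−1) C_{n+1}`, `a = ∑_x χ(x)`, with `C_0 = 1, C_1 = a, C_2 = a² − 2k`
  (`weightedCount_rec`, `weightedCount_zero/one/two`; via the weighted snoc decomposition
  `sum_reducedWords_succ_succ` and the last-letter transfer `weightedLast_succ`) — reducing the
  `k`-dimensional local limit theorem to a scalar second-order recurrence.
* Towards Lemmas 3.4–3.5 (surface ⇒ commutators): `cl(f g) ≤ cl(g)` for homomorphisms
  (`commutatorLength_map_le`) and the handle reduction of the classification of surfaces in any
  group, `xAyBx⁻¹Cy⁻¹D = (CB)([(CB)⁻¹x, AyB]·ADCB)(CB)⁻¹` (`handle_eq_conj_commutator_mul`), so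
  `cl(xAyBx⁻¹Cy⁻¹D) ≤ cl(ADCB) + 1` (`commutatorLength_handle_le`).
* §4.2, **Lemma 4.4** (tripods): `x y⁻¹` is reduced iff the last letters of the non-empty reduced
  words `x, y` differ (`isReduced_append_invRev_iff`); reduced words with prescribed last letter
  number `(2k−1)ⁿ` and those whose last letter avoids two given letters `(2k−2)(2k−1)ⁿ`
  (`card_reducedWords_filter_last`, `card_reducedWords_filter_last_ne_ne`).
* Towards Lemma 3.5 (Culler), the classification step: an **orientable quadratic word** `Q`
  (every letter at most once and as often as its inverse) has `4 · cl(mk Q) ≤ |Q|`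
  (`commutatorLength_quadratic_le`) — delete adjacent `c c⁻¹` or cut off the handle of two linked
  pairs, which exist when no pair is adjacent (`exists_linked_pairs`).
* **Lemma 3.5 (Culler), the commutator half, PROVED**: for a pairing `π` of `w` (fixed-point-free
  involution of the positions with `w(πi) = w(i)⁻¹`) and any corner labelling invariant under the
  side pairing with `V` values, `2 cl(mk w) + V ≤ |w|/2 + 1` (`commutatorLength_le_of_pairing`);
  with `V` = number of orbits of `rot ∘ π` this is `cl(w) ≤ g(π) = |w|/4 − V/2 + 1/2`, the `≤`
  half of Bardakov's formula (`commutatorLength_le_of_pairing_orbits`). No topology: universal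
  quadratic word, tree potential along the boundary walk (`exists_tree_potential`), and
  `commutatorLength_quadratic_le`.
* In the vocabulary of `CommutatorLength.lean` (`IsPairing`, `orbitCount`): for every pairing,
  `4 cl(mk w) + 2 orbitCount(σπ) ≤ |w| + 2` (`commutatorLength_le_of_isPairing`), hence
  `cl(w) ≤ |w|/4 − o/2 + 1/2` — ONE INEQUALITY OF THE NAMED FACT `BardakovFormula`, proved
  (`commutatorLength_le_bardakov`).

## Not (yet) here
Sharp's asymptotics (Thm. 2.1), the subword statistics of §2 (Props. 2.3, 2.6, 2.11), surfaces
and fatgraphs (Lemmas 3.4–3.7) and Props. 4.2/4.9: `CalegariWalker2013_randomRigidity` remains a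
named fact until those land.
-/

noncomputable section

open Filter

namespace Literature.GroupTheory.CombinatorialGroupTheory

/-! ### §3.1: `cl` is attained and subadditive; `scl` is the limit `lim cl(gⁿ)/n` -/

section SclLimit

variable {G : Type*} [Group G]

/-- For `g ∈ [G,G]` the infimum defining `cl(g)` is attained: `g` is a product of exactly `cl(g)`
commutators. [folklore] -/
theorem exists_list_length_eq_commutatorLength {g : G} (hg : g ∈ commutator G) :
    ∃ l : List (G × G), l.length = commutatorLength g ∧
      (l.map fun p => p.1 * p.2 * p.1⁻¹ * p.2⁻¹).prod = g := by
  have hne : {m : ℕ | ∃ l : List (G × G), l.length = m ∧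
      (l.map fun p => p.1 * p.2 * p.1⁻¹ * p.2⁻¹).prod = g}.Nonempty := by
    obtain ⟨l, hl⟩ := (exists_list_prod_eq_iff_mem_commutator g).mpr hg
    exact ⟨l.length, l, rfl, hl⟩
  have h := Nat.sInf_mem hne
  exact h

/-- **Subadditivity of commutator length** on `[G,G]`: `cl(gh) ≤ cl(g) + cl(h)` (concatenate two
minimal commutator expressions). [folklore] -/
theorem commutatorLength_mul_le {g h : G} (hg : g ∈ commutator G) (hh : h ∈ commutator G) :
    commutatorLength (g * h) ≤ commutatorLength g + commutatorLength h := by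
  obtain ⟨l₁, hl₁, hg₁⟩ := exists_list_length_eq_commutatorLength hg
  obtain ⟨l₂, hl₂, hh₂⟩ := exists_list_length_eq_commutatorLength hh
  rw [← hl₁, ← hl₂, ← List.length_append]
  exact Nat.sInf_le ⟨l₁ ++ l₂, rfl, by rw [List.map_append, List.prod_append, hg₁, hh₂]⟩

/-- `cl(gⁿ) ≤ n · cl(g)` for `g ∈ [G,G]`. [folklore] -/
theorem commutatorLength_pow_le {g : G} (hg : g ∈ commutator G) (n : ℕ) :
    commutatorLength (g ^ n) ≤ n * commutatorLength g := by
  induction n with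
  | zero => simp
  | succ n ih =>
    rw [pow_succ, Nat.succ_mul]
    exact (commutatorLength_mul_le (Subgroup.pow_mem _ hg n) hg).trans (by omega)

/-- For `g ∈ [G,G]` the sequence `n ↦ cl(gⁿ)` is subadditive (Mathlib's `Subadditive`).
[folklore] -/
theorem subadditive_commutatorLength_pow {g : G} (hg : g ∈ commutator G) :
    Subadditive fun n : ℕ => (commutatorLength (g ^ n) : ℝ) := by
  intro m n
  have h := commutatorLength_mul_le (Subgroup.pow_mem _ hg m) (Subgroup.pow_mem _ hg n)
  rw [← pow_add] at h
  show (commutatorLength (g ^ (m + n)) : ℝ) ≤ commutatorLength (g ^ m) + commutatorLength (g ^ n)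
  exact_mod_cast h

/-- The infimum `⨅ k, cl(g^{k+1})/(k+1)` defining `scl(g)` is the infimum of `cl(gⁿ)/n` over
`n ≥ 1` (the set used by Mathlib's `Subadditive.lim`). [folklore] -/
theorem stableCommutatorLength_eq_sInf (g : G) :
    stableCommutatorLength g =
      sInf ((fun n : ℕ => (commutatorLength (g ^ n) : ℝ) / n) '' Set.Ici 1) := by
  rw [stableCommutatorLength_def, iInf]
  congr 1
  ext x
  simp only [Set.mem_range, Set.mem_image, Set.mem_Ici]
  constructor
  · rintro ⟨k, rfl⟩
    exact ⟨k + 1, Nat.succ_pos k, by push_cast; ring⟩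
  · rintro ⟨n, hn, rfl⟩
    obtain ⟨k, rfl⟩ := Nat.exists_eq_add_of_le' hn
    exact ⟨k, by push_cast; ring⟩

/-- **`scl` is the limit of Def. 3.1.** For `g ∈ [G,G]`, `cl(gⁿ)/n → scl(g)` as `n → ∞`: since
`n ↦ cl(gⁿ)` is subadditive, Fekete's lemma (Mathlib `Subadditive.tendsto_lim`) gives convergence
of `cl(gⁿ)/n` to its infimum over `n ≥ 1`, which is the body of `stableCommutatorLength`. This
certifies that the rendering `⨅ k, cl(g^{k+1})/(k+1)` of `scl(g) := lim_{n→∞} cl(gⁿ)/n` is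
faithful. [cite: CalegariWalker2013, Def. 3.1] -/
theorem tendsto_commutatorLength_pow_div {g : G} (hg : g ∈ commutator G) :
    Tendsto (fun n : ℕ => (commutatorLength (g ^ n) : ℝ) / n) atTop
      (nhds (stableCommutatorLength g)) := by
  have hsub := subadditive_commutatorLength_pow hg
  have hbdd : BddBelow (Set.range fun n : ℕ => (commutatorLength (g ^ n) : ℝ) / n) :=
    ⟨0, by
      rintro _ ⟨n, rfl⟩
      positivity⟩
  have h := hsub.tendsto_lim hbdd
  rwa [Subadditive.lim, ← stableCommutatorLength_eq_sInf] at h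

/-- `scl(g) ≤ cl(gⁿ)/n` for every `n ≥ 1` (a term of the infimum). [folklore] -/
theorem stableCommutatorLength_le_div (g : G) {n : ℕ} (hn : n ≠ 0) :
    stableCommutatorLength g ≤ (commutatorLength (g ^ n) : ℝ) / n := by
  obtain ⟨k, rfl⟩ := Nat.exists_eq_succ_of_ne_zero hn
  have h := ciInf_le (f := fun k : ℕ => (commutatorLength (g ^ (k + 1)) : ℝ) / ((k : ℝ) + 1))
    ⟨0, Set.forall_mem_range.mpr fun _ => by positivity⟩ k
  rw [stableCommutatorLength_def]
  push_cast
  exact h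

/-- Lower bounds for `scl`: if `c ≤ cl(gⁿ)/n` for all `n ≥ 1` then `c ≤ scl(g)`. [folklore] -/
theorem le_stableCommutatorLength_of_forall_le_div (g : G) {c : ℝ}
    (h : ∀ n : ℕ, n ≠ 0 → c ≤ (commutatorLength (g ^ n) : ℝ) / n) :
    c ≤ stableCommutatorLength g := by
  rw [stableCommutatorLength_def]
  refine le_ciInf fun k => ?_
  have h' := h (k + 1) (Nat.succ_ne_zero k)
  push_cast at h'
  exact h'

end SclLimit

/-! ### §5.1: homogeneous quasimorphisms and the elementary direction of Bavard duality

A *quasimorphism of defect at most `D`* is `φ : G → ℝ` with `|φ(ab) − φ(a) − φ(b)| ≤ D` for all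
`a, b` (loc. cit. Def. 5.1; the defect `D(φ)` is the least such `D`); it is *homogeneous* if
`φ(aⁿ) = n φ(a)`. We carry both as explicit hypotheses `hD`, `hφ` (no new definition); `hφ` is
only assumed for `n : ℕ`. -/

section Bavard

variable {G : Type*} [Group G] {φ : G → ℝ} {D : ℝ}

/-- If `n · |x| ≤ D` for every `n : ℕ` then `x = 0` (Archimedes). [folklore] -/
theorem eq_zero_of_forall_nat_mul_abs_le {x D : ℝ} (h : ∀ n : ℕ, (n : ℝ) * |x| ≤ D) :
    x = 0 := by
  by_contra hx
  have hpos : 0 < |x| := abs_pos.mpr hx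
  obtain ⟨n, hn⟩ := exists_nat_gt (D / |x|)
  have h' := h n
  rw [div_lt_iff₀ hpos] at hn
  linarith

/-- `|φ(ab)| ≤ |φ(a)| + |φ(b)| + D` for a quasimorphism of defect `≤ D`. [folklore] -/
theorem quasimorphism_abs_map_mul_le (hD : ∀ a b, |φ (a * b) - φ a - φ b| ≤ D) (a b : G) :
    |φ (a * b)| ≤ |φ a| + |φ b| + D := by
  have h := hD a b
  calc |φ (a * b)| = |(φ (a * b) - φ a - φ b) + φ a + φ b| := by congr 1; ring
    _ ≤ |φ (a * b) - φ a - φ b| + |φ a| + |φ b| := abs_add_three _ _ _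
    _ ≤ |φ a| + |φ b| + D := by linarith

/-- A homogeneous function vanishes at the identity. [folklore] -/
theorem homogeneous_map_one (hφ : ∀ (a : G) (n : ℕ), φ (a ^ n) = n * φ a) : φ 1 = 0 := by
  have h := hφ 1 2
  rw [one_pow] at h
  push_cast at h
  linarith

/-- A homogeneous quasimorphism is odd: `φ(a⁻¹) = −φ(a)` (`n |φ(a) + φ(a⁻¹)| = |φ(aⁿ) + φ(a⁻ⁿ)|`
stays bounded). [folklore] -/
theorem homogeneous_quasimorphism_map_inv (hD : ∀ a b, |φ (a * b) - φ a - φ b| ≤ D)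
    (hφ : ∀ (a : G) (n : ℕ), φ (a ^ n) = n * φ a) (a : G) : φ a⁻¹ = -φ a := by
  have h1 := homogeneous_map_one hφ
  suffices h : φ a + φ a⁻¹ = 0 by linarith
  refine eq_zero_of_forall_nat_mul_abs_le (D := D) fun n => ?_
  have hprod : a ^ n * a⁻¹ ^ n = 1 := by rw [inv_pow, mul_inv_cancel]
  have h := hD (a ^ n) (a⁻¹ ^ n)
  rw [hprod, h1, hφ a n, hφ a⁻¹ n] at h
  calc (n : ℝ) * |φ a + φ a⁻¹| = |(0 : ℝ) - n * φ a - n * φ a⁻¹| := by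
        rw [show (0 : ℝ) - n * φ a - n * φ a⁻¹ = -((n : ℝ) * (φ a + φ a⁻¹)) by ring, abs_neg,
          abs_mul, Nat.abs_cast]
    _ ≤ D := h

/-- A homogeneous quasimorphism is a class function: `φ(b a b⁻¹) = φ(a)`
(`(bab⁻¹)ⁿ = baⁿb⁻¹`, so `n |φ(bab⁻¹) − φ(a)| ≤ 2D`). [folklore] -/
theorem homogeneous_quasimorphism_map_conj (hD : ∀ a b, |φ (a * b) - φ a - φ b| ≤ D)
    (hφ : ∀ (a : G) (n : ℕ), φ (a ^ n) = n * φ a) (a b : G) : φ (b * a * b⁻¹) = φ a := by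
  have hinv := homogeneous_quasimorphism_map_inv hD hφ
  suffices h : φ (b * a * b⁻¹) - φ a = 0 by linarith
  refine eq_zero_of_forall_nat_mul_abs_le (D := D + D) fun n => ?_
  have e1 := hD (b * a ^ n) b⁻¹
  have e2 := hD b (a ^ n)
  have hc : (b * a * b⁻¹) ^ n = b * a ^ n * b⁻¹ := conj_pow
  have e3 : φ (b * a ^ n * b⁻¹) = n * φ (b * a * b⁻¹) := by rw [← hc, hφ]
  rw [hinv b, e3] at e1
  rw [hφ a n] at e2
  rw [← Nat.abs_cast n, ← abs_mul]
  calc |(n : ℝ) * (φ (b * a * b⁻¹) - φ a)|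
        = |(n * φ (b * a * b⁻¹) - φ (b * a ^ n) - -φ b) + (φ (b * a ^ n) - φ b - n * φ a)| := by
          congr 1; ring
    _ ≤ |n * φ (b * a * b⁻¹) - φ (b * a ^ n) - -φ b| + |φ (b * a ^ n) - φ b - n * φ a| :=
          abs_add_le _ _
    _ ≤ D + D := add_le_add e1 e2

/-- **Bavard's lemma**: a homogeneous quasimorphism of defect `≤ D` is bounded by `D` on single
commutators, `|φ(aba⁻¹b⁻¹)| ≤ D` (since `φ(aba⁻¹) = φ(b) = −φ(b⁻¹)`). [folklore] -/
theorem homogeneous_quasimorphism_abs_commutator_le (hD : ∀ a b, |φ (a * b) - φ a - φ b| ≤ D)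
    (hφ : ∀ (a : G) (n : ℕ), φ (a ^ n) = n * φ a) (a b : G) :
    |φ (a * b * a⁻¹ * b⁻¹)| ≤ D := by
  have h := hD (a * b * a⁻¹) b⁻¹
  rwa [homogeneous_quasimorphism_map_conj hD hφ b a, homogeneous_quasimorphism_map_inv hD hφ b,
    sub_neg_eq_add, sub_add_cancel] at h

/-- A homogeneous quasimorphism of defect `≤ D` on a product of `m ≥ 1` commutators:
`D + |φ(c₁ ⋯ c_m)| ≤ 2 m D`, i.e. `|φ(c₁ ⋯ c_m)| ≤ (2m − 1) D`. [folklore] -/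
theorem homogeneous_quasimorphism_abs_prod_le (hD : ∀ a b, |φ (a * b) - φ a - φ b| ≤ D)
    (hφ : ∀ (a : G) (n : ℕ), φ (a ^ n) = n * φ a) (l : List (G × G)) (hl : l ≠ []) :
    D + |φ (l.map fun p => p.1 * p.2 * p.1⁻¹ * p.2⁻¹).prod| ≤ 2 * l.length * D := by
  induction l with
  | nil => exact absurd rfl hl
  | cons p l ih =>
    have hc := homogeneous_quasimorphism_abs_commutator_le hD hφ p.1 p.2
    rcases eq_or_ne l [] with rfl | hne
    · simp only [List.map_cons, List.map_nil, List.prod_cons, List.prod_nil, mul_one,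
        List.length_cons, List.length_nil]
      push_cast
      linarith
    · have ih' := ih hne
      rw [List.map_cons, List.prod_cons, List.length_cons]
      push_cast
      have h3 := quasimorphism_abs_map_mul_le hD (p.1 * p.2 * p.1⁻¹ * p.2⁻¹)
        (l.map fun p => p.1 * p.2 * p.1⁻¹ * p.2⁻¹).prod
      linarith

/-- **Bavard duality, the elementary direction** (loc. cit. §5.1, Thm. 5.2 and the display
"`scl(v) ≥ h̄(v)/2D(h̄)`" of §5.2; C. Bavard, *Longueur stable des commutateurs*, Enseign. Math. 37
(1991); [Calegari, *scl*, §2.4–2.5]). If `φ : G → ℝ` satisfies `|φ(ab) − φ(a) − φ(b)| ≤ D` for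
all `a, b` and `φ(aⁿ) = n φ(a)` for all `a` and `n : ℕ`, then for every `g ∈ [G,G]`,
`φ(g) ≤ 2 D · scl(g)`. Proof: if `gⁿ` is a product of `m = cl(gⁿ)` commutators then
`n φ(g) = φ(gⁿ) ≤ (2m − 1) D`, so `φ(g) ≤ 2D · cl(gⁿ)/n` for all `n ≥ 1`.
[cite: CalegariWalker2013, §5.1 Thm. 5.2 (easy direction)] -/
theorem le_stableCommutatorLength_of_homogeneous_quasimorphism
    (hD : ∀ a b, |φ (a * b) - φ a - φ b| ≤ D) (hφ : ∀ (a : G) (n : ℕ), φ (a ^ n) = n * φ a)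
    {g : G} (hg : g ∈ commutator G) :
    φ g ≤ 2 * D * stableCommutatorLength g := by
  have hD0 : 0 ≤ D := (abs_nonneg _).trans (hD 1 1)
  -- for every `n ≥ 1`: `φ g ≤ 2 D cl(gⁿ)/n`
  have key : ∀ n : ℕ, n ≠ 0 → φ g ≤ 2 * D * ((commutatorLength (g ^ n) : ℝ) / n) := by
    intro n hn
    have hnpos : (0 : ℝ) < n := by exact_mod_cast Nat.pos_of_ne_zero hn
    obtain ⟨l, hl, hprod⟩ := exists_list_length_eq_commutatorLength (Subgroup.pow_mem _ hg n)
    rcases eq_or_ne l [] with rfl | hne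
    · -- `gⁿ = 1`, so `n φ(g) = φ(1) = 0`
      simp only [List.map_nil, List.prod_nil] at hprod
      have h0 : (n : ℝ) * φ g = 0 := by rw [← hφ g n, ← hprod, homogeneous_map_one hφ]
      have hφg : φ g = 0 := by
        rcases mul_eq_zero.mp h0 with h | h
        · exact absurd h (ne_of_gt hnpos)
        · exact h
      rw [hφg]
      positivity
    · have h := homogeneous_quasimorphism_abs_prod_le hD hφ l hne
      rw [hprod, hφ g n, hl] at h
      have h' : (n : ℝ) * φ g ≤ 2 * (commutatorLength (g ^ n) : ℝ) * D := by
        have := le_abs_self ((n : ℝ) * φ g)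
        linarith
      rw [show 2 * D * ((commutatorLength (g ^ n) : ℝ) / n) =
          (2 * (commutatorLength (g ^ n) : ℝ) * D) / n by ring, le_div_iff₀ hnpos]
      linarith
  -- pass to the infimum over `n = k + 1`
  calc φ g ≤ 2 * D * ⨅ k : ℕ, (commutatorLength (g ^ (k + 1)) : ℝ) / ((k : ℝ) + 1) := by
        rw [Real.mul_iInf_of_nonneg (by positivity)]
        refine le_ciInf fun k => ?_
        have h := key (k + 1) (Nat.succ_ne_zero k)
        push_cast at h
        exact h
    _ = 2 * D * stableCommutatorLength g := by rw [stableCommutatorLength_def]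

/-- Bavard duality, elementary direction, in the printed shape `φ(g)/(2D) ≤ scl(g)` (for `D > 0`).
[cite: CalegariWalker2013, §5.1 Thm. 5.2 (easy direction)] -/
theorem div_le_stableCommutatorLength_of_homogeneous_quasimorphism
    (hD : ∀ a b, |φ (a * b) - φ a - φ b| ≤ D) (hφ : ∀ (a : G) (n : ℕ), φ (a ^ n) = n * φ a)
    (hDpos : 0 < D) {g : G} (hg : g ∈ commutator G) :
    φ g / (2 * D) ≤ stableCommutatorLength g := by
  rw [div_le_iff₀ (by positivity)]
  have h := le_stableCommutatorLength_of_homogeneous_quasimorphism hD hφ hg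
  linarith [mul_comm (2 * D) (stableCommutatorLength g)]

/-- The same for quasimorphisms homogeneous in the printed sense (`φ(aⁿ) = n φ(a)` for all
`n ∈ ℤ`, loc. cit. Def. 5.1). [cite: CalegariWalker2013, §5.1 Thm. 5.2 (easy direction)] -/
theorem le_stableCommutatorLength_of_homogeneous_quasimorphism'
    (hD : ∀ a b, |φ (a * b) - φ a - φ b| ≤ D) (hφ : ∀ (a : G) (n : ℤ), φ (a ^ n) = n * φ a)
    {g : G} (hg : g ∈ commutator G) :
    φ g ≤ 2 * D * stableCommutatorLength g :=
  le_stableCommutatorLength_of_homogeneous_quasimorphism hD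
    (fun a n => by simpa using hφ a (n : ℤ)) hg

end Bavard

/-! ### §2.1/§2.3: counting reduced words, `|F_n| = 2k(2k−1)^{n−1}`; `F_n' = ∅` for odd `n` -/

section Counting

open scoped Classical

/-- A word `w : Fin n → Fin k × Bool` is reduced (fixed by `FreeGroup.reduce`) iff no letter is
immediately followed by its inverse (Mathlib: `FreeGroup.isReduced_iff_reduce_eq`,
`List.isChain_ofFn`). [folklore] -/
theorem reduce_ofFn_eq_self_iff {k n : ℕ} (w : Fin n → Fin k × Bool) :
    FreeGroup.reduce (List.ofFn w) = List.ofFn w ↔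
      ∀ (i : ℕ) (hi : i + 1 < n), (w ⟨i, Nat.lt_of_succ_lt hi⟩).1 = (w ⟨i + 1, hi⟩).1 →
        (w ⟨i, Nat.lt_of_succ_lt hi⟩).2 = (w ⟨i + 1, hi⟩).2 := by
  rw [← FreeGroup.isReduced_iff_reduce_eq, FreeGroup.IsReduced, List.isChain_ofFn]

/-- The same criterion for words of length `n + 1`, indexed by `Fin n` (`castSucc`/`succ`).
[folklore] -/
theorem reduce_ofFn_eq_self_iff_fin {k n : ℕ} (w : Fin (n + 1) → Fin k × Bool) :
    FreeGroup.reduce (List.ofFn w) = List.ofFn w ↔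
      ∀ i : Fin n, (w i.castSucc).1 = (w i.succ).1 → (w i.castSucc).2 = (w i.succ).2 := by
  rw [reduce_ofFn_eq_self_iff]
  constructor
  · intro h i
    exact h i (by omega)
  · intro h i hi
    exact h ⟨i, by omega⟩

/-- The letters that may follow a given letter `c` in a reduced word — all but `c⁻¹` — number
`2k − 1`. [folklore] -/
theorem card_filter_ne_inv_letter (k : ℕ) (c : Fin k × Bool) :
    (Finset.univ.filter fun x : Fin k × Bool => c.1 = x.1 → c.2 = x.2).card = 2 * k - 1 := by
  have h : (Finset.univ.filter fun x : Fin k × Bool => c.1 = x.1 → c.2 = x.2) =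
      Finset.univ.erase (c.1, !c.2) := by
    ext x
    obtain ⟨c1, c2⟩ := c
    obtain ⟨x1, x2⟩ := x
    simp only [Finset.mem_filter, Finset.mem_univ, true_and, Finset.mem_erase, ne_eq,
      Prod.mk.injEq, and_true]
    cases c2 <;> cases x2 <;> simp [eq_comm]
  rw [h, Finset.card_erase_of_mem (Finset.mem_univ _), Finset.card_univ, Fintype.card_prod,
    Fintype.card_fin, Fintype.card_bool]
  omega

/-- `|F_0| = 1` (the empty word). [folklore] -/
theorem card_reducedWords_zero (k : ℕ) : (reducedWords k 0).card = 1 := by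
  have h : reducedWords k 0 = Finset.univ := by
    rw [reducedWords, Finset.filter_true_of_mem]
    intro w _
    rw [reduce_ofFn_eq_self_iff]
    intro i hi
    omega
  rw [h, Finset.card_univ]
  simp

/-- `|F_1| = 2k` (every one-letter word is reduced). [folklore] -/
theorem card_reducedWords_one (k : ℕ) : (reducedWords k 1).card = 2 * k := by
  have h : reducedWords k 1 = Finset.univ := by
    rw [reducedWords, Finset.filter_true_of_mem]
    intro w _
    rw [reduce_ofFn_eq_self_iff]
    intro i hi
    omega
  rw [h, Finset.card_univ, Fintype.card_fun, Fintype.card_prod, Fintype.card_fin,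
    Fintype.card_bool, Fintype.card_fin]
  ring

/-- The recursion `|F_{n+2}| = |F_{n+1}| · (2k − 1)`: a reduced word of length `n + 2` is a reduced
word of length `n + 1` followed by any of the `2k − 1` letters other than the inverse of its last
letter. [folklore] -/
theorem card_reducedWords_succ_succ (k n : ℕ) :
    (reducedWords k (n + 2)).card = (reducedWords k (n + 1)).card * (2 * k - 1) := by
  set T : Finset (Σ _ : Fin (n + 1) → Fin k × Bool, Fin k × Bool) :=
    (reducedWords k (n + 1)).sigma fun u => Finset.univ.filter fun x : Fin k × Bool =>
      (u (Fin.last n)).1 = x.1 → (u (Fin.last n)).2 = x.2 with hT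
  have hTcard : T.card = (reducedWords k (n + 1)).card * (2 * k - 1) := by
    rw [hT, Finset.card_sigma,
      Finset.sum_congr rfl fun u _ => card_filter_ne_inv_letter k (u (Fin.last n)),
      Finset.sum_const, smul_eq_mul]
  rw [← hTcard]
  refine Finset.card_nbij' (fun w => ⟨Fin.init w, w (Fin.last (n + 1))⟩)
    (fun ux => Fin.snoc ux.1 ux.2) ?_ ?_ ?_ ?_
  · intro w hw
    rw [Finset.mem_coe, mem_reducedWords_iff, reduce_ofFn_eq_self_iff_fin] at hw
    simp only [hT, Finset.coe_sigma, Set.mem_sigma_iff, Finset.mem_coe, mem_reducedWords_iff,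
      reduce_ofFn_eq_self_iff_fin, Finset.mem_filter, Finset.mem_univ, true_and]
    refine ⟨fun i => ?_, ?_⟩
    · simpa only [Fin.init, Fin.succ_castSucc] using hw i.castSucc
    · simpa only [Fin.init, Fin.succ_last] using hw (Fin.last n)
  · rintro ⟨u, x⟩ hux
    simp only [hT, Finset.coe_sigma, Set.mem_sigma_iff, Finset.mem_coe, mem_reducedWords_iff,
      reduce_ofFn_eq_self_iff_fin, Finset.mem_filter, Finset.mem_univ, true_and] at hux
    obtain ⟨hu, hx⟩ := hux
    rw [Finset.mem_coe, mem_reducedWords_iff, reduce_ofFn_eq_self_iff_fin]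
    intro i
    rcases Fin.eq_castSucc_or_eq_last i with ⟨j, rfl⟩ | rfl
    · simpa only [Fin.succ_castSucc, Fin.snoc_castSucc] using hu j
    · simpa only [Fin.succ_last, Fin.snoc_last, Fin.snoc_castSucc] using hx
  · intro w _
    exact Fin.snoc_init_self w
  · rintro ⟨u, x⟩ _
    simp only [Fin.init_snoc, Fin.snoc_last]

/-- **`|F_n| = 2k(2k−1)^{n−1}`** for `n ≥ 1`: the number of reduced words of length `n` in the
free group of rank `k` (loc. cit. §2.3, "the cardinality of `F_n` is `(2k)(2k−1)^{n−1}`").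
[cite: CalegariWalker2013, §2.3] -/
theorem card_reducedWords (k : ℕ) {n : ℕ} (hn : 1 ≤ n) :
    (reducedWords k n).card = 2 * k * (2 * k - 1) ^ (n - 1) := by
  induction n, hn using Nat.le_induction with
  | base => simp [card_reducedWords_one]
  | succ n hn ih =>
    obtain ⟨m, rfl⟩ := Nat.exists_eq_add_of_le' hn
    rw [show m + 1 + 1 = m + 2 from rfl, card_reducedWords_succ_succ, ih,
      show m + 2 - 1 = m + 1 - 1 + 1 by omega, pow_succ]
    ring

/-- The length of a word with balanced letter counts is even: it is `Σₐ (#a + #a⁻¹) = 2 Σₐ #a`.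
[folklore] -/
theorem even_of_balanced {k n : ℕ} (w : Fin n → Fin k × Bool)
    (h : ∀ a : Fin k, (Finset.univ.filter fun i => w i = (a, true)).card =
      (Finset.univ.filter fun i => w i = (a, false)).card) : Even n := by
  have hn : n = ∑ x : Fin k × Bool, (Finset.univ.filter fun i : Fin n => w i = x).card := by
    rw [← Finset.card_eq_sum_card_fiberwise fun i _ => Finset.mem_univ (w i), Finset.card_univ,
      Fintype.card_fin]
  rw [hn, Fintype.sum_prod_type]
  simp_rw [Fintype.sum_bool, h, ← two_mul]
  rw [← Finset.mul_sum]
  exact even_two_mul _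

/-- **`F_n' = ∅` for odd `n`** (the first clause of Sharp's theorem, loc. cit. Thm. 2.1): a
reduced word of odd length is never in `[F,F]`, its letter counts being unbalanced.
[cite: CalegariWalker2013, Thm. 2.1] -/
theorem commutatorWords_eq_empty_of_odd (k : ℕ) {n : ℕ} (hn : Odd n) :
    commutatorWords k n = ∅ := by
  rw [commutatorWords_eq_filter_balanced, Finset.filter_eq_empty_iff]
  rintro w - ⟨-, hbal⟩
  exact (Nat.not_even_iff_odd.mpr hn) (even_of_balanced w hbal)

end Counting

/-! ### §3.1: `cl` and `scl` are class functions, even, and `scl` is homogeneous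

"`scl` ... vanishes on the subspace `⟨g − hgh⁻¹, gⁿ − ng⟩`. This vanishing reflects the
homogeneity of `scl` and the fact that it is a class function" (loc. cit. §3.1). We also record
the algebraic form of tubing boundary components of a surface: a product of `b` conjugates of
powers `v^{nᵢ}` is a product of `b` commutators times `v^{Σ nᵢ}`, so
`cl(v^N) ≤ cl(∏ᵢ hᵢ v^{nᵢ} hᵢ⁻¹) + b`. -/

section ClassFunction

variable {G : Type*} [Group G]

/-- Off the commutator subgroup `cl` takes the junk value `0`. [folklore] -/
theorem commutatorLength_of_not_mem {g : G} (hg : g ∉ commutator G) : commutatorLength g = 0 := by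
  rw [commutatorLength_def, Nat.sInf_eq_zero]
  right
  ext m
  simp only [Set.mem_setOf_eq, Set.mem_empty_iff_false, iff_false]
  rintro ⟨l, -, hl⟩
  exact hg (hl ▸ prod_map_commutator_mem l)

/-- `scl(1) = 0`. [folklore] -/
@[simp]
theorem stableCommutatorLength_one : stableCommutatorLength (1 : G) = 0 :=
  le_antisymm (by simpa using stableCommutatorLength_le_commutatorLength (1 : G))
    (stableCommutatorLength_nonneg 1)

/-- Conjugating a product of commutators: `h [a₁,b₁]⋯[a_m,b_m] h⁻¹ = [a₁ʰ,b₁ʰ]⋯[a_mʰ,b_mʰ]`.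
[folklore] -/
theorem conj_prod_map_commutator (h : G) (l : List (G × G)) :
    h * (l.map fun p => p.1 * p.2 * p.1⁻¹ * p.2⁻¹).prod * h⁻¹ =
      ((l.map fun p => (h * p.1 * h⁻¹, h * p.2 * h⁻¹)).map
        fun p => p.1 * p.2 * p.1⁻¹ * p.2⁻¹).prod := by
  induction l with
  | nil => simp
  | cons p l ih =>
    simp only [List.map_cons, List.prod_cons]
    rw [← ih]
    group

/-- `cl(hgh⁻¹) ≤ cl(g)`. [folklore] -/
theorem commutatorLength_conj_le (g h : G) :
    commutatorLength (h * g * h⁻¹) ≤ commutatorLength g := by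
  by_cases hg : g ∈ commutator G
  · obtain ⟨l, hl, hprod⟩ := exists_list_length_eq_commutatorLength hg
    rw [← hl]
    refine Nat.sInf_le ⟨l.map fun p => (h * p.1 * h⁻¹, h * p.2 * h⁻¹), by simp, ?_⟩
    rw [← conj_prod_map_commutator, hprod]
  · have hg' : h * g * h⁻¹ ∉ commutator G := fun h' => hg (by
      have h'' := (inferInstance : (commutator G).Normal).conj_mem _ h' h⁻¹
      rwa [show h⁻¹ * (h * g * h⁻¹) * h⁻¹⁻¹ = g by group] at h'')
    rw [commutatorLength_of_not_mem hg, commutatorLength_of_not_mem hg']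

/-- **`cl` is a class function**: `cl(hgh⁻¹) = cl(g)`. [folklore] -/
theorem commutatorLength_conj (g h : G) : commutatorLength (h * g * h⁻¹) = commutatorLength g := by
  refine le_antisymm (commutatorLength_conj_le g h) ?_
  have h' := commutatorLength_conj_le (h * g * h⁻¹) h⁻¹
  rwa [show h⁻¹ * (h * g * h⁻¹) * h⁻¹⁻¹ = g by group] at h'

/-- Inverting a product of commutators: `([a₁,b₁]⋯[a_m,b_m])⁻¹ = [b_m,a_m]⋯[b₁,a₁]`. [folklore] -/
theorem prod_map_commutator_inv (l : List (G × G)) :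
    (((l.map fun p => (p.2, p.1)).reverse).map fun p => p.1 * p.2 * p.1⁻¹ * p.2⁻¹).prod =
      ((l.map fun p => p.1 * p.2 * p.1⁻¹ * p.2⁻¹).prod)⁻¹ := by
  rw [List.map_reverse, List.prod_reverse_noncomm, List.map_map, List.map_map]
  simp [Function.comp_def, mul_assoc]

/-- `cl(g⁻¹) ≤ cl(g)`. [folklore] -/
theorem commutatorLength_inv_le (g : G) : commutatorLength g⁻¹ ≤ commutatorLength g := by
  by_cases hg : g ∈ commutator G
  · obtain ⟨l, hl, hprod⟩ := exists_list_length_eq_commutatorLength hg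
    rw [← hl]
    refine Nat.sInf_le ⟨(l.map fun p => (p.2, p.1)).reverse, by simp, ?_⟩
    rw [prod_map_commutator_inv, hprod]
  · have hg' : g⁻¹ ∉ commutator G := fun h' => hg (by simpa using inv_mem h')
    rw [commutatorLength_of_not_mem hg, commutatorLength_of_not_mem hg']

/-- **`cl` is even**: `cl(g⁻¹) = cl(g)`. [folklore] -/
theorem commutatorLength_inv (g : G) : commutatorLength g⁻¹ = commutatorLength g :=
  le_antisymm (commutatorLength_inv_le g) (by simpa using commutatorLength_inv_le g⁻¹)

/-- `scl(g⁻¹) = scl(g)`. [folklore] -/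
theorem stableCommutatorLength_inv (g : G) :
    stableCommutatorLength g⁻¹ = stableCommutatorLength g := by
  simp only [stableCommutatorLength_def, inv_pow, commutatorLength_inv]

/-- **`scl` is a class function**: `scl(hgh⁻¹) = scl(g)`. [cite: CalegariWalker2013, §3.1] -/
theorem stableCommutatorLength_conj (g h : G) :
    stableCommutatorLength (h * g * h⁻¹) = stableCommutatorLength g := by
  simp only [stableCommutatorLength_def, conj_pow, commutatorLength_conj]

/-- **`scl` is homogeneous**: `scl(gᵐ) = m · scl(g)` for `g ∈ [G,G]` and `m : ℕ`
(`cl((gᵐ)ⁿ)/n = m · cl(g^{mn})/(mn)`, a subsequence of a convergent sequence).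
[cite: CalegariWalker2013, §3.1] -/
theorem stableCommutatorLength_pow {g : G} (hg : g ∈ commutator G) (m : ℕ) :
    stableCommutatorLength (g ^ m) = m * stableCommutatorLength g := by
  rcases Nat.eq_zero_or_pos m with rfl | hm
  · simp
  have h1 : Tendsto (fun n : ℕ => (commutatorLength ((g ^ m) ^ n) : ℝ) / n) atTop
      (nhds (stableCommutatorLength (g ^ m))) :=
    tendsto_commutatorLength_pow_div (Subgroup.pow_mem _ hg m)
  have h2 : Tendsto (fun n : ℕ => (m : ℝ) *
      ((commutatorLength (g ^ (m * n)) : ℝ) / ((m * n : ℕ) : ℝ))) atTop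
      (nhds (m * stableCommutatorLength g)) := by
    have hmn : Tendsto (fun n : ℕ => m * n) atTop atTop :=
      tendsto_atTop_mono (fun n => Nat.le_mul_of_pos_left n hm) tendsto_id
    exact ((tendsto_commutatorLength_pow_div hg).comp hmn).const_mul (m : ℝ)
  have heq : (fun n : ℕ => (commutatorLength ((g ^ m) ^ n) : ℝ) / n) =
      fun n : ℕ => (m : ℝ) * ((commutatorLength (g ^ (m * n)) : ℝ) / ((m * n : ℕ) : ℝ)) := by
    funext n
    rw [← pow_mul]
    rcases Nat.eq_zero_or_pos n with rfl | hn
    · simp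
    · have hm' : (m : ℝ) ≠ 0 := by exact_mod_cast hm.ne'
      have hn' : (n : ℝ) ≠ 0 := by exact_mod_cast hn.ne'
      push_cast
      field_simp
  rw [heq] at h1
  exact tendsto_nhds_unique h1 h2

/-- **Tubing identity.** A product of conjugates of powers of `v` is a product of as many
commutators times the total power: for `ps = [(h₁,n₁),…,(h_b,n_b)]` there are `b` commutators
`c₁,…,c_b` with `∏ᵢ hᵢ v^{nᵢ} hᵢ⁻¹ = c₁⋯c_b · v^{Σ nᵢ}` (move the powers of `v` to the right using
`h vᵃ h⁻¹ x = [h,vᵃ] vᵃ x` and `vᵃ [x,y] = [xᵛ,yᵛ] vᵃ`). This is the algebra behind gluing the `b`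
boundary components of an admissible surface into one. [folklore] -/
theorem exists_prod_map_conj_pow_eq (v : G) (ps : List (G × ℕ)) :
    ∃ l : List (G × G), l.length = ps.length ∧
      (ps.map fun p => p.1 * v ^ p.2 * p.1⁻¹).prod =
        (l.map fun p => p.1 * p.2 * p.1⁻¹ * p.2⁻¹).prod * v ^ (ps.map Prod.snd).sum := by
  induction ps with
  | nil => exact ⟨[], rfl, by simp⟩
  | cons p ps ih =>
    obtain ⟨l, hl, hprod⟩ := ih
    obtain ⟨h, a⟩ := p
    refine ⟨(h, v ^ a) :: l.map fun q => (v ^ a * q.1 * (v ^ a)⁻¹, v ^ a * q.2 * (v ^ a)⁻¹),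
      by simp [hl], ?_⟩
    rw [List.map_cons, List.prod_cons, hprod, List.map_cons, List.prod_cons,
      ← conj_prod_map_commutator, List.map_cons, List.sum_cons, pow_add]
    simp only [mul_assoc, inv_mul_cancel_left]

/-- **Tubing bound for `cl`.** If a product `P = ∏ᵢ hᵢ v^{nᵢ} hᵢ⁻¹` of `b` conjugates of powers of
`v` lies in `[G,G]`, then `cl(v^{Σ nᵢ}) ≤ cl(P) + b`. (With an admissible surface of genus `g'`
and `b` boundary components for `v`, `cl(P) ≤ g'`, this is the crude bound
`cl(v^N) ≤ g' + b`.) [folklore] -/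
theorem commutatorLength_pow_sum_le (v : G) (ps : List (G × ℕ))
    (hmem : (ps.map fun p => p.1 * v ^ p.2 * p.1⁻¹).prod ∈ commutator G) :
    commutatorLength (v ^ (ps.map Prod.snd).sum) ≤
      commutatorLength (ps.map fun p => p.1 * v ^ p.2 * p.1⁻¹).prod + ps.length := by
  obtain ⟨l, hl, hprod⟩ := exists_prod_map_conj_pow_eq v ps
  have hL : (l.map fun p => p.1 * p.2 * p.1⁻¹ * p.2⁻¹).prod ∈ commutator G :=
    prod_map_commutator_mem l
  have hvN : v ^ (ps.map Prod.snd).sum = ((l.map fun p => p.1 * p.2 * p.1⁻¹ * p.2⁻¹).prod)⁻¹ *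
      (ps.map fun p => p.1 * v ^ p.2 * p.1⁻¹).prod := by
    rw [hprod, inv_mul_cancel_left]
  rw [hvN]
  refine (commutatorLength_mul_le (inv_mem hL) hmem).trans ?_
  rw [commutatorLength_inv, add_comm, ← hl]
  have hle : commutatorLength (l.map fun p => p.1 * p.2 * p.1⁻¹ * p.2⁻¹).prod ≤ l.length :=
    Nat.sInf_le ⟨l, rfl, rfl⟩
  exact Nat.add_le_add_left hle _

/-- In particular `v^{Σ nᵢ} ∈ [G,G]` as soon as some product of conjugates of the `v^{nᵢ}` is.
[folklore] -/
theorem pow_sum_mem_commutator (v : G) (ps : List (G × ℕ))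
    (hmem : (ps.map fun p => p.1 * v ^ p.2 * p.1⁻¹).prod ∈ commutator G) :
    v ^ (ps.map Prod.snd).sum ∈ commutator G := by
  obtain ⟨l, -, hprod⟩ := exists_prod_map_conj_pow_eq v ps
  have hvN : v ^ (ps.map Prod.snd).sum = ((l.map fun p => p.1 * p.2 * p.1⁻¹ * p.2⁻¹).prod)⁻¹ *
      (ps.map fun p => p.1 * v ^ p.2 * p.1⁻¹).prod := by
    rw [hprod, inv_mul_cancel_left]
  rw [hvN]
  exact mul_mem (inv_mem (prod_map_commutator_mem l)) hmem

end ClassFunction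

/-! ### §2.5, Lemma 2.9: in a reduced word no copy of `σ` overlaps (or abuts) a copy of `σ⁻¹`

Words are `List (α × Bool)` as in `FreeGroup`; `σ⁻¹` is `FreeGroup.invRev σ`; "a copy of `σ` in
`v` at position `i`" is a decomposition `v = p ++ σ ++ s` with `p.length = i`. -/

section NoOverlap

variable {α : Type*}

/-- A non-empty reduced word is not its own inverse: if `σ⁻¹ = σ` as words then `σ = []` — for
odd length the middle letter would equal its own inverse, for even length the two middle letters
would cancel ("we can write `σ` as `xy` where `y = y⁻¹`. But this is absurd", loc. cit. proof of
Lemma 2.9). [cite: CalegariWalker2013, Lemma 2.9] -/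
theorem eq_nil_of_isReduced_of_invRev_eq {u : List (α × Bool)} (hred : FreeGroup.IsReduced u)
    (hinv : FreeGroup.invRev u = u) : u = [] := by
  by_contra hne
  -- letters in mirror positions are inverse to each other
  have key : ∀ (i j : ℕ) (hi : i < u.length) (hj : j < u.length), i + j = u.length - 1 →
      u[i] = ((u[j]).1, !(u[j]).2) := by
    intro i j hi hj hij
    obtain rfl : j = u.length - 1 - i := by omega
    rw [List.getElem_of_eq hinv.symm hi]
    simp [FreeGroup.invRev, List.getElem_reverse, List.getElem_map]
  have hlen : 0 < u.length := List.length_pos_iff.mpr hne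
  obtain ⟨s, hs | hs⟩ := Nat.even_or_odd' u.length
  · -- even length `2(r+1)`: the letters in positions `r`, `r+1` cancel
    obtain ⟨r, rfl⟩ : ∃ r, s = r + 1 := ⟨s - 1, by omega⟩
    have h1 := key (r + 1) r (by omega) (by omega) (by omega)
    have h2 := List.isChain_iff_getElem.mp hred r (by omega)
    rw [h1] at h2
    simp at h2
  · -- odd length `2s+1`: the middle letter is its own inverse
    have h1 := key s s (by omega) (by omega) (by omega)
    have h2 := congrArg Prod.snd h1
    simp at h2

/-- Prefixes of `σ⁻¹` are inverses of suffixes of `σ`. [folklore] -/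
theorem take_invRev (σ : List (α × Bool)) (t : ℕ) :
    (FreeGroup.invRev σ).take t = FreeGroup.invRev (σ.drop (σ.length - t)) := by
  simp [FreeGroup.invRev, List.take_reverse, List.map_drop]

/-- `σ σ⁻¹` is not reduced for `σ ≠ []` (its middle letters `a a⁻¹` cancel). [folklore] -/
theorem not_isReduced_append_invRev {σ : List (α × Bool)} (hσ : σ ≠ []) :
    ¬ FreeGroup.IsReduced (σ ++ FreeGroup.invRev σ) := by
  intro h
  rw [← List.dropLast_concat_getLast hσ, FreeGroup.invRev_append] at h
  have h' : FreeGroup.IsReduced ([σ.getLast hσ] ++ FreeGroup.invRev [σ.getLast hσ]) :=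
    h.infix ⟨σ.dropLast, FreeGroup.invRev σ.dropLast, by simp [List.append_assoc]⟩
  simp [FreeGroup.invRev] at h'

/-- One-sided form of Lemma 2.9: if `σ ≠ []` occurs in the reduced word `v` at position `|p₁|`
and `σ⁻¹` occurs at position `|p₂| ≥ |p₁|`, then `|p₁| + |σ| < |p₂|` — the copy of `σ⁻¹` starts
strictly after the copy of `σ` ends (no overlap: the overlap would be a non-empty self-inverse
reduced word; not adjacent: `σσ⁻¹` is not reduced). [cite: CalegariWalker2013, Lemma 2.9] -/
theorem length_add_length_lt_of_isReduced {v σ p₁ s₁ p₂ s₂ : List (α × Bool)}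
    (hv : FreeGroup.IsReduced v) (hσ : σ ≠ []) (h₁ : v = p₁ ++ σ ++ s₁)
    (h₂ : v = p₂ ++ FreeGroup.invRev σ ++ s₂) (hle : p₁.length ≤ p₂.length) :
    p₁.length + σ.length < p₂.length := by
  by_contra hge
  rw [not_lt] at hge
  rcases Nat.lt_or_ge p₂.length (p₁.length + σ.length) with hlt | hge'
  · -- overlap of length `|σ| - d ≥ 1`, where `d = |p₂| - |p₁| < |σ|`
    set d := p₂.length - p₁.length with hd
    have hdlt : d < σ.length := by omega
    have hp₂ : p₂.length = p₁.length + d := by omega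
    -- the overlap, read in the copy of `σ`: the suffix `σ.drop d`
    have e₁ : (v.drop p₂.length).take (σ.length - d) = σ.drop d := by
      rw [h₁, List.append_assoc, hp₂, ← List.drop_drop, List.drop_left,
        List.drop_append_of_le_length hdlt.le, List.take_append_of_le_length (by simp),
        List.take_of_length_le (by simp)]
    -- the overlap, read in the copy of `σ⁻¹`: the prefix of `σ⁻¹` of the same length
    have e₂ : (v.drop p₂.length).take (σ.length - d) =
        (FreeGroup.invRev σ).take (σ.length - d) := by
      rw [h₂, List.append_assoc, List.drop_left, List.take_append_of_le_length]
      rw [FreeGroup.invRev_length]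
      omega
    have hu_inv : FreeGroup.invRev (σ.drop d) = σ.drop d := by
      have h := e₁.symm.trans e₂
      rw [take_invRev, show σ.length - (σ.length - d) = d by omega] at h
      exact h.symm
    have hu_red : FreeGroup.IsReduced (σ.drop d) := by
      refine hv.infix ?_
      rw [h₁]
      exact (List.drop_suffix d σ).isInfix.trans (List.infix_append _ _ _)
    have hu_nil := eq_nil_of_isReduced_of_invRev_eq hu_red hu_inv
    have hlen : (σ.drop d).length = σ.length - d := List.length_drop
    rw [hu_nil, List.length_nil] at hlen
    omega
  · -- adjacent: `σ σ⁻¹` would be a factor of `v`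
    have heq : p₂.length = p₁.length + σ.length := le_antisymm hge hge'
    have hs₁ : s₁ = FreeGroup.invRev σ ++ s₂ := by
      have e1 : v.drop (p₁.length + σ.length) = s₁ := by
        rw [h₁, ← List.length_append, List.drop_left]
      have e2 : v.drop (p₁.length + σ.length) = FreeGroup.invRev σ ++ s₂ := by
        rw [h₂, ← heq, List.append_assoc, List.drop_left]
      rw [← e1, e2]
    refine not_isReduced_append_invRev hσ (hv.infix ⟨p₁, s₂, ?_⟩)
    rw [h₁, hs₁]
    simp [List.append_assoc]

/-- **Calegari–Walker Lemma 2.9.** *Let `v` be a reduced word. Then for any reduced word `σ`, no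
copy of `σ` in `v` can overlap a copy of `σ⁻¹`* — indeed the two copies are not even adjacent
(as noted for joints in loc. cit. §4.2): if `v = p₁ σ s₁ = p₂ σ⁻¹ s₂` with `σ ≠ []`, then
`|p₁| + |σ| < |p₂|` or `|p₂| + |σ| < |p₁|`. (Reducedness of `σ` is automatic, `σ` being a factor
of `v`.) [cite: CalegariWalker2013, Lemma 2.9] -/
theorem inv_occurrences_separated {v σ p₁ s₁ p₂ s₂ : List (α × Bool)}
    (hv : FreeGroup.IsReduced v) (hσ : σ ≠ []) (h₁ : v = p₁ ++ σ ++ s₁)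
    (h₂ : v = p₂ ++ FreeGroup.invRev σ ++ s₂) :
    p₁.length + σ.length < p₂.length ∨ p₂.length + σ.length < p₁.length := by
  rcases le_or_gt p₁.length p₂.length with hle | hlt
  · exact Or.inl (length_add_length_lt_of_isReduced hv hσ h₁ h₂ hle)
  · right
    have hσ' : FreeGroup.invRev σ ≠ [] := fun h =>
      hσ (FreeGroup.invRev_injective (h.trans FreeGroup.invRev_empty.symm))
    have h := length_add_length_lt_of_isReduced (σ := FreeGroup.invRev σ) hv hσ' h₂
      (by rwa [FreeGroup.invRev_invRev]) hlt.le
    rwa [FreeGroup.invRev_length] at h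

end NoOverlap

/-! ### §2.4, Lemma 2.4: reduced words with prescribed first and last letters

The proof of loc. cit. Lemma 2.4 (decay of correlations) rests on the counts `u_m(a,b)` of
reduced words `a u b` of length `m + 2`. We count, for letters `a b` and `n ≥ 0`, the reduced words
of length `n + 1` with first letter `a` and last letter `b` — the entries `(Mⁿ)_{ab}` of the powers
of the transfer matrix `M = J − P` of the no-backtracking walk (`u_m(a,b)` is the case
`n = m + 1`): first-letter classes have `(2k−1)ⁿ` elements (`card_reducedWords_filter_head`), the
two-ended counts satisfy the transfer recursion `N_{n+1}(a,b) + N_n(a,b⁻¹) = (2k−1)ⁿ`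
(`card_filter_ends_succ_add`), whence the closed form
`2k · N_n(a,b) = (2k−1)ⁿ − (−1)ⁿ + 2k(−1)ⁿ·[b = a⁽ⁿ⁾]`, `a⁽ⁿ⁾ = a` (`n` even), `a⁻¹` (`n` odd)
(`two_mul_card_filter_ends`), and Lemma 2.4 (i): `N_n(a,b)` is the same for all `b ≠ a⁽ⁿ⁾`
(`card_filter_ends_eq_of_ne`). -/

section EndLetters

open scoped Classical

/-- Reduced words of length `n + 1` with prescribed first letter number `(2k−1)ⁿ` (each further
letter avoids exactly the inverse of its predecessor). [cite: CalegariWalker2013, §2.4] -/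
theorem card_reducedWords_filter_head (k n : ℕ) (a : Fin k × Bool) :
    ((reducedWords k (n + 1)).filter fun w => w 0 = a).card = (2 * k - 1) ^ n := by
  induction n with
  | zero =>
    rw [pow_zero, Finset.card_eq_one]
    refine ⟨fun _ => a, ?_⟩
    ext w
    simp only [Finset.mem_filter, mem_reducedWords_iff, reduce_ofFn_eq_self_iff,
      Finset.mem_singleton]
    constructor
    · rintro ⟨-, h⟩
      funext i
      rw [Fin.fin_one_eq_zero i, h]
    · rintro rfl
      exact ⟨fun i hi => absurd hi (by omega), rfl⟩
  | succ n ih =>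
    set T : Finset (Σ _ : Fin (n + 1) → Fin k × Bool, Fin k × Bool) :=
      ((reducedWords k (n + 1)).filter fun w => w 0 = a).sigma fun u =>
        Finset.univ.filter fun x : Fin k × Bool =>
          (u (Fin.last n)).1 = x.1 → (u (Fin.last n)).2 = x.2 with hT
    have hTcard : T.card = (2 * k - 1) ^ (n + 1) := by
      rw [hT, Finset.card_sigma,
        Finset.sum_congr rfl fun u _ => card_filter_ne_inv_letter k (u (Fin.last n)),
        Finset.sum_const, smul_eq_mul, ih, pow_succ]
    rw [← hTcard]
    refine Finset.card_nbij' (fun w => ⟨Fin.init w, w (Fin.last (n + 1))⟩)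
      (fun ux => Fin.snoc ux.1 ux.2) ?_ ?_ ?_ ?_
    · intro w hw
      simp only [Finset.coe_filter, Set.mem_setOf_eq, mem_reducedWords_iff,
        reduce_ofFn_eq_self_iff_fin] at hw
      obtain ⟨hw, h0⟩ := hw
      simp only [hT, Finset.coe_sigma, Set.mem_sigma_iff, Finset.coe_filter, Set.mem_setOf_eq,
        mem_reducedWords_iff, reduce_ofFn_eq_self_iff_fin, Finset.mem_univ, true_and]
      refine ⟨⟨fun i => ?_, ?_⟩, ?_⟩
      · simpa only [Fin.init, Fin.succ_castSucc] using hw i.castSucc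
      · simpa only [Fin.init, Fin.castSucc_zero] using h0
      · simpa only [Fin.init, Fin.succ_last] using hw (Fin.last n)
    · rintro ⟨u, x⟩ hux
      simp only [hT, Finset.coe_sigma, Set.mem_sigma_iff, Finset.coe_filter, Set.mem_setOf_eq,
        mem_reducedWords_iff, reduce_ofFn_eq_self_iff_fin, Finset.mem_univ, true_and] at hux
      obtain ⟨⟨hu, h0⟩, hx⟩ := hux
      simp only [Finset.coe_filter, Set.mem_setOf_eq, mem_reducedWords_iff,
        reduce_ofFn_eq_self_iff_fin, Fin.snoc_apply_zero]
      refine ⟨fun i => ?_, h0⟩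
      rcases Fin.eq_castSucc_or_eq_last i with ⟨j, rfl⟩ | rfl
      · simpa only [Fin.succ_castSucc, Fin.snoc_castSucc] using hu j
      · simpa only [Fin.succ_last, Fin.snoc_last, Fin.snoc_castSucc] using hx
    · intro w _
      exact Fin.snoc_init_self w
    · rintro ⟨u, x⟩ _
      simp only [Fin.init_snoc, Fin.snoc_last]

/-- At length `1`: the reduced words with first letter `a` and last letter `b` number `[a = b]`.
[folklore] -/
theorem card_filter_ends_zero (k : ℕ) (a b : Fin k × Bool) :
    ((reducedWords k 1).filter fun w => w 0 = a ∧ w (Fin.last 0) = b).card =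
      if b = a then 1 else 0 := by
  have h1 := card_reducedWords_filter_head k 0 a
  rw [pow_zero, Finset.card_eq_one] at h1
  obtain ⟨w₀, hw₀⟩ := h1
  have hfilter : ((reducedWords k 1).filter fun w => w 0 = a ∧ w (Fin.last 0) = b) =
      ((reducedWords k 1).filter fun w => w 0 = a).filter fun w => w 0 = b := by
    rw [Finset.filter_filter]
    rfl
  rw [hfilter, hw₀, Finset.filter_singleton]
  have ha : w₀ 0 = a := by
    have : w₀ ∈ ({w₀} : Finset (Fin 1 → Fin k × Bool)) := Finset.mem_singleton_self w₀
    rw [← hw₀, Finset.mem_filter] at this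
    exact this.2
  rw [ha]
  by_cases hab : b = a
  · subst hab
    simp
  · rw [if_neg (Ne.symm hab), if_neg hab, Finset.card_empty]

/-- Non-compatibility with `b` of a preceding letter `c` means `c = b⁻¹`. [folklore] -/
theorem not_compatible_iff {k : ℕ} (c b : Fin k × Bool) :
    ¬ (c.1 = b.1 → c.2 = b.2) ↔ c = (b.1, !b.2) := by
  obtain ⟨c1, c2⟩ := c
  obtain ⟨b1, b2⟩ := b
  cases c2 <;> cases b2 <;> simp

/-- **Transfer recursion.** Writing `N_n(a,b)` for the number of reduced words of length `n + 1`
from `a` to `b`: `N_{n+1}(a,b) + N_n(a,b⁻¹) = (2k−1)ⁿ` — a reduced word of length `n + 2` ending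
in `b` is a reduced word of length `n + 1` not ending in `b⁻¹`, followed by `b`.
[cite: CalegariWalker2013, Lemma 2.4 (proof)] -/
theorem card_filter_ends_succ_add (k n : ℕ) (a b : Fin k × Bool) :
    ((reducedWords k (n + 2)).filter fun w => w 0 = a ∧ w (Fin.last (n + 1)) = b).card +
      ((reducedWords k (n + 1)).filter fun w => w 0 = a ∧ w (Fin.last n) = (b.1, !b.2)).card =
        (2 * k - 1) ^ n := by
  set S := (reducedWords k (n + 1)).filter fun w => w 0 = a with hS
  -- the words counted first ↔ `u ∈ S` whose last letter is compatible with `b` (append `b`)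
  have h1 : ((reducedWords k (n + 2)).filter fun w => w 0 = a ∧ w (Fin.last (n + 1)) = b).card =
      (S.filter fun u => (u (Fin.last n)).1 = b.1 → (u (Fin.last n)).2 = b.2).card := by
    refine Finset.card_nbij' (fun w => Fin.init w) (fun u => Fin.snoc u b) ?_ ?_ ?_ ?_
    · intro w hw
      simp only [Finset.coe_filter, Set.mem_setOf_eq, mem_reducedWords_iff,
        reduce_ofFn_eq_self_iff_fin] at hw
      obtain ⟨hw, h0, hb⟩ := hw
      simp only [hS, Finset.coe_filter, Set.mem_setOf_eq, Finset.mem_filter,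
        mem_reducedWords_iff, reduce_ofFn_eq_self_iff_fin]
      refine ⟨⟨fun i => ?_, ?_⟩, ?_⟩
      · simpa only [Fin.init, Fin.succ_castSucc] using hw i.castSucc
      · simpa only [Fin.init, Fin.castSucc_zero] using h0
      · simpa only [Fin.init, Fin.succ_last, hb] using hw (Fin.last n)
    · intro u hu
      simp only [hS, Finset.coe_filter, Set.mem_setOf_eq, Finset.mem_filter,
        mem_reducedWords_iff, reduce_ofFn_eq_self_iff_fin] at hu
      obtain ⟨⟨hu, h0⟩, hb⟩ := hu
      simp only [Finset.coe_filter, Set.mem_setOf_eq, mem_reducedWords_iff,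
        reduce_ofFn_eq_self_iff_fin, Fin.snoc_apply_zero, Fin.snoc_last]
      refine ⟨fun i => ?_, h0, trivial⟩
      rcases Fin.eq_castSucc_or_eq_last i with ⟨j, rfl⟩ | rfl
      · simpa only [Fin.succ_castSucc, Fin.snoc_castSucc] using hu j
      · simpa only [Fin.succ_last, Fin.snoc_last, Fin.snoc_castSucc] using hb
    · intro w hw
      simp only [Finset.coe_filter, Set.mem_setOf_eq] at hw
      conv_rhs => rw [← Fin.snoc_init_self w]
      rw [hw.2.2]
    · intro u _
      exact Fin.init_snoc _ _
  -- the words counted second are the `u ∈ S` whose last letter is NOT compatible with `b`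
  have h2 : ((reducedWords k (n + 1)).filter fun w => w 0 = a ∧ w (Fin.last n) = (b.1, !b.2)) =
      S.filter fun u => ¬ ((u (Fin.last n)).1 = b.1 → (u (Fin.last n)).2 = b.2) := by
    rw [hS, Finset.filter_filter]
    exact Finset.filter_congr fun u _ => by rw [not_compatible_iff]
  rw [h1, h2, Finset.card_filter_add_card_filter_not, hS, card_reducedWords_filter_head]

/-- `b⁻¹ = a⁽ⁿ⁾ ↔ b = a⁽ⁿ⁺¹⁾` for the alternating letter `a⁽ⁿ⁾` (`a` for even `n`, `a⁻¹` for odd `n`).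
[folklore] -/
theorem inv_eq_alt_iff {k : ℕ} (n : ℕ) (a b : Fin k × Bool) :
    ((b.1, !b.2) = if Even n then a else (a.1, !a.2)) ↔
      (b = if Even (n + 1) then a else (a.1, !a.2)) := by
  obtain ⟨a1, a2⟩ := a
  obtain ⟨b1, b2⟩ := b
  by_cases hn : Even n
  · have hn1 : ¬ Even (n + 1) := by rwa [Nat.even_add_one, not_not]
    simp only [if_pos hn, if_neg hn1, Prod.mk.injEq]
    cases a2 <;> cases b2 <;> simp
  · have hn1 : Even (n + 1) := by rwa [Nat.even_add_one]
    simp only [if_neg hn, if_pos hn1, Prod.mk.injEq]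
    cases a2 <;> cases b2 <;> simp

/-- **Closed form of the two-ended count** (the entries of `Mⁿ = ((2k−1)ⁿ − (−1)ⁿ)/2k · J + (−1)ⁿ Pⁿ`
for the transfer matrix `M = J − P`): with `N_n(a,b)` the number of reduced words of length
`n + 1` with first letter `a` and last letter `b`,
`2k · N_n(a,b) = (2k−1)ⁿ − (−1)ⁿ + 2k(−1)ⁿ·[b = a⁽ⁿ⁾]`, where `a⁽ⁿ⁾ = a` for even `n` and `a⁻¹`
for odd `n`. This makes the two claims in the proof of loc. cit. Lemma 2.4 quantitative.
[cite: CalegariWalker2013, Lemma 2.4 (proof)] -/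
theorem two_mul_card_filter_ends (k n : ℕ) (a b : Fin k × Bool) :
    (2 * k : ℤ) * ((reducedWords k (n + 1)).filter fun w => w 0 = a ∧ w (Fin.last n) = b).card =
      (2 * k - 1 : ℤ) ^ n - (-1) ^ n +
        (if b = (if Even n then a else (a.1, !a.2)) then (2 * k : ℤ) * (-1) ^ n else 0) := by
  have hk : 1 ≤ k := a.1.pos
  induction n generalizing b with
  | zero =>
    rw [card_filter_ends_zero]
    simp only [Even.zero, if_true, pow_zero, sub_self, zero_add, mul_one]
    split_ifs <;> simp
  | succ n ih =>
    have hrec : ((reducedWords k (n + 1 + 1)).filter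
        fun w => w 0 = a ∧ w (Fin.last (n + 1)) = b).card +
        ((reducedWords k (n + 1)).filter fun w => w 0 = a ∧ w (Fin.last n) = (b.1, !b.2)).card =
          (2 * k - 1) ^ n :=
      card_filter_ends_succ_add k n a b
    have hrec' : (((reducedWords k (n + 1 + 1)).filter
        fun w => w 0 = a ∧ w (Fin.last (n + 1)) = b).card : ℤ) =
        (2 * k - 1 : ℤ) ^ n - ((reducedWords k (n + 1)).filter
          fun w => w 0 = a ∧ w (Fin.last n) = (b.1, !b.2)).card := by
      have h := congrArg (fun m : ℕ => (m : ℤ)) hrec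
      push_cast [Nat.cast_sub (by omega : 1 ≤ 2 * k)] at h
      linarith
    have ih' := ih (b.1, !b.2)
    rw [hrec', mul_sub, ih']
    have hiff := inv_eq_alt_iff n a b
    by_cases hc : (b.1, !b.2) = if Even n then a else (a.1, !a.2)
    · rw [if_pos hc, if_pos (hiff.mp hc)]
      ring
    · rw [if_neg hc, if_neg fun h => hc (hiff.mpr h)]
      ring

/-- **Calegari–Walker Lemma 2.4, first claim** (`u_m(a,b) = u_m(a,c)` if neither of `b, c` equals
`a^{(−1)^{m+1}}`): the number of reduced words of length `n + 1` from `a` to `b` is the same for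
all `b ≠ a⁽ⁿ⁾`. [cite: CalegariWalker2013, Lemma 2.4] -/
theorem card_filter_ends_eq_of_ne (k n : ℕ) (a b c : Fin k × Bool)
    (hb : b ≠ if Even n then a else (a.1, !a.2)) (hc : c ≠ if Even n then a else (a.1, !a.2)) :
    ((reducedWords k (n + 1)).filter fun w => w 0 = a ∧ w (Fin.last n) = b).card =
      ((reducedWords k (n + 1)).filter fun w => w 0 = a ∧ w (Fin.last n) = c).card := by
  have hk : (0 : ℤ) < 2 * k := by have := a.1.pos; positivity
  have h1 := two_mul_card_filter_ends k n a b
  have h2 := two_mul_card_filter_ends k n a c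
  rw [if_neg hb] at h1
  rw [if_neg hc] at h2
  have h : (2 * k : ℤ) * ((reducedWords k (n + 1)).filter fun w => w 0 = a ∧ w (Fin.last n) = b).card
      = (2 * k : ℤ) * ((reducedWords k (n + 1)).filter
          fun w => w 0 = a ∧ w (Fin.last n) = c).card := by rw [h1, h2]
  exact_mod_cast mul_left_cancel₀ hk.ne' h

/-- **Calegari–Walker Lemma 2.4, second claim, sharpened**: the exceptional count exceeds the
generic one by exactly `(−1)ⁿ`: `N_n(a,a⁽ⁿ⁾) = N_n(a,b) + (−1)ⁿ` for `b ≠ a⁽ⁿ⁾`.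
[cite: CalegariWalker2013, Lemma 2.4] -/
theorem card_filter_ends_alt_eq (k n : ℕ) (a b : Fin k × Bool)
    (hb : b ≠ if Even n then a else (a.1, !a.2)) :
    (((reducedWords k (n + 1)).filter fun w =>
        w 0 = a ∧ w (Fin.last n) = if Even n then a else (a.1, !a.2)).card : ℤ) =
      ((reducedWords k (n + 1)).filter fun w => w 0 = a ∧ w (Fin.last n) = b).card + (-1) ^ n := by
  have hk : (0 : ℤ) < 2 * k := by have := a.1.pos; positivity
  have h1 := two_mul_card_filter_ends k n a (if Even n then a else (a.1, !a.2))
  have h2 := two_mul_card_filter_ends k n a b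
  rw [if_pos rfl] at h1
  rw [if_neg hb] at h2
  refine mul_left_cancel₀ hk.ne' ?_
  rw [h1, mul_add, h2]
  ring

/-- The generic count is large: `2k · N_n(a,b) = (2k−1)ⁿ − (−1)ⁿ ≥ 2k (2k−2)^{n−1}` for `n ≥ 1`,
`k ≥ 2` — so the relative deviation `|N_n(a,a⁽ⁿ⁾)/N_n(a,b) − 1| = 1/N_n(a,b)` is at most
`(2k−2)^{−(n−1)}`, which is loc. cit. Lemma 2.4 (ii) (`m = n − 1`). [cite: CalegariWalker2013, Lemma 2.4] -/
theorem pow_sub_neg_one_pow_ge (k m : ℕ) (hk : 2 ≤ k) :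
    (2 * k : ℤ) * (2 * k - 2) ^ m ≤ (2 * k - 1 : ℤ) ^ (m + 1) - (-1) ^ (m + 1) := by
  induction m with
  | zero => simp
  | succ m ih =>
    have hx : (2 : ℤ) ≤ 2 * k - 2 := by linarith [show (2 : ℤ) ≤ k by exact_mod_cast hk]
    have hxm : (1 : ℤ) ≤ (2 * k - 2) ^ m := one_le_pow₀ (by linarith)
    have hsq : ((-1 : ℤ) ^ (m + 1)) * ((-1 : ℤ) ^ (m + 1)) = 1 := by
      rw [← mul_pow, neg_one_mul, neg_neg, one_pow]
    rcases neg_one_pow_eq_or ℤ (m + 1) with h | h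
    · rw [pow_succ (-1 : ℤ), h, pow_succ (2 * k - 1 : ℤ), pow_succ (2 * k - 2 : ℤ)]
      rw [h] at ih
      nlinarith
    · rw [pow_succ (-1 : ℤ), h, pow_succ (2 * k - 1 : ℤ), pow_succ (2 * k - 2 : ℤ)]
      rw [h] at ih
      nlinarith

/-- **Calegari–Walker Lemma 2.4 (ii)**, ratio form: for `k ≥ 2`, `n ≥ 1` and `b ≠ a⁽ⁿ⁾`,
`|N_n(a,a⁽ⁿ⁾)/N_n(a,b) − 1| ≤ (2k−2)^{−(n−1)}` ("`|u_m(a,a^{∓})/u_m(a,b) − 1| ≤ (2k−2)^{−m}`",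
`m = n − 1`). [cite: CalegariWalker2013, Lemma 2.4] -/
theorem abs_card_filter_ends_div_sub_one_le (k n : ℕ) (hk : 2 ≤ k) (hn : 1 ≤ n)
    (a b : Fin k × Bool) (hb : b ≠ if Even n then a else (a.1, !a.2)) :
    |((((reducedWords k (n + 1)).filter fun w =>
          w 0 = a ∧ w (Fin.last n) = if Even n then a else (a.1, !a.2)).card : ℕ) : ℝ) /
        ((((reducedWords k (n + 1)).filter fun w => w 0 = a ∧ w (Fin.last n) = b).card : ℕ) : ℝ)
        - 1| ≤ ((2 * k - 2 : ℝ) ^ (n - 1))⁻¹ := by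
  obtain ⟨m, rfl⟩ : ∃ m, n = m + 1 := ⟨n - 1, by omega⟩
  set N : ℕ := ((reducedWords k (m + 1 + 1)).filter
    fun w => w 0 = a ∧ w (Fin.last (m + 1)) = b).card with hN
  have hclosed := two_mul_card_filter_ends k (m + 1) a b
  rw [if_neg hb, add_zero, ← hN] at hclosed
  have hlow := pow_sub_neg_one_pow_ge k m hk
  rw [← hclosed] at hlow
  -- so `(2k-2)^m ≤ N`, in particular `N > 0`
  have hk0 : (0 : ℤ) < 2 * k := by positivity
  have hNm : ((2 * k - 2 : ℤ)) ^ m ≤ (N : ℤ) := le_of_mul_le_mul_left hlow hk0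
  have hx : (2 : ℝ) ≤ 2 * k - 2 := by linarith [show (2 : ℝ) ≤ k by exact_mod_cast hk]
  have hxm : (1 : ℝ) ≤ (2 * k - 2 : ℝ) ^ m := one_le_pow₀ (by linarith)
  have hNm' : ((2 * k - 2 : ℝ)) ^ m ≤ (N : ℝ) := by exact_mod_cast hNm
  have hNpos : (0 : ℝ) < N := by linarith
  have halt := card_filter_ends_alt_eq k (m + 1) a b hb
  rw [← hN] at halt
  have halt' : ((((reducedWords k (m + 1 + 1)).filter fun w =>
      w 0 = a ∧ w (Fin.last (m + 1)) = if Even (m + 1) then a else (a.1, !a.2)).card : ℕ) : ℝ) =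
      (N : ℝ) + (-1) ^ (m + 1) := by exact_mod_cast halt
  rw [halt', show m + 1 - 1 = m from rfl, add_div, div_self hNpos.ne', add_sub_cancel_left,
    abs_div, abs_neg_one_pow, abs_of_pos hNpos, one_div]
  exact inv_anti₀ (by linarith) hNm'

end EndLetters

/-! ### §2.4: subwords of a random reduced word are uniform

"Since `v` contains `n − |σ| + 1` subwords of length `|σ|`, the 'expected' number of copies of `σ`
in `v` is `(n − |σ| + 1)/|F_{|σ|}|`" (loc. cit. §2.4): for the uniform measure on `F_n` the
subword of length `L` at any fixed position is EXACTLY uniformly distributed on `F_L`. We prove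
the underlying counts: appending (`card_filter_init`) or prepending (`card_filter_tail`) a letter
multiplies any count by `2k − 1`; a reduced word has `(2k−1)ᵗ` reduced right-extensions by `t`
letters (`card_filter_prefix`); and the number of `w ∈ F_n` with a prescribed reduced subword `σ`
of length `L ≥ 1` at a prescribed position is `(2k−1)^{n−L}` (`card_filter_window`), i.e.
`|{w ∈ F_n : w[i,i+L) = σ}| · |F_L| = |F_n|` (`card_filter_window_mul_card`). -/

section Windows

open scoped Classical

/-- **Appending a letter.** For any property `P` of words of length `N ≥ 1`, the reduced words of
length `N + 1` whose initial segment has `P` number `2k − 1` times the reduced words of length `N`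
with `P` (the last letter avoids one of `2k`). [folklore] -/
theorem card_filter_init (k : ℕ) {N : ℕ} (hN : N ≠ 0) (P : (Fin N → Fin k × Bool) → Prop)
    [DecidablePred P] :
    ((reducedWords k (N + 1)).filter fun w => P (Fin.init w)).card =
      ((reducedWords k N).filter P).card * (2 * k - 1) := by
  obtain ⟨n, rfl⟩ := Nat.exists_eq_succ_of_ne_zero hN
  set T : Finset (Σ _ : Fin (n + 1) → Fin k × Bool, Fin k × Bool) :=
    ((reducedWords k (n + 1)).filter P).sigma fun u =>
      Finset.univ.filter fun x : Fin k × Bool =>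
        (u (Fin.last n)).1 = x.1 → (u (Fin.last n)).2 = x.2 with hT
  have hTcard : T.card = ((reducedWords k (n + 1)).filter P).card * (2 * k - 1) := by
    rw [hT, Finset.card_sigma,
      Finset.sum_congr rfl fun u _ => card_filter_ne_inv_letter k (u (Fin.last n)),
      Finset.sum_const, smul_eq_mul]
  rw [← hTcard]
  refine Finset.card_nbij' (fun w => ⟨Fin.init w, w (Fin.last (n + 1))⟩)
    (fun ux => Fin.snoc ux.1 ux.2) ?_ ?_ ?_ ?_
  · intro w hw
    simp only [Finset.coe_filter, Set.mem_setOf_eq, mem_reducedWords_iff,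
      reduce_ofFn_eq_self_iff_fin] at hw
    obtain ⟨hw, hP⟩ := hw
    simp only [hT, Finset.coe_sigma, Set.mem_sigma_iff, Finset.coe_filter, Set.mem_setOf_eq,
      mem_reducedWords_iff, reduce_ofFn_eq_self_iff_fin, Finset.mem_univ, true_and]
    refine ⟨⟨fun i => ?_, hP⟩, ?_⟩
    · simpa only [Fin.init, Fin.succ_castSucc] using hw i.castSucc
    · simpa only [Fin.init, Fin.succ_last] using hw (Fin.last n)
  · rintro ⟨u, x⟩ hux
    simp only [hT, Finset.coe_sigma, Set.mem_sigma_iff, Finset.coe_filter, Set.mem_setOf_eq,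
      mem_reducedWords_iff, reduce_ofFn_eq_self_iff_fin, Finset.mem_univ, true_and] at hux
    obtain ⟨⟨hu, hP⟩, hx⟩ := hux
    simp only [Finset.coe_filter, Set.mem_setOf_eq, mem_reducedWords_iff,
      reduce_ofFn_eq_self_iff_fin, Fin.init_snoc]
    refine ⟨fun i => ?_, hP⟩
    rcases Fin.eq_castSucc_or_eq_last i with ⟨j, rfl⟩ | rfl
    · simpa only [Fin.succ_castSucc, Fin.snoc_castSucc] using hu j
    · simpa only [Fin.succ_last, Fin.snoc_last, Fin.snoc_castSucc] using hx
  · intro w _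
    exact Fin.snoc_init_self w
  · rintro ⟨u, x⟩ _
    simp only [Fin.init_snoc, Fin.snoc_last]

/-- The letters that may precede a given letter `c` in a reduced word number `2k − 1`. [folklore] -/
theorem card_filter_ne_inv_letter' (k : ℕ) (c : Fin k × Bool) :
    (Finset.univ.filter fun x : Fin k × Bool => x.1 = c.1 → x.2 = c.2).card = 2 * k - 1 := by
  rw [← card_filter_ne_inv_letter k c]
  exact congrArg Finset.card (Finset.filter_congr fun x _ => by rw [eq_comm, @eq_comm _ x.2])

/-- **Prepending a letter.** For any property `P` of words of length `N ≥ 1`, the reduced words of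
length `N + 1` whose tail has `P` number `2k − 1` times the reduced words of length `N` with `P`.
[folklore] -/
theorem card_filter_tail (k : ℕ) {N : ℕ} (hN : N ≠ 0) (P : (Fin N → Fin k × Bool) → Prop)
    [DecidablePred P] :
    ((reducedWords k (N + 1)).filter fun w => P (Fin.tail w)).card =
      (2 * k - 1) * ((reducedWords k N).filter P).card := by
  obtain ⟨n, rfl⟩ := Nat.exists_eq_succ_of_ne_zero hN
  set T : Finset (Σ _ : Fin (n + 1) → Fin k × Bool, Fin k × Bool) :=
    ((reducedWords k (n + 1)).filter P).sigma fun u =>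
      Finset.univ.filter fun x : Fin k × Bool => x.1 = (u 0).1 → x.2 = (u 0).2 with hT
  have hTcard : T.card = (2 * k - 1) * ((reducedWords k (n + 1)).filter P).card := by
    rw [hT, Finset.card_sigma,
      Finset.sum_congr rfl fun u _ => card_filter_ne_inv_letter' k (u 0),
      Finset.sum_const, smul_eq_mul, mul_comm]
  rw [← hTcard]
  refine Finset.card_nbij' (fun w => ⟨Fin.tail w, w 0⟩)
    (fun ux => Fin.cons ux.2 ux.1) ?_ ?_ ?_ ?_
  · intro w hw
    simp only [Finset.coe_filter, Set.mem_setOf_eq, mem_reducedWords_iff,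
      reduce_ofFn_eq_self_iff_fin] at hw
    obtain ⟨hw, hP⟩ := hw
    simp only [hT, Finset.coe_sigma, Set.mem_sigma_iff, Finset.coe_filter, Set.mem_setOf_eq,
      mem_reducedWords_iff, reduce_ofFn_eq_self_iff_fin, Finset.mem_univ, true_and]
    refine ⟨⟨fun i => ?_, hP⟩, ?_⟩
    · simpa only [Fin.tail, ← Fin.succ_castSucc] using hw i.succ
    · simpa only [Fin.tail, Fin.castSucc_zero] using hw 0
  · rintro ⟨u, x⟩ hux
    simp only [hT, Finset.coe_sigma, Set.mem_sigma_iff, Finset.coe_filter, Set.mem_setOf_eq,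
      mem_reducedWords_iff, reduce_ofFn_eq_self_iff_fin, Finset.mem_univ, true_and] at hux
    obtain ⟨⟨hu, hP⟩, hx⟩ := hux
    simp only [Finset.coe_filter, Set.mem_setOf_eq, mem_reducedWords_iff,
      reduce_ofFn_eq_self_iff_fin, Fin.tail_cons]
    refine ⟨fun i => ?_, hP⟩
    rcases Fin.eq_zero_or_eq_succ i with rfl | ⟨j, rfl⟩
    · simpa only [Fin.castSucc_zero, Fin.cons_zero, Fin.succ_zero_eq_one, ← Fin.succ_zero_eq_one,
        Fin.cons_succ] using hx
    · simpa only [← Fin.succ_castSucc, Fin.cons_succ] using hu j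
  · intro w _
    exact Fin.cons_self_tail w
  · rintro ⟨u, x⟩ _
    simp only [Fin.tail_cons, Fin.cons_zero]

/-- **Right extensions.** A reduced word `u` of length `L + 1` has exactly `(2k−1)ᵗ` reduced
extensions to a word of length `L + 1 + t` with prefix `u`. [folklore] -/
theorem card_filter_prefix (k L t : ℕ) (u : Fin (L + 1) → Fin k × Bool)
    (hu : u ∈ reducedWords k (L + 1)) :
    ((reducedWords k (L + 1 + t)).filter fun w =>
        ∀ j : Fin (L + 1), w ⟨j, by omega⟩ = u j).card = (2 * k - 1) ^ t := by
  induction t with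
  | zero =>
    rw [pow_zero, Finset.card_eq_one]
    refine ⟨u, ?_⟩
    ext w
    simp only [Finset.mem_filter, Finset.mem_singleton]
    constructor
    · rintro ⟨-, h⟩
      funext j
      exact h j
    · rintro rfl
      exact ⟨hu, fun j => rfl⟩
  | succ t ih =>
    have h := card_filter_init k (N := L + 1 + t) (by omega)
      (fun v => ∀ j : Fin (L + 1), v ⟨j, by omega⟩ = u j)
    rw [ih] at h
    rw [pow_succ]
    exact h

/-- **Subwords at a fixed position are uniform.** For a reduced word `σ` of length `L + 1` and a
position `i`, the reduced words of length `L + 1 + t + i` carrying `σ` at positions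
`i, …, i + L` number `(2k−1)^{t+i}` — independently of `σ` and of `i`. [cite: CalegariWalker2013, §2.4] -/
theorem card_filter_window (k L t i : ℕ) (σ : Fin (L + 1) → Fin k × Bool)
    (hσ : σ ∈ reducedWords k (L + 1)) :
    ((reducedWords k (L + 1 + t + i)).filter fun w =>
        ∀ j : Fin (L + 1), w ⟨i + j, by omega⟩ = σ j).card = (2 * k - 1) ^ (t + i) := by
  induction i with
  | zero =>
    calc ((reducedWords k (L + 1 + t + 0)).filter fun w =>
          ∀ j : Fin (L + 1), w ⟨0 + j, by omega⟩ = σ j).card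
        = ((reducedWords k (L + 1 + t)).filter fun w =>
            ∀ j : Fin (L + 1), w ⟨j, by omega⟩ = σ j).card := by
          refine congrArg Finset.card (Finset.filter_congr fun w _ => forall_congr' fun j => ?_)
          simp only [Nat.zero_add]
      _ = (2 * k - 1) ^ (t + 0) := by
          rw [add_zero]
          exact card_filter_prefix k L t σ hσ
  | succ i ih =>
    have h := card_filter_tail k (N := L + 1 + t + i) (by omega)
      (fun v => ∀ j : Fin (L + 1), v ⟨i + j, by omega⟩ = σ j)
    rw [ih] at h
    calc ((reducedWords k (L + 1 + t + (i + 1))).filter fun w =>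
          ∀ j : Fin (L + 1), w ⟨i + 1 + j, by omega⟩ = σ j).card
        = ((reducedWords k (L + 1 + t + i + 1)).filter fun w =>
            ∀ j : Fin (L + 1), Fin.tail w ⟨i + j, by omega⟩ = σ j).card := by
          refine congrArg Finset.card (Finset.filter_congr fun w _ => forall_congr' fun j => ?_)
          simp only [Fin.tail, Fin.succ_mk, show i + 1 + (j : ℕ) = i + j + 1 by omega]
      _ = (2 * k - 1) * (2 * k - 1) ^ (t + i) := h
      _ = (2 * k - 1) ^ (t + (i + 1)) := by ring

/-- The same count for words of any length `n ≥ i + (L + 1)`: the `w ∈ F_n` with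
`w[i, i + L] = σ` number `(2k−1)^{n−(L+1)}`. [cite: CalegariWalker2013, §2.4] -/
theorem card_filter_window' (k L n i : ℕ) (h : i + (L + 1) ≤ n) (σ : Fin (L + 1) → Fin k × Bool)
    (hσ : σ ∈ reducedWords k (L + 1)) :
    ((reducedWords k n).filter fun w =>
        ∀ j : Fin (L + 1), w ⟨i + j, by omega⟩ = σ j).card = (2 * k - 1) ^ (n - (L + 1)) := by
  obtain ⟨t, rfl⟩ : ∃ t, n = L + 1 + t + i := ⟨n - (L + 1) - i, by omega⟩
  rw [card_filter_window k L t i σ hσ, show L + 1 + t + i - (L + 1) = t + i by omega]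

/-- **Uniformity of subwords, probability form**: `|{w ∈ F_n : w[i,i+L] = σ}| · |F_{L+1}| = |F_n|`,
i.e. under the uniform measure on `F_n` the subword of length `L + 1` at position `i` is uniformly
distributed on `F_{L+1}` (so the expected number of copies of `σ` in `v` is `(n − |σ| + 1)/|F_{|σ|}|`,
loc. cit. §2.4). [cite: CalegariWalker2013, §2.4] -/
theorem card_filter_window_mul_card (k L n i : ℕ) (h : i + (L + 1) ≤ n)
    (σ : Fin (L + 1) → Fin k × Bool) (hσ : σ ∈ reducedWords k (L + 1)) :
    ((reducedWords k n).filter fun w => ∀ j : Fin (L + 1), w ⟨i + j, by omega⟩ = σ j).card *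
        (reducedWords k (L + 1)).card = (reducedWords k n).card := by
  rw [card_filter_window' k L n i h σ hσ, card_reducedWords k (by omega : 1 ≤ L + 1),
    card_reducedWords k (by omega : 1 ≤ n), show L + 1 - 1 = L from rfl]
  obtain ⟨t, rfl⟩ : ∃ t, n = L + 1 + t := ⟨n - (L + 1), by omega⟩
  rw [show L + 1 + t - (L + 1) = t by omega, show L + 1 + t - 1 = L + t by omega, pow_add]
  ring

end Windows

/-! ### Non-vacuity of the random model: `F_n' ≠ ∅` for even `n ≥ 4` -/

section NonVacuous

open scoped Classical

/-- For `k ≥ 2` and even `n ≥ 4` the set `F_n'` of reduced words of length `n` in `[F,F]` is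
non-empty: it contains `x₁ᵃ x₂ x₁⁻ᵃ x₂⁻¹ = [x₁ᵃ, x₂]` with `n = 2a + 2`. (Odd `n` give `F_n' = ∅`,
`commutatorWords_eq_empty_of_odd`; so does `n = 2`.) Hence the Random Rigidity Theorem speaks about
a non-empty probability space for every even `n ≥ 4`. [folklore] -/
theorem commutatorWords_nonempty {k n : ℕ} (hk : 2 ≤ k) (hn : 4 ≤ n) (he : Even n) :
    (commutatorWords k n).Nonempty := by
  obtain ⟨r, rfl⟩ := he
  obtain ⟨a, rfl⟩ : ∃ a, r = a + 1 := ⟨r - 1, by omega⟩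
  have ha : a ≠ 0 := by omega
  -- the letters `x₁^{±1}`, `x₂^{±1}`
  set x : Fin k × Bool := (⟨0, by omega⟩, true) with hx
  set X : Fin k × Bool := (⟨0, by omega⟩, false) with hX
  set y : Fin k × Bool := (⟨1, by omega⟩, true) with hy
  set Y : Fin k × Bool := (⟨1, by omega⟩, false) with hY
  set l : List (Fin k × Bool) :=
    (List.replicate a x ++ [y]) ++ (List.replicate a X ++ [Y]) with hl
  have hlen : l.length = a + 1 + (a + 1) := by
    simp only [hl, List.length_append, List.length_replicate, List.length_singleton]
  refine ⟨fun i => l[i.val]'(by rw [hlen]; exact i.isLt), ?_⟩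
  have hofFn : List.ofFn (fun i : Fin (a + 1 + (a + 1)) => l[i.val]'(by rw [hlen]; exact i.isLt))
      = l := by
    apply List.ext_getElem
    · rw [List.length_ofFn, hlen]
    · intro i h1 h2
      rw [List.getElem_ofFn]
  rw [mem_commutatorWords_iff, hofFn, ← FreeGroup.isReduced_iff_reduce_eq,
    mk_mem_commutator_iff_count]
  have h10 : (⟨1, by omega⟩ : Fin k) ≠ ⟨0, by omega⟩ := by simp
  constructor
  · -- reduced: every adjacent pair is `x x`, `x y`, `y X`, `X X` or `X Y`
    rw [hl, FreeGroup.IsReduced]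
    refine List.IsChain.append (List.IsChain.append (List.isChain_replicate_of_rel a ?_)
      (List.isChain_singleton y) ?_) (List.IsChain.append (List.isChain_replicate_of_rel a ?_)
      (List.isChain_singleton Y) ?_) ?_
    · simp
    · intro p hp q hq
      rw [List.getLast?_replicate, if_neg ha, Option.mem_def, Option.some.injEq] at hp
      simp only [List.head?_cons, Option.mem_def, Option.some.injEq] at hq
      subst hp
      subst hq
      simp [hx, hy]
    · simp
    · intro p hp q hq
      rw [List.getLast?_replicate, if_neg ha, Option.mem_def, Option.some.injEq] at hp
      simp only [List.head?_cons, Option.mem_def, Option.some.injEq] at hq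
      subst hp
      subst hq
      simp [hX, hY]
    · intro p hp q hq
      rw [List.getLast?_append, List.getLast?_singleton, Option.mem_def, Option.some_or,
        Option.some.injEq] at hp
      rw [List.head?_append, List.head?_replicate, if_neg ha, Option.mem_def, Option.some_or,
        Option.some.injEq] at hq
      subst hp
      subst hq
      simp [hy, hX, h10]
  · -- balanced: `x₁` and `x₁⁻¹` occur `a` times each, `x₂` and `x₂⁻¹` once each
    intro c
    simp only [hl, List.count_append, List.count_replicate, List.count_cons, List.count_nil,
      hx, hX, hy, hY, beq_iff_eq, Prod.mk.injEq, and_true, Bool.true_eq_false,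
      Bool.false_eq_true, and_false, if_false, zero_add, add_zero]

end NonVacuous

/-! ### §2.5, Lemma 2.10 (core): conditional on any prefix, a window is at most uniform

"No matter what `v_{<i}` is, there are `(2k−1)^{Lm}` choices for `v_i`, and each occurs with the
uniform probability" (loc. cit. proof of Lemma 2.10). In counts: among the reduced words of length
`n` with a prescribed prefix `p` (of which there are `(2k−1)^{n−|p|}` when `p` is reduced and none
otherwise), those carrying a prescribed word `x` right after the prefix number at most
`(2k−1)^{n−|p|−|x|}`. -/

section ConditionalWindow

open scoped Classical

/-- Reduced words of length `n ≥ L + 1` with a prescribed prefix `u` of length `L + 1` number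
`(2k−1)^{n−(L+1)}` if `u` is reduced. [folklore] -/
theorem card_filter_prefix' (k L n : ℕ) (h : L + 1 ≤ n) (u : Fin (L + 1) → Fin k × Bool)
    (hu : u ∈ reducedWords k (L + 1)) :
    ((reducedWords k n).filter fun w => ∀ j : Fin (L + 1), w ⟨j, by omega⟩ = u j).card =
      (2 * k - 1) ^ (n - (L + 1)) := by
  obtain ⟨t, rfl⟩ : ∃ t, n = L + 1 + t := ⟨n - (L + 1), by omega⟩
  rw [Nat.add_sub_cancel_left]
  exact card_filter_prefix k L t u hu

/-- … and none if `u` is not reduced; in all cases at most `(2k−1)^{n−(L+1)}`. [folklore] -/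
theorem card_filter_prefix_le (k L n : ℕ) (h : L + 1 ≤ n) (u : Fin (L + 1) → Fin k × Bool) :
    ((reducedWords k n).filter fun w => ∀ j : Fin (L + 1), w ⟨j, by omega⟩ = u j).card ≤
      (2 * k - 1) ^ (n - (L + 1)) := by
  by_cases hu : u ∈ reducedWords k (L + 1)
  · exact (card_filter_prefix' k L n h u hu).le
  · have h0 : ((reducedWords k n).filter fun w => ∀ j : Fin (L + 1), w ⟨j, by omega⟩ = u j) = ∅ := by
      refine Finset.filter_eq_empty_iff.mpr fun w hw hwu => hu ?_
      obtain ⟨t, rfl⟩ : ∃ t, n = L + 1 + t := ⟨n - (L + 1), by omega⟩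
      rw [mem_reducedWords_iff, reduce_ofFn_eq_self_iff] at hw ⊢
      intro i hi
      rw [← hwu ⟨i, by omega⟩, ← hwu ⟨i + 1, hi⟩]
      exact hw i (by omega)
    rw [h0, Finset.card_empty]
    exact Nat.zero_le _

/-- **Calegari–Walker Lemma 2.10, the counting core.** Among reduced words of length `n`, those with
a prescribed prefix `p` of length `i + 1` AND a prescribed word `x` of length `ℓ + 1` in positions
`i + 1, …, i + 1 + ℓ` number at most `(2k−1)^{n−(i+1)−(ℓ+1)}` — whatever `p` and `x` are.
[cite: CalegariWalker2013, Lemma 2.10] -/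
theorem card_filter_prefix_window_le (k i ℓ n : ℕ) (h : i + 1 + (ℓ + 1) ≤ n)
    (p : Fin (i + 1) → Fin k × Bool) (x : Fin (ℓ + 1) → Fin k × Bool) :
    ((reducedWords k n).filter fun w =>
        (∀ j : Fin (i + 1), w ⟨j, by omega⟩ = p j) ∧
          ∀ j : Fin (ℓ + 1), w ⟨i + 1 + j, by omega⟩ = x j).card ≤
      (2 * k - 1) ^ (n - (i + 1) - (ℓ + 1)) := by
  have hpx := card_filter_prefix_le k (i + 1 + ℓ) n (by omega)
    (fun j : Fin (i + 1 + ℓ + 1) =>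
      if hj : (j : ℕ) < i + 1 then p ⟨j, hj⟩ else x ⟨j - (i + 1), by omega⟩)
  rw [show n - (i + 1 + ℓ + 1) = n - (i + 1) - (ℓ + 1) by omega] at hpx
  refine le_trans (Finset.card_le_card (Finset.monotone_filter_right _ fun w _ hw => ?_)) hpx
  obtain ⟨hp, hx⟩ := hw
  intro j
  by_cases hj : (j : ℕ) < i + 1
  · rw [dif_pos hj]
    exact hp ⟨j, hj⟩
  · rw [dif_neg hj]
    have hxj := hx ⟨j - (i + 1), by omega⟩
    convert hxj using 2
    exact Fin.ext (show (j : ℕ) = i + 1 + ((j : ℕ) - (i + 1)) by omega)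

/-- **Calegari–Walker Lemma 2.10, conditional-probability form.** For a reduced prefix `p` of length
`i + 1` and any `x` of length `ℓ + 1`: `|{w ∈ F_n : p ⊑ w, w[i+1, i+1+ℓ] = x}| · (2k−1)^{ℓ+1} ≤
|{w ∈ F_n : p ⊑ w}|`, i.e. conditional on `v_{<i+1} = p` the next window equals `x` with probability
at most `(2k−1)^{−(ℓ+1)}`. [cite: CalegariWalker2013, Lemma 2.10] -/
theorem card_filter_prefix_window_mul_le (k i ℓ n : ℕ) (h : i + 1 + (ℓ + 1) ≤ n)
    (p : Fin (i + 1) → Fin k × Bool) (hp : p ∈ reducedWords k (i + 1))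
    (x : Fin (ℓ + 1) → Fin k × Bool) :
    ((reducedWords k n).filter fun w =>
        (∀ j : Fin (i + 1), w ⟨j, by omega⟩ = p j) ∧
          ∀ j : Fin (ℓ + 1), w ⟨i + 1 + j, by omega⟩ = x j).card * (2 * k - 1) ^ (ℓ + 1) ≤
      ((reducedWords k n).filter fun w => ∀ j : Fin (i + 1), w ⟨j, by omega⟩ = p j).card := by
  rw [card_filter_prefix' k i n (by omega) p hp]
  refine (Nat.mul_le_mul_right _ (card_filter_prefix_window_le k i ℓ n h p x)).trans ?_
  rw [← pow_add, show n - (i + 1) - (ℓ + 1) + (ℓ + 1) = n - (i + 1) by omega]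

end ConditionalWindow

/-! ### §2.4, Lemmas 2.4–2.5: windows after a gap (the transfer count)

For the near-independence of distant windows (Lemma 2.4 as used in Lemma 2.5) one needs the exact
number of reduced words with a prescribed prefix `p`, then a free gap of length `g + 1`, then a
prescribed window `x`: it is `N · (2k−1)^{n − |p| − (g+1) − |x|}` where
`N = #{reduced a u b : |u| = g + 1}`, `a` the last letter of `p`, `b` the first letter of `x` — the
two-ended count of `two_mul_card_filter_ends` (`card_filter_prefix_gap_window`). -/

section GapWindow

open scoped Classical

/-- Pointwise description of `Fin.append`. [folklore] -/
theorem fin_append_apply {δ : Type*} {m n : ℕ} (f : Fin m → δ) (g : Fin n → δ) (j : Fin (m + n)) :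
    Fin.append f g j = if h : (j : ℕ) < m then f ⟨j, h⟩ else g ⟨j - m, by omega⟩ := by
  by_cases h : (j : ℕ) < m
  · rw [dif_pos h]
    have hj : j = Fin.castAdd n ⟨j, h⟩ := Fin.ext rfl
    conv_lhs => rw [hj]
    rw [Fin.append_left]
  · rw [dif_neg h]
    have hj : j = Fin.natAdd m ⟨j - m, by omega⟩ := Fin.ext (by simp; omega)
    conv_lhs => rw [hj]
    rw [Fin.append_right]

/-- **Reducedness of a concatenation**: `f ⋆ g` (both non-empty) is reduced iff `f` and `g` are
reduced and the last letter of `f` is compatible with the first letter of `g`. [folklore] -/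
theorem append_mem_reducedWords_iff {k m n : ℕ} (f : Fin (m + 1) → Fin k × Bool)
    (g : Fin (n + 1) → Fin k × Bool) :
    Fin.append f g ∈ reducedWords k (m + 1 + (n + 1)) ↔
      f ∈ reducedWords k (m + 1) ∧ g ∈ reducedWords k (n + 1) ∧
        ((f (Fin.last m)).1 = (g 0).1 → (f (Fin.last m)).2 = (g 0).2) := by
  simp only [mem_reducedWords_iff, ← FreeGroup.isReduced_iff_reduce_eq, List.ofFn_fin_append]
  have h1 : (List.ofFn f).getLast? = some (f (Fin.last m)) := by
    rw [List.ofFn_succ']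
    simp
  have h2 : (List.ofFn g).head? = some (g 0) := by
    rw [List.ofFn_succ]
    rfl
  rw [FreeGroup.IsReduced, List.isChain_append]
  simp only [h1, h2, Option.mem_def, Option.some.injEq, forall_eq']
  exact Iff.rfl

/-- With a non-reduced prefix there are no reduced words. [folklore] -/
theorem card_filter_prefix_eq_zero (k L n : ℕ) (h : L + 1 ≤ n) (u : Fin (L + 1) → Fin k × Bool)
    (hu : u ∉ reducedWords k (L + 1)) :
    ((reducedWords k n).filter fun w => ∀ j : Fin (L + 1), w ⟨j, by omega⟩ = u j).card = 0 := by
  rw [Finset.card_eq_zero]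
  refine Finset.filter_eq_empty_iff.mpr fun w hw hwu => hu ?_
  obtain ⟨t, rfl⟩ : ∃ t, n = L + 1 + t := ⟨n - (L + 1), by omega⟩
  rw [mem_reducedWords_iff, reduce_ofFn_eq_self_iff] at hw ⊢
  intro i hi
  rw [← hwu ⟨i, by omega⟩, ← hwu ⟨i + 1, hi⟩]
  exact hw i (by omega)

/-- **Windows after a gap (the transfer count).** For a reduced prefix `p` of length `i + 1`, a
gap of length `g + 1` and a reduced word `x` of length `ℓ + 1`, the reduced words of length `n`
beginning with `p` and carrying `x` right after the gap number
`N · (2k−1)^{n − (i+1) − (g+1) − (ℓ+1)}`, where `N` is the number of reduced words `a u b` with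
`|u| = g + 1`, `a` = the last letter of `p`, `b` = the first letter of `x` (computed in closed form
by `two_mul_card_filter_ends`). Dividing by `#{w : p ⊑ w} = (2k−1)^{n−(i+1)}` this is the
conditional law of a window given the past, uniform up to the factor
`2k N/(2k−1)^{g+2} = 1 + O((2k−1)^{−(g+2)})` — the decay of correlations of loc. cit. Lemma 2.4.
[cite: CalegariWalker2013, Lemma 2.4] -/
theorem card_filter_prefix_gap_window (k i g ℓ n : ℕ) (h : i + 1 + (g + 1) + (ℓ + 1) ≤ n)
    (p : Fin (i + 1) → Fin k × Bool) (hp : p ∈ reducedWords k (i + 1))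
    (x : Fin (ℓ + 1) → Fin k × Bool) (hx : x ∈ reducedWords k (ℓ + 1)) :
    ((reducedWords k n).filter fun w =>
        (∀ j : Fin (i + 1), w ⟨j, by omega⟩ = p j) ∧
          ∀ j : Fin (ℓ + 1), w ⟨i + 1 + (g + 1) + j, by omega⟩ = x j).card =
      ((reducedWords k (g + 2 + 1)).filter fun v =>
          v 0 = p (Fin.last i) ∧ v (Fin.last (g + 2)) = x 0).card *
        (2 * k - 1) ^ (n - (i + 1 + (g + 1) + (ℓ + 1))) := by
  -- the glued prefixes `G u = p u x`, pointwise
  let G : (Fin (g + 1) → Fin k × Bool) → Fin (i + 1 + (g + 1) + (ℓ + 1)) → Fin k × Bool :=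
    fun u => Fin.append (Fin.append p u) x
  have hG_apply : ∀ u (j : Fin (i + 1 + (g + 1) + (ℓ + 1))), G u j =
      if h1 : (j : ℕ) < i + 1 then p ⟨j, h1⟩ else
        if h2 : (j : ℕ) < i + 1 + (g + 1) then u ⟨j - (i + 1), by omega⟩ else
          x ⟨j - (i + 1 + (g + 1)), by omega⟩ := by
    intro u j
    show Fin.append (Fin.append p u) x j = _
    rw [fin_append_apply]
    by_cases h2 : (j : ℕ) < i + 1 + (g + 1)
    · rw [dif_pos h2, fin_append_apply]
      by_cases h1 : (j : ℕ) < i + 1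
      · rw [dif_pos h1, dif_pos h1]
      · rw [dif_neg h1, dif_neg h1, dif_pos h2]
    · rw [dif_neg h2, dif_neg (by omega), dif_neg h2]
  have hGred : ∀ u : Fin (g + 1) → Fin k × Bool,
      G u ∈ reducedWords k (i + 1 + (g + 1) + (ℓ + 1)) ↔
        u ∈ reducedWords k (g + 1) ∧
          ((p (Fin.last i)).1 = (u 0).1 → (p (Fin.last i)).2 = (u 0).2) ∧
          ((u (Fin.last g)).1 = (x 0).1 → (u (Fin.last g)).2 = (x 0).2) := by
    intro u
    show Fin.append (Fin.append p u) x ∈ reducedWords k (i + 1 + g + 1 + (ℓ + 1)) ↔ _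
    rw [append_mem_reducedWords_iff,
      show (Fin.append p u ∈ reducedWords k (i + 1 + g + 1)) =
        (Fin.append p u ∈ reducedWords k (i + 1 + (g + 1))) from rfl,
      append_mem_reducedWords_iff]
    have e1 : Fin.append p u (Fin.last (i + 1 + g)) = u (Fin.last g) := by
      rw [← Fin.natAdd_last, Fin.append_right]
    rw [e1]
    simp only [hp, hx, true_and]
    tauto
  -- Step A/B: the fibre of `S` over the gap content `u` is the prefix class of `G u`
  let gap : (Fin n → Fin k × Bool) → Fin (g + 1) → Fin k × Bool :=
    fun w j => w ⟨i + 1 + j, by omega⟩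
  have hfib : ∀ u : Fin (g + 1) → Fin k × Bool,
      (((reducedWords k n).filter fun w =>
        (∀ j : Fin (i + 1), w ⟨j, by omega⟩ = p j) ∧
          ∀ j : Fin (ℓ + 1), w ⟨i + 1 + (g + 1) + j, by omega⟩ = x j).filter
        fun w => gap w = u) =
      (reducedWords k n).filter fun w =>
        ∀ j : Fin (i + 1 + (g + 1) + (ℓ + 1)), w ⟨j, by omega⟩ = G u j := by
    intro u
    ext w
    simp only [Finset.mem_filter, and_assoc]
    refine and_congr_right fun _ => ?_
    constructor
    · rintro ⟨hpw, hxw, hgw⟩ j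
      rw [hG_apply]
      by_cases h1 : (j : ℕ) < i + 1
      · rw [dif_pos h1]
        exact hpw ⟨j, h1⟩
      · rw [dif_neg h1]
        by_cases h2 : (j : ℕ) < i + 1 + (g + 1)
        · rw [dif_pos h2]
          have hj : gap w ⟨j - (i + 1), by omega⟩ = u ⟨j - (i + 1), by omega⟩ := by rw [hgw]
          refine Eq.trans ?_ hj
          exact congrArg w (Fin.ext (show (j : ℕ) = i + 1 + ((j : ℕ) - (i + 1)) by omega))
        · rw [dif_neg h2]
          refine Eq.trans ?_ (hxw ⟨j - (i + 1 + (g + 1)), by omega⟩)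
          exact congrArg w (Fin.ext
            (show (j : ℕ) = i + 1 + (g + 1) + ((j : ℕ) - (i + 1 + (g + 1))) by omega))
    · intro hw
      refine ⟨fun j => ?_, fun j => ?_, funext fun j => ?_⟩
      · have hj := hw ⟨j, by omega⟩
        rw [hG_apply, dif_pos j.isLt] at hj
        exact hj
      · have hj := hw ⟨i + 1 + (g + 1) + j, by omega⟩
        rw [hG_apply, dif_neg (by simp; omega), dif_neg (by simp)] at hj
        rw [hj]
        exact congrArg x (Fin.ext (show i + 1 + (g + 1) + (j : ℕ) - (i + 1 + (g + 1)) = j by omega))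
      · have hj := hw ⟨i + 1 + j, by omega⟩
        rw [hG_apply, dif_neg (by simp; omega), dif_pos (by simp; omega)] at hj
        show w ⟨i + 1 + j, _⟩ = u j
        rw [hj]
        exact congrArg u (Fin.ext (show i + 1 + (j : ℕ) - (i + 1) = j by omega))
  -- Step C: each fibre has `(2k-1)^(n-L)` or `0` elements
  have hfibcard : ∀ u : Fin (g + 1) → Fin k × Bool,
      ((((reducedWords k n).filter fun w =>
        (∀ j : Fin (i + 1), w ⟨j, by omega⟩ = p j) ∧
          ∀ j : Fin (ℓ + 1), w ⟨i + 1 + (g + 1) + j, by omega⟩ = x j).filter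
        fun w => gap w = u).card) =
      if G u ∈ reducedWords k (i + 1 + (g + 1) + (ℓ + 1)) then
        (2 * k - 1) ^ (n - (i + 1 + (g + 1) + (ℓ + 1))) else 0 := by
    intro u
    rw [hfib]
    split_ifs with hred
    · exact card_filter_prefix' k (i + 1 + (g + 1) + ℓ) n (by omega) (G u) hred
    · exact card_filter_prefix_eq_zero k (i + 1 + (g + 1) + ℓ) n (by omega) (G u) hred
  -- Step D: sum over the gap contents
  rw [Finset.card_eq_sum_card_fiberwise (f := gap) (t := Finset.univ) fun w _ => Finset.mem_univ _,
    Finset.sum_congr rfl fun u _ => hfibcard u, Finset.sum_ite, Finset.sum_const_zero,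
    add_zero, Finset.sum_const, smul_eq_mul]
  congr 1
  -- Step E: gap contents `u` with `G u` reduced ↔ reduced words `a u b` of length `g + 3`
  set a := p (Fin.last i) with ha
  set b := x 0 with hb
  let fwd : (Fin (g + 1) → Fin k × Bool) → Fin (g + 2 + 1) → Fin k × Bool := fun u j =>
    if (j : ℕ) = 0 then a else if hj : (j : ℕ) ≤ g + 1 then u ⟨j - 1, by omega⟩ else b
  let bwd : (Fin (g + 2 + 1) → Fin k × Bool) → Fin (g + 1) → Fin k × Bool := fun v j =>
    v ⟨j + 1, by omega⟩
  have hfwd0 : ∀ u, fwd u 0 = a := fun u => by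
    show (if ((0 : Fin (g + 2 + 1)) : ℕ) = 0 then a else _) = a
    simp
  have hfwd_mid : ∀ u (t : ℕ) (ht1 : 1 ≤ t) (ht2 : t ≤ g + 1),
      fwd u ⟨t, by omega⟩ = u ⟨t - 1, by omega⟩ := fun u t ht1 ht2 => by
    show (if t = 0 then a else if hj : t ≤ g + 1 then u ⟨t - 1, _⟩ else b) = _
    rw [if_neg (by omega), dif_pos ht2]
  have hfwd_last : ∀ u, fwd u ⟨g + 2, by omega⟩ = b := fun u => by
    show (if g + 2 = 0 then a else if hj : g + 2 ≤ g + 1 then u ⟨g + 2 - 1, _⟩ else b) = b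
    rw [if_neg (by omega), dif_neg (by omega)]
  refine Finset.card_nbij' fwd bwd ?_ ?_ ?_ ?_
  · intro u hu
    rw [Finset.coe_filter, Set.mem_setOf_eq, hGred] at hu
    obtain ⟨-, hured, hau, hub⟩ := hu
    rw [mem_reducedWords_iff, reduce_ofFn_eq_self_iff] at hured
    rw [Finset.coe_filter, Set.mem_setOf_eq]
    refine ⟨?_, hfwd0 u, ?_⟩
    · rw [mem_reducedWords_iff, reduce_ofFn_eq_self_iff]
      intro t ht
      rcases Nat.eq_zero_or_pos t with rfl | ht0
      · -- junction `a | u 0`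
        have e0 : fwd u ⟨0, by omega⟩ = a := hfwd0 u
        have e1 : fwd u ⟨0 + 1, ht⟩ = u 0 := hfwd_mid u 1 le_rfl (by omega)
        rw [e0, e1]
        exact hau
      rcases Nat.lt_or_ge t (g + 1) with htg | htg
      · -- inside `u`
        rw [hfwd_mid u t ht0 htg.le, hfwd_mid u (t + 1) (by omega) (by omega)]
        have := hured (t - 1) (by omega)
        have e : t - 1 + 1 = t + 1 - 1 := by omega
        convert this using 3 <;> simp [e]
      · -- junction `u last | b`
        have ht' : t = g + 1 := by omega
        subst ht'
        rw [hfwd_mid u (g + 1) (by omega) le_rfl, hfwd_last u]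
        exact hub
    · show fwd u (Fin.last (g + 2)) = b
      exact hfwd_last u
  · intro v hv
    rw [Finset.coe_filter, Set.mem_setOf_eq] at hv
    obtain ⟨hvred, hv0, hvl⟩ := hv
    rw [mem_reducedWords_iff, reduce_ofFn_eq_self_iff] at hvred
    rw [Finset.coe_filter, Set.mem_setOf_eq, hGred]
    refine ⟨Finset.mem_univ _, ?_, ?_, ?_⟩
    · rw [mem_reducedWords_iff, reduce_ofFn_eq_self_iff]
      intro t ht
      exact hvred (t + 1) (by omega)
    · have h0 := hvred 0 (by omega)
      rw [show (⟨0, by omega⟩ : Fin (g + 2 + 1)) = 0 from rfl, hv0] at h0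
      exact h0
    · have hl := hvred (g + 1) (by omega)
      rw [show (⟨g + 1 + 1, by omega⟩ : Fin (g + 2 + 1)) = Fin.last (g + 2) from rfl, hvl] at hl
      exact hl
  · intro u _
    funext j
    show fwd u ⟨j.val + 1, _⟩ = u j
    rw [hfwd_mid u (j.val + 1) (by omega) (by omega)]
    exact congrArg u (Fin.ext (show (j : ℕ) + 1 - 1 = j by omega))
  · intro v hv
    rw [Finset.coe_filter, Set.mem_setOf_eq] at hv
    obtain ⟨-, hv0, hvl⟩ := hv
    funext j
    rcases Nat.eq_zero_or_pos j.val with hj0 | hj0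
    · have ej : j = 0 := Fin.ext hj0
      rw [ej, hfwd0, ← hv0]
    rcases Nat.lt_or_ge j.val (g + 2) with hjg | hjg
    · have ej : j = ⟨j.val, j.isLt⟩ := rfl
      rw [ej, hfwd_mid (bwd v) j.val hj0 (by omega)]
      exact congrArg v (Fin.ext (show (j : ℕ) - 1 + 1 = j by omega))
    · have ej : j = Fin.last (g + 2) := Fin.ext (by rw [Fin.val_last]; omega)
      rw [ej]
      exact (hfwd_last (bwd v)).trans hvl.symm

/-- **Conditional law of a window after a gap, exact form.** For a reduced prefix `v` of length
`i + 1` (a fibre of "the past"), a gap `g + 1` and a reduced `σ` of length `ℓ + 1`: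
`(2k−1)^{(g+1)+(ℓ+1)} · #{w : v ⊑ w, σ after the gap} = N(a,b) · #{w : v ⊑ w}` with `N(a,b)` the
two-ended count (`a` = last letter of `v`, `b` = first of `σ`): the conditional probability is
`N(a,b)/(2k−1)^{g+ℓ+2}`, whatever the rest of the past. [cite: CalegariWalker2013, Lemma 2.4] -/
theorem card_fibre_window_mul (k i g ℓ n : ℕ) (h : i + 1 + (g + 1) + (ℓ + 1) ≤ n)
    (v : Fin (i + 1) → Fin k × Bool) (hv : v ∈ reducedWords k (i + 1))
    (σ : Fin (ℓ + 1) → Fin k × Bool) (hσ : σ ∈ reducedWords k (ℓ + 1)) :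
    (2 * k - 1) ^ (g + 1 + (ℓ + 1)) *
        (((reducedWords k n).filter fun w => ∀ j : Fin (i + 1), w ⟨j, by omega⟩ = v j).filter
          fun w => ∀ j : Fin (ℓ + 1), w ⟨i + 1 + (g + 1) + j, by omega⟩ = σ j).card =
      ((reducedWords k (g + 2 + 1)).filter fun u =>
          u 0 = v (Fin.last i) ∧ u (Fin.last (g + 2)) = σ 0).card *
        ((reducedWords k n).filter fun w => ∀ j : Fin (i + 1), w ⟨j, by omega⟩ = v j).card := by
  rw [Finset.filter_filter, card_filter_prefix_gap_window k i g ℓ n h v hv σ hσ,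
    card_filter_prefix' k i n (by omega) v hv]
  have e : n - (i + 1) = g + 1 + (ℓ + 1) + (n - (i + 1 + (g + 1) + (ℓ + 1))) := by omega
  rw [e, pow_add]
  ring

/-- **Decay of correlations, quantitative (Lemma 2.4 as used in Lemma 2.5).** With `v`, `σ` as above,
the conditional probability `P = #{v ⊑ w, σ after the gap}/#{v ⊑ w}` of seeing `σ` after a gap of
length `g + 1`, given ANY reduced past `v`, satisfies
`|2k (2k−1)^{g+ℓ+2} · P − (2k−1)^{g+2}| ≤ 2k + 1`, i.e. `P = (1 ± (2k+1)(2k−1)^{−(g+2)}) / |F_{ℓ+1}|`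
(`|F_{ℓ+1}| = 2k(2k−1)^ℓ`): stated multiplied out, as the two inequalities
`(2k−1)^{g+2} − 2k − 1) · #F ≤ 2k (2k−1)^{g+ℓ+2} · #FX ≤ ((2k−1)^{g+2} + 2k + 1) · #F`.
[cite: CalegariWalker2013, Lemma 2.4] -/
theorem conditional_window_two_sided (k i g ℓ n : ℕ) (h : i + 1 + (g + 1) + (ℓ + 1) ≤ n)
    (v : Fin (i + 1) → Fin k × Bool) (hv : v ∈ reducedWords k (i + 1))
    (σ : Fin (ℓ + 1) → Fin k × Bool) (hσ : σ ∈ reducedWords k (ℓ + 1)) :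
    ((2 * k - 1 : ℝ) ^ (g + 2) - 2 * k - 1) *
        ((reducedWords k n).filter fun w => ∀ j : Fin (i + 1), w ⟨j, by omega⟩ = v j).card ≤
      2 * k * (2 * k - 1 : ℝ) ^ (g + 1 + (ℓ + 1)) *
        (((reducedWords k n).filter fun w => ∀ j : Fin (i + 1), w ⟨j, by omega⟩ = v j).filter
          fun w => ∀ j : Fin (ℓ + 1), w ⟨i + 1 + (g + 1) + j, by omega⟩ = σ j).card ∧
    2 * k * (2 * k - 1 : ℝ) ^ (g + 1 + (ℓ + 1)) *
        (((reducedWords k n).filter fun w => ∀ j : Fin (i + 1), w ⟨j, by omega⟩ = v j).filter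
          fun w => ∀ j : Fin (ℓ + 1), w ⟨i + 1 + (g + 1) + j, by omega⟩ = σ j).card ≤
      ((2 * k - 1 : ℝ) ^ (g + 2) + 2 * k + 1) *
        ((reducedWords k n).filter fun w => ∀ j : Fin (i + 1), w ⟨j, by omega⟩ = v j).card := by
  have hk : 1 ≤ k := (v 0).1.pos
  -- the exact identity, cast to `ℝ`
  have hmul := card_fibre_window_mul k i g ℓ n h v hv σ hσ
  have hmulR : ((2 * k - 1 : ℝ)) ^ (g + 1 + (ℓ + 1)) *
      ((((reducedWords k n).filter fun w => ∀ j : Fin (i + 1), w ⟨j, by omega⟩ = v j).filter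
        fun w => ∀ j : Fin (ℓ + 1), w ⟨i + 1 + (g + 1) + j, by omega⟩ = σ j).card : ℝ) =
      (((reducedWords k (g + 2 + 1)).filter fun u =>
          u 0 = v (Fin.last i) ∧ u (Fin.last (g + 2)) = σ 0).card : ℝ) *
        (((reducedWords k n).filter fun w => ∀ j : Fin (i + 1), w ⟨j, by omega⟩ = v j).card : ℝ) := by
    have hc := congrArg (fun m : ℕ => (m : ℝ)) hmul
    push_cast [Nat.cast_sub (show 1 ≤ 2 * k by omega)] at hc
    exact hc
  -- the closed form of the two-ended count, cast to `ℝ`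
  have hN := two_mul_card_filter_ends k (g + 2) (v (Fin.last i)) (σ 0)
  have hNR : (2 * k : ℝ) * (((reducedWords k (g + 2 + 1)).filter fun u =>
      u 0 = v (Fin.last i) ∧ u (Fin.last (g + 2)) = σ 0).card : ℝ) =
      (2 * k - 1 : ℝ) ^ (g + 2) - (-1) ^ (g + 2) +
        (if σ 0 = (if Even (g + 2) then v (Fin.last i) else ((v (Fin.last i)).1, !(v (Fin.last i)).2))
          then (2 * k : ℝ) * (-1) ^ (g + 2) else 0) := by
    have hc := congrArg (fun m : ℤ => (m : ℝ)) hN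
    push_cast at hc
    split_ifs at hc ⊢ <;> simpa using hc
  set N : ℝ := (((reducedWords k (g + 2 + 1)).filter fun u =>
      u 0 = v (Fin.last i) ∧ u (Fin.last (g + 2)) = σ 0).card : ℝ) with hNdef
  set F : ℝ := (((reducedWords k n).filter fun w => ∀ j : Fin (i + 1), w ⟨j, by omega⟩ = v j).card : ℝ)
    with hFdef
  set FX : ℝ := ((((reducedWords k n).filter fun w => ∀ j : Fin (i + 1), w ⟨j, by omega⟩ = v j).filter
      fun w => ∀ j : Fin (ℓ + 1), w ⟨i + 1 + (g + 1) + j, by omega⟩ = σ j).card : ℝ) with hFXdef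
  have hF0 : 0 ≤ F := Nat.cast_nonneg _
  have habs : |(2 * k : ℝ) * N - (2 * k - 1) ^ (g + 2)| ≤ 2 * k + 1 := by
    rw [hNR]
    have hk0 : (0 : ℝ) ≤ 2 * k := by positivity
    rcases neg_one_pow_eq_or ℝ (g + 2) with h1 | h1 <;> rw [h1] <;> split_ifs <;>
      (rw [abs_le]; constructor <;> linarith)
  obtain ⟨hlo, hhi⟩ := abs_le.mp habs
  have hid : 2 * k * (2 * k - 1 : ℝ) ^ (g + 1 + (ℓ + 1)) * FX = (2 * k * N) * F := by
    rw [mul_assoc, hmulR]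
    ring
  constructor
  · rw [hid]
    exact mul_le_mul_of_nonneg_right (by linarith) hF0
  · rw [hid]
    exact mul_le_mul_of_nonneg_right (by linarith) hF0

/-- A prefix of a reduced word is reduced. [folklore] -/
theorem prefix_mem_reducedWords {k L n : ℕ} (h : L + 1 ≤ n) {w : Fin n → Fin k × Bool}
    (hw : w ∈ reducedWords k n) :
    (fun q : Fin (L + 1) => w ⟨q, by omega⟩) ∈ reducedWords k (L + 1) := by
  obtain ⟨t, rfl⟩ : ∃ t, n = L + 1 + t := ⟨n - (L + 1), by omega⟩
  rw [mem_reducedWords_iff, reduce_ofFn_eq_self_iff] at hw ⊢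
  intro i hi
  exact hw i (by omega)

end GapWindow

/-! ### §2.4, Lemma 2.5 (finite form): the number of copies of `σ` in one residue class concentrates

Lemma 2.5 of loc. cit.: for a fixed reduced `σ` and windows at prescribed positions
`s 0 < s 1 < …` separated by at least `(g+1) + (ℓ+1)` (a free gap of length `g + 1` then the
window of length `ℓ + 1 = |σ|`), the number of these windows equal to `σ` in a uniform random
reduced word of length `n` is a sum of `T` indicators whose conditional probabilities given the
past lie in `[p₋, p₊]`, `p± = (1 ± (2k+1)(2k−1)^{−(g+2)})/|F_{ℓ+1}|` (`conditional_window_two_sided`);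
the adapted Chernoff bound (`Literature.Probability.Moments.card_filter_sum_indicator_ge_le_exp`,
`…_le_le_exp`) then gives exponential tails. -/

section Lemma25

open scoped Classical
open Literature.Probability.Moments

/-- **Calegari–Walker Lemma 2.5, upper tail (finite form).** Let `k ≥ 2`, `σ` a reduced word of
length `ℓ + 1`, and positions `s 0, s 1, …` with `s 0 ≥ 1`, `s t + (g+1) + (ℓ+1) ≤ s u` for `t < u`
and `s t + (g+1) + (ℓ+1) ≤ n` for `t < T`. With
`p₊ = ((2k−1)^{g+2} + 2k + 1)/(2k (2k−1)^{g+ℓ+2})`, for `0 ≤ δ ≤ 2` the reduced words of length `n`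
in which at least `(1+δ) T p₊` of the `T` windows `[s t + g + 1, s t + g + 1 + ℓ]` read `σ` number at
most `|F_n| · exp(−δ² T p₊ / 4)`. [cite: CalegariWalker2013, Lemma 2.5] -/
theorem card_filter_windowCount_ge_le (k n g ℓ T : ℕ) (hk : 2 ≤ k) (s : ℕ → ℕ) (hs0 : 1 ≤ s 0)
    (hs : ∀ t u, t < u → s t + (g + 1 + (ℓ + 1)) ≤ s u)
    (hsn : ∀ t, t < T → s t + (g + 1 + (ℓ + 1)) ≤ n)
    (σ : Fin (ℓ + 1) → Fin k × Bool) (hσ : σ ∈ reducedWords k (ℓ + 1))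
    {δ : ℝ} (hδ : 0 ≤ δ) (hδ2 : δ ≤ 2) :
    (((reducedWords k n).filter fun w =>
        (1 + δ) * (T * (((2 * k - 1 : ℝ) ^ (g + 2) + 2 * k + 1) /
          (2 * k * (2 * k - 1 : ℝ) ^ (g + 1 + (ℓ + 1))))) ≤
          ∑ t : Fin T, if (∀ q : Fin (ℓ + 1),
              w ⟨s t + (g + 1) + q, by have := hsn t t.isLt; omega⟩ = σ q) then (1 : ℝ) else 0).card : ℝ) ≤
      (reducedWords k n).card * Real.exp (-(δ ^ 2 * (T * (((2 * k - 1 : ℝ) ^ (g + 2) + 2 * k + 1) /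
        (2 * k * (2 * k - 1 : ℝ) ^ (g + 1 + (ℓ + 1))))) / 4)) := by
  set p : ℝ := ((2 * k - 1 : ℝ) ^ (g + 2) + 2 * k + 1) /
    (2 * k * (2 * k - 1 : ℝ) ^ (g + 1 + (ℓ + 1))) with hpdef
  have hk1 : (1 : ℝ) ≤ 2 * k - 1 := by
    have : (2 : ℝ) ≤ k := by exact_mod_cast hk
    linarith
  have hden : (0 : ℝ) < 2 * k * (2 * k - 1 : ℝ) ^ (g + 1 + (ℓ + 1)) := by positivity
  have hp : 0 ≤ p := by rw [hpdef]; positivity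
  -- monotonicity of the positions
  have hsmono : ∀ t u, t ≤ u → s t ≤ s u := by
    intro t u htu
    rcases Nat.eq_or_lt_of_le htu with rfl | hlt
    · exact le_rfl
    · have := hs t u hlt; omega
  have hs1 : ∀ t, 1 ≤ s t := fun t => hs0.trans (hsmono 0 t (Nat.zero_le t))
  -- the events and the keys
  let X : ℕ → (Fin n → Fin k × Bool) → Prop := fun t w =>
    ∃ ht : t < T, ∀ q : Fin (ℓ + 1), w ⟨s t + (g + 1) + q, by have := hsn t ht; omega⟩ = σ q
  let key : ∀ _ : ℕ, (Fin n → Fin k × Bool) → (Fin n → Fin k × Bool) := fun t w q =>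
    if (q : ℕ) < s t then w q else σ 0
  have hkey : ∀ t, ∀ w ∈ reducedWords k n, ∀ w' ∈ reducedWords k n, key t w = key t w' →
      ∀ u < t, (X u w ↔ X u w') := by
    intro t w _ w' _ hww' u hut
    have hagree : ∀ q : Fin n, (q : ℕ) < s t → w q = w' q := by
      intro q hq
      have := congrFun hww' q
      simp only [key, if_pos hq] at this
      exact this
    have hsu := hs u t hut
    constructor
    · rintro ⟨hu, hw⟩
      exact ⟨hu, fun q => by rw [← hagree _ (by simp; omega)]; exact hw q⟩
    · rintro ⟨hu, hw⟩
      exact ⟨hu, fun q => by rw [hagree _ (by simp; omega)]; exact hw q⟩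
  -- the conditional bound on each fibre
  have hX : ∀ t < T, ∀ v ∈ (reducedWords k n).image (key t),
      (((((reducedWords k n).filter fun w => key t w = v).filter (X t)).card : ℝ)) ≤
        p * (((reducedWords k n).filter fun w => key t w = v).card : ℝ) := by
    intro t ht v hv
    obtain ⟨w₀, hw₀, rfl⟩ := Finset.mem_image.mp hv
    obtain ⟨i, hi⟩ : ∃ i, s t = i + 1 := ⟨s t - 1, by have := hs1 t; omega⟩
    have hstn : i + 1 + (g + 1) + (ℓ + 1) ≤ n := by have := hsn t ht; omega
    set v' : Fin (i + 1) → Fin k × Bool := fun q => w₀ ⟨q, by omega⟩ with hv'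
    have hv'red : v' ∈ reducedWords k (i + 1) := prefix_mem_reducedWords (by omega) hw₀
    -- the fibre is the prefix class of `v'`
    have hfib : ((reducedWords k n).filter fun w => key t w = key t w₀) =
        (reducedWords k n).filter fun w => ∀ q : Fin (i + 1), w ⟨q, by omega⟩ = v' q := by
      refine Finset.filter_congr fun w _ => ?_
      constructor
      · intro h q
        have := congrFun h ⟨q, by omega⟩
        simp only [key] at this
        rw [if_pos (by omega), if_pos (by omega)] at this
        exact this
      · intro h
        funext q
        show (if (q : ℕ) < s t then w q else σ 0) = (if (q : ℕ) < s t then w₀ q else σ 0)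
        by_cases hq : (q : ℕ) < s t
        · rw [if_pos hq, if_pos hq]
          have := h ⟨q, by omega⟩
          exact this
        · rw [if_neg hq, if_neg hq]
    -- the event is the window after the gap
    have hev : (((reducedWords k n).filter fun w => key t w = key t w₀).filter (X t)) =
        ((reducedWords k n).filter fun w => ∀ q : Fin (i + 1), w ⟨q, by omega⟩ = v' q).filter
          fun w => ∀ q : Fin (ℓ + 1), w ⟨i + 1 + (g + 1) + q, by omega⟩ = σ q := by
      rw [hfib]
      refine Finset.filter_congr fun w _ => ?_
      constructor
      · rintro ⟨_, hw⟩ q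
        rw [← hw q]
        exact congrArg w (Fin.ext (show i + 1 + (g + 1) + (q : ℕ) = s t + (g + 1) + q by omega))
      · intro hw
        refine ⟨ht, fun q => ?_⟩
        rw [← hw q]
        exact congrArg w (Fin.ext (show s t + (g + 1) + (q : ℕ) = i + 1 + (g + 1) + q by omega))
    rw [hev, hfib]
    have h2 := (conditional_window_two_sided k i g ℓ n hstn v' hv'red σ hσ).2
    rw [hpdef, div_mul_eq_mul_div, le_div_iff₀ hden]
    linarith
  -- the adapted Chernoff bound
  have hmain := card_filter_sum_indicator_ge_le_exp (reducedWords k n) key X hp hkey T hX hδ hδ2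
  -- identify the two sums
  have hsum : ∀ w : Fin n → Fin k × Bool,
      (∑ t ∈ Finset.range T, if X t w then (1 : ℝ) else 0) =
        ∑ t : Fin T, if (∀ q : Fin (ℓ + 1),
          w ⟨s t + (g + 1) + q, by have := hsn t t.isLt; omega⟩ = σ q) then (1 : ℝ) else 0 := by
    intro w
    rw [Finset.sum_range]
    refine Finset.sum_congr rfl fun t _ => ?_
    have hiff : X t w ↔ ∀ q : Fin (ℓ + 1),
        w ⟨s t + (g + 1) + q, by have := hsn t t.isLt; omega⟩ = σ q :=
      ⟨fun ⟨_, h⟩ => h, fun h => ⟨t.isLt, h⟩⟩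
    by_cases hXt : X t w
    · rw [if_pos hXt, if_pos (hiff.mp hXt)]
    · rw [if_neg hXt, if_neg (fun h => hXt (hiff.mpr h))]
  have hfilter : ((reducedWords k n).filter fun w => (1 + δ) * (T * p) ≤
      ∑ t ∈ Finset.range T, if X t w then (1 : ℝ) else 0) =
      (reducedWords k n).filter fun w => (1 + δ) * (T * p) ≤
        ∑ t : Fin T, if (∀ q : Fin (ℓ + 1),
          w ⟨s t + (g + 1) + q, by have := hsn t t.isLt; omega⟩ = σ q) then (1 : ℝ) else 0 :=
    Finset.filter_congr fun w _ => by rw [hsum w]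
  rw [hfilter] at hmain
  exact hmain

/-- **Calegari–Walker Lemma 2.5, lower tail (finite form).** Under the same hypotheses, with
`p₋ = ((2k−1)^{g+2} − 2k − 1)/(2k (2k−1)^{g+ℓ+2})`, the reduced words of length `n` in which at
most `(1−δ) T p₋` of the `T` windows read `σ` number at most `|F_n| · exp(−δ² T p₋ / 4)`.
[cite: CalegariWalker2013, Lemma 2.5] -/
theorem card_filter_windowCount_le_le (k n g ℓ T : ℕ) (hk : 2 ≤ k) (s : ℕ → ℕ) (hs0 : 1 ≤ s 0)
    (hs : ∀ t u, t < u → s t + (g + 1 + (ℓ + 1)) ≤ s u)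
    (hsn : ∀ t, t < T → s t + (g + 1 + (ℓ + 1)) ≤ n)
    (σ : Fin (ℓ + 1) → Fin k × Bool) (hσ : σ ∈ reducedWords k (ℓ + 1))
    {δ : ℝ} (hδ : 0 ≤ δ) (hδ2 : δ ≤ 2) :
    (((reducedWords k n).filter fun w =>
        (∑ t : Fin T, if (∀ q : Fin (ℓ + 1),
            w ⟨s t + (g + 1) + q, by have := hsn t t.isLt; omega⟩ = σ q) then (1 : ℝ) else 0) ≤
          (1 - δ) * (T * (((2 * k - 1 : ℝ) ^ (g + 2) - 2 * k - 1) /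
            (2 * k * (2 * k - 1 : ℝ) ^ (g + 1 + (ℓ + 1)))))).card : ℝ) ≤
      (reducedWords k n).card * Real.exp (-(δ ^ 2 * (T * (((2 * k - 1 : ℝ) ^ (g + 2) - 2 * k - 1) /
        (2 * k * (2 * k - 1 : ℝ) ^ (g + 1 + (ℓ + 1))))) / 4)) := by
  set p : ℝ := ((2 * k - 1 : ℝ) ^ (g + 2) - 2 * k - 1) /
    (2 * k * (2 * k - 1 : ℝ) ^ (g + 1 + (ℓ + 1))) with hpdef
  have hk2 : (2 : ℝ) ≤ k := by exact_mod_cast hk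
  have hk1 : (1 : ℝ) ≤ 2 * k - 1 := by linarith
  have hden : (0 : ℝ) < 2 * k * (2 * k - 1 : ℝ) ^ (g + 1 + (ℓ + 1)) := by positivity
  have hnum : (0 : ℝ) ≤ (2 * k - 1 : ℝ) ^ (g + 2) - 2 * k - 1 := by
    have h3 : (3 : ℝ) ≤ 2 * k - 1 := by linarith
    have : (2 * k - 1 : ℝ) ^ 2 ≤ (2 * k - 1 : ℝ) ^ (g + 2) :=
      pow_le_pow_right₀ hk1 (by omega)
    nlinarith
  have hp : 0 ≤ p := by rw [hpdef]; positivity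
  have hp1 : p ≤ 1 := by
    rw [hpdef, div_le_one hden]
    have : (2 * k - 1 : ℝ) ^ (g + 2) ≤ 2 * k * (2 * k - 1 : ℝ) ^ (g + 1 + (ℓ + 1)) := by
      calc (2 * k - 1 : ℝ) ^ (g + 2) ≤ (2 * k - 1 : ℝ) ^ (g + 1 + (ℓ + 1)) :=
            pow_le_pow_right₀ hk1 (by omega)
        _ ≤ 2 * k * (2 * k - 1 : ℝ) ^ (g + 1 + (ℓ + 1)) :=
            le_mul_of_one_le_left (by positivity) (by linarith)
    linarith
  have hsmono : ∀ t u, t ≤ u → s t ≤ s u := by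
    intro t u htu
    rcases Nat.eq_or_lt_of_le htu with rfl | hlt
    · exact le_rfl
    · have := hs t u hlt; omega
  have hs1 : ∀ t, 1 ≤ s t := fun t => hs0.trans (hsmono 0 t (Nat.zero_le t))
  let X : ℕ → (Fin n → Fin k × Bool) → Prop := fun t w =>
    ∃ ht : t < T, ∀ q : Fin (ℓ + 1), w ⟨s t + (g + 1) + q, by have := hsn t ht; omega⟩ = σ q
  let key : ∀ _ : ℕ, (Fin n → Fin k × Bool) → (Fin n → Fin k × Bool) := fun t w q =>
    if (q : ℕ) < s t then w q else σ 0
  have hkey : ∀ t, ∀ w ∈ reducedWords k n, ∀ w' ∈ reducedWords k n, key t w = key t w' →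
      ∀ u < t, (X u w ↔ X u w') := by
    intro t w _ w' _ hww' u hut
    have hagree : ∀ q : Fin n, (q : ℕ) < s t → w q = w' q := by
      intro q hq
      have := congrFun hww' q
      simp only [key, if_pos hq] at this
      exact this
    have hsu := hs u t hut
    constructor
    · rintro ⟨hu, hw⟩
      exact ⟨hu, fun q => by rw [← hagree _ (by simp; omega)]; exact hw q⟩
    · rintro ⟨hu, hw⟩
      exact ⟨hu, fun q => by rw [hagree _ (by simp; omega)]; exact hw q⟩
  have hX : ∀ t < T, ∀ v ∈ (reducedWords k n).image (key t),
      p * (((reducedWords k n).filter fun w => key t w = v).card : ℝ) ≤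
        (((((reducedWords k n).filter fun w => key t w = v).filter (X t)).card : ℝ)) := by
    intro t ht v hv
    obtain ⟨w₀, hw₀, rfl⟩ := Finset.mem_image.mp hv
    obtain ⟨i, hi⟩ : ∃ i, s t = i + 1 := ⟨s t - 1, by have := hs1 t; omega⟩
    have hstn : i + 1 + (g + 1) + (ℓ + 1) ≤ n := by have := hsn t ht; omega
    set v' : Fin (i + 1) → Fin k × Bool := fun q => w₀ ⟨q, by omega⟩ with hv'
    have hv'red : v' ∈ reducedWords k (i + 1) := prefix_mem_reducedWords (by omega) hw₀
    have hfib : ((reducedWords k n).filter fun w => key t w = key t w₀) =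
        (reducedWords k n).filter fun w => ∀ q : Fin (i + 1), w ⟨q, by omega⟩ = v' q := by
      refine Finset.filter_congr fun w _ => ?_
      constructor
      · intro h q
        have := congrFun h ⟨q, by omega⟩
        simp only [key] at this
        rw [if_pos (by omega), if_pos (by omega)] at this
        exact this
      · intro h
        funext q
        show (if (q : ℕ) < s t then w q else σ 0) = (if (q : ℕ) < s t then w₀ q else σ 0)
        by_cases hq : (q : ℕ) < s t
        · rw [if_pos hq, if_pos hq]
          have := h ⟨q, by omega⟩
          exact this
        · rw [if_neg hq, if_neg hq]
    have hev : (((reducedWords k n).filter fun w => key t w = key t w₀).filter (X t)) =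
        ((reducedWords k n).filter fun w => ∀ q : Fin (i + 1), w ⟨q, by omega⟩ = v' q).filter
          fun w => ∀ q : Fin (ℓ + 1), w ⟨i + 1 + (g + 1) + q, by omega⟩ = σ q := by
      rw [hfib]
      refine Finset.filter_congr fun w _ => ?_
      constructor
      · rintro ⟨_, hw⟩ q
        rw [← hw q]
        exact congrArg w (Fin.ext (show i + 1 + (g + 1) + (q : ℕ) = s t + (g + 1) + q by omega))
      · intro hw
        refine ⟨ht, fun q => ?_⟩
        rw [← hw q]
        exact congrArg w (Fin.ext (show s t + (g + 1) + (q : ℕ) = i + 1 + (g + 1) + q by omega))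
    rw [hev, hfib]
    have h1 := (conditional_window_two_sided k i g ℓ n hstn v' hv'red σ hσ).1
    rw [hpdef, div_mul_eq_mul_div, div_le_iff₀ hden]
    linarith
  have hmain := card_filter_sum_indicator_le_le_exp (reducedWords k n) key X hp hp1 hkey T hX hδ hδ2
  have hsum : ∀ w : Fin n → Fin k × Bool,
      (∑ t ∈ Finset.range T, if X t w then (1 : ℝ) else 0) =
        ∑ t : Fin T, if (∀ q : Fin (ℓ + 1),
          w ⟨s t + (g + 1) + q, by have := hsn t t.isLt; omega⟩ = σ q) then (1 : ℝ) else 0 := by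
    intro w
    rw [Finset.sum_range]
    refine Finset.sum_congr rfl fun t _ => ?_
    have hiff : X t w ↔ ∀ q : Fin (ℓ + 1),
        w ⟨s t + (g + 1) + q, by have := hsn t t.isLt; omega⟩ = σ q :=
      ⟨fun ⟨_, h⟩ => h, fun h => ⟨t.isLt, h⟩⟩
    by_cases hXt : X t w
    · rw [if_pos hXt, if_pos (hiff.mp hXt)]
    · rw [if_neg hXt, if_neg (fun h => hXt (hiff.mpr h))]
  have hfilter : ((reducedWords k n).filter fun w =>
      (∑ t ∈ Finset.range T, if X t w then (1 : ℝ) else 0) ≤ (1 - δ) * (T * p)) =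
      (reducedWords k n).filter fun w =>
        (∑ t : Fin T, if (∀ q : Fin (ℓ + 1),
          w ⟨s t + (g + 1) + q, by have := hsn t t.isLt; omega⟩ = σ q) then (1 : ℝ) else 0) ≤
          (1 - δ) * (T * p) :=
    Finset.filter_congr fun w _ => by rw [hsum w]
  rw [hfilter] at hmain
  exact hmain

end Lemma25

/-! ### Towards Theorem 2.1 (Sharp): weighted counts of reduced words and the cogrowth recurrence

Sharp's theorem counts `F_n' = F_n ∩ [F,F]` by Fourier analysis of the abelianisation: for a
character `χ` of `ℤ^k`, `∑_{w ∈ F_n} χ(ab w) = ∑_{w ∈ F_n} ∏ᵢ χ(wᵢ)` with multiplicative weights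
`χ(x⁻¹) χ(x) = 1` on letters. We prove the classical **transfer (cogrowth) recurrence** for these
weighted counts: with `C_n = ∑_{w ∈ F_n} ∏ χ(wᵢ)` and `a = ∑_x χ(x)`,
`C_{n+3} = a C_{n+2} − (2k−1) C_{n+1}`, `C_0 = 1`, `C_1 = a`, `C_2 = a² − 2k`
(`weightedCount_rec`), i.e. `∑_n C_n tⁿ = (1 − t²)/(1 − a t + (2k−1) t²)` — reducing the
`k`-dimensional local limit theorem to a scalar second-order recurrence. -/

section WeightedCounts

open scoped Classical

variable {R : Type*} [CommRing R]

/-- **Weighted snoc decomposition**: summing `F(init w, last w)` over reduced words of length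
`n + 2` is summing over reduced `u` of length `n + 1` and letters `x` compatible with the last
letter of `u`. [folklore] -/
theorem sum_reducedWords_succ_succ {k n : ℕ} {M : Type*} [AddCommMonoid M]
    (F : (Fin (n + 1) → Fin k × Bool) → (Fin k × Bool) → M) :
    ∑ w ∈ reducedWords k (n + 2), F (Fin.init w) (w (Fin.last (n + 1))) =
      ∑ u ∈ reducedWords k (n + 1), ∑ x ∈ Finset.univ.filter (fun x : Fin k × Bool =>
        (u (Fin.last n)).1 = x.1 → (u (Fin.last n)).2 = x.2), F u x := by
  rw [← Finset.sum_sigma (reducedWords k (n + 1)) (fun u => Finset.univ.filter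
    (fun x : Fin k × Bool => (u (Fin.last n)).1 = x.1 → (u (Fin.last n)).2 = x.2))
    (fun ux => F ux.1 ux.2)]
  refine Finset.sum_nbij' (fun w => ⟨Fin.init w, w (Fin.last (n + 1))⟩)
    (fun ux => Fin.snoc ux.1 ux.2) ?_ ?_ ?_ ?_ ?_
  · intro w hw
    rw [mem_reducedWords_iff, reduce_ofFn_eq_self_iff_fin] at hw
    simp only [Finset.mem_sigma, mem_reducedWords_iff, reduce_ofFn_eq_self_iff_fin,
      Finset.mem_filter, Finset.mem_univ, true_and]
    refine ⟨fun i => ?_, ?_⟩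
    · simpa only [Fin.init, Fin.succ_castSucc] using hw i.castSucc
    · simpa only [Fin.init, Fin.succ_last] using hw (Fin.last n)
  · rintro ⟨u, x⟩ hux
    simp only [Finset.mem_sigma, mem_reducedWords_iff, reduce_ofFn_eq_self_iff_fin,
      Finset.mem_filter, Finset.mem_univ, true_and] at hux
    obtain ⟨hu, hx⟩ := hux
    rw [mem_reducedWords_iff, reduce_ofFn_eq_self_iff_fin]
    intro i
    rcases Fin.eq_castSucc_or_eq_last i with ⟨j, rfl⟩ | rfl
    · simpa only [Fin.succ_castSucc, Fin.snoc_castSucc] using hu j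
    · simpa only [Fin.succ_last, Fin.snoc_last, Fin.snoc_castSucc] using hx
  · intro w _
    exact Fin.snoc_init_self w
  · rintro ⟨u, x⟩ _
    simp only [Fin.init_snoc, Fin.snoc_last]
  · intro w _
    rfl

/-- The weight of a word splits off its last letter. [folklore] -/
theorem prod_weight_eq_init_mul {k n : ℕ} (χ : Fin k × Bool → R) (w : Fin (n + 2) → Fin k × Bool) :
    ∏ i, χ (w i) = (∏ i, χ (Fin.init w i)) * χ (w (Fin.last (n + 1))) := by
  rw [Fin.prod_univ_castSucc]
  rfl

/-- **Last-letter transfer**: with `D_m(y) = ∑_{w ∈ F_{m+1}, last = y} wt(w)` and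
`C_m = ∑_{w ∈ F_m} wt(w)`, `D_{n+1}(y) = χ(y) (C_{n+1} − D_n(y⁻¹))`. [folklore] -/
theorem weightedLast_succ {k n : ℕ} (χ : Fin k × Bool → R) (y : Fin k × Bool) :
    ∑ w ∈ (reducedWords k (n + 2)).filter (fun w => w (Fin.last (n + 1)) = y), ∏ i, χ (w i) =
      χ y * (∑ u ∈ reducedWords k (n + 1), ∏ i, χ (u i) -
        ∑ u ∈ (reducedWords k (n + 1)).filter (fun u => u (Fin.last n) = (y.1, !y.2)),
          ∏ i, χ (u i)) := by
  rw [Finset.sum_filter]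
  have h := sum_reducedWords_succ_succ (k := k) (n := n) (M := R)
    (fun u x => if x = y then (∏ i, χ (u i)) * χ x else 0)
  have h' : ∑ w ∈ reducedWords k (n + 2), (if w (Fin.last (n + 1)) = y then ∏ i, χ (w i) else 0) =
      ∑ w ∈ reducedWords k (n + 2),
        (fun u x => if x = y then (∏ i, χ (u i)) * χ x else 0) (Fin.init w) (w (Fin.last (n + 1))) := by
    refine Finset.sum_congr rfl fun w _ => ?_
    simp only [prod_weight_eq_init_mul χ w]
  rw [h', h]
  -- inner sum: only `x = y` contributes, iff `y` is compatible with the last letter of `u`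
  have hinner : ∀ u : Fin (n + 1) → Fin k × Bool,
      ∑ x ∈ Finset.univ.filter (fun x : Fin k × Bool =>
        (u (Fin.last n)).1 = x.1 → (u (Fin.last n)).2 = x.2),
        (if x = y then (∏ i, χ (u i)) * χ x else 0) =
      if (u (Fin.last n)).1 = y.1 → (u (Fin.last n)).2 = y.2 then (∏ i, χ (u i)) * χ y else 0 := by
    intro u
    rw [Finset.sum_ite_eq' (Finset.univ.filter _) y]
    simp only [Finset.mem_filter, Finset.mem_univ, true_and]
  rw [Finset.sum_congr rfl fun u _ => hinner u, ← Finset.sum_filter, ← Finset.sum_mul]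
  have hsplit := Finset.sum_filter_add_sum_filter_not (reducedWords k (n + 1))
    (fun u : Fin (n + 1) → Fin k × Bool => (u (Fin.last n)).1 = y.1 → (u (Fin.last n)).2 = y.2)
    (fun u => ∏ i, χ (u i))
  have hneg : ((reducedWords k (n + 1)).filter fun u : Fin (n + 1) → Fin k × Bool =>
      ¬ ((u (Fin.last n)).1 = y.1 → (u (Fin.last n)).2 = y.2)) =
      (reducedWords k (n + 1)).filter fun u => u (Fin.last n) = (y.1, !y.2) :=
    Finset.filter_congr fun u _ => not_compatible_iff _ _
  rw [hneg] at hsplit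
  rw [eq_sub_of_add_eq hsplit]
  ring

/-- `C_{n+1} = ∑_y D_n(y)` (sum over the last letter). [folklore] -/
theorem weightedCount_eq_sum_last {k n : ℕ} (χ : Fin k × Bool → R) :
    ∑ w ∈ reducedWords k (n + 1), ∏ i, χ (w i) =
      ∑ y : Fin k × Bool, ∑ w ∈ (reducedWords k (n + 1)).filter (fun w => w (Fin.last n) = y),
        ∏ i, χ (w i) :=
  (Finset.sum_fiberwise_of_maps_to (fun w _ => Finset.mem_univ (w (Fin.last n))) _).symm

/-- **The cogrowth (transfer) recurrence.** For weights with `χ(x) χ(x⁻¹) = 1` on letters (e.g. a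
character of the abelianisation), the weighted counts `C_n = ∑_{w ∈ F_n} ∏ᵢ χ(wᵢ)` satisfy
`C_{n+3} = a C_{n+2} − (2k−1) C_{n+1}` with `a = ∑_x χ(x)` — equivalently
`∑ C_n tⁿ = (1 − t²)/(1 − a t + (2k−1)t²)`. This is the classical reduction of Sharp's local limit
theorem (loc. cit. Thm. 2.1) to a scalar recurrence. [folklore] -/
theorem weightedCount_rec {k : ℕ} (χ : Fin k × Bool → R) (hχ : ∀ x, χ x * χ (x.1, !x.2) = 1) (n : ℕ) :
    ∑ w ∈ reducedWords k (n + 3), ∏ i, χ (w i) =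
      (∑ x : Fin k × Bool, χ x) * ∑ w ∈ reducedWords k (n + 2), ∏ i, χ (w i) -
        (2 * k - 1 : R) * ∑ w ∈ reducedWords k (n + 1), ∏ i, χ (w i) := by
  -- `C_{n+3} = Σ_y D_{n+2}(y) = Σ_y χ y (C_{n+2} − D_{n+1}(ȳ)) = a C_{n+2} − Σ_y χ y D_{n+1}(ȳ)`
  rw [weightedCount_eq_sum_last, Finset.sum_congr rfl fun y _ => weightedLast_succ χ y]
  simp only [mul_sub, Finset.sum_sub_distrib, ← Finset.sum_mul]
  congr 1
  -- `Σ_y χ y D_{n+1}(ȳ) = Σ_x χ x̄ D_{n+1}(x) = Σ_x χ x̄ χ x (C_{n+1} − D_n(x̄)) = 2k C_{n+1} − C_{n+1}`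
  have hinv : ∑ y : Fin k × Bool, χ y *
      ∑ u ∈ (reducedWords k (n + 2)).filter (fun u => u (Fin.last (n + 1)) = (y.1, !y.2)),
        ∏ i, χ (u i) =
      ∑ x : Fin k × Bool, χ (x.1, !x.2) *
        ∑ u ∈ (reducedWords k (n + 2)).filter (fun u => u (Fin.last (n + 1)) = x), ∏ i, χ (u i) := by
    refine Finset.sum_nbij' (fun y => (y.1, !y.2)) (fun x => (x.1, !x.2)) (by simp) (by simp)
      (fun y _ => by simp) (fun x _ => by simp) fun y _ => by simp
  rw [hinv, Finset.sum_congr rfl fun x _ => by rw [weightedLast_succ χ x]]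
  rw [Finset.sum_congr rfl fun x _ => by
    rw [← mul_assoc, mul_comm (χ (x.1, !x.2)) (χ x), hχ x, one_mul]]
  rw [Finset.sum_sub_distrib, Finset.sum_const, Finset.card_univ, Fintype.card_prod,
    Fintype.card_fin, Fintype.card_bool, nsmul_eq_mul]
  -- `Σ_x D_n(x̄) = Σ_y D_n(y) = C_{n+1}`
  have hC : ∑ x : Fin k × Bool, ∑ u ∈ (reducedWords k (n + 1)).filter
      (fun u => u (Fin.last n) = (x.1, !x.2)), ∏ i, χ (u i) =
      ∑ w ∈ reducedWords k (n + 1), ∏ i, χ (w i) := by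
    rw [weightedCount_eq_sum_last (n := n) χ]
    exact Fintype.sum_bijective (fun x : Fin k × Bool => (x.1, !x.2))
      (Function.Involutive.bijective fun x => by simp) _ _ fun x => rfl
  rw [hC]
  push_cast
  ring

/-- `C_0 = 1`. [folklore] -/
theorem weightedCount_zero {k : ℕ} (χ : Fin k × Bool → R) :
    ∑ w ∈ reducedWords k 0, ∏ i, χ (w i) = 1 := by
  have h : reducedWords k 0 = Finset.univ := by
    rw [reducedWords, Finset.filter_true_of_mem]
    intro w _
    rw [reduce_ofFn_eq_self_iff]
    intro i hi
    omega
  rw [h]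
  simp

/-- `C_1 = a = ∑_x χ(x)`. [folklore] -/
theorem weightedCount_one {k : ℕ} (χ : Fin k × Bool → R) :
    ∑ w ∈ reducedWords k 1, ∏ i, χ (w i) = ∑ x : Fin k × Bool, χ x := by
  have h : reducedWords k 1 = Finset.univ := by
    rw [reducedWords, Finset.filter_true_of_mem]
    intro w _
    rw [reduce_ofFn_eq_self_iff]
    intro i hi
    omega
  rw [h]
  simp only [Fin.prod_univ_one]
  exact Fintype.sum_bijective (fun w : Fin 1 → Fin k × Bool => w 0)
    ⟨fun w w' hww' => funext fun i => by rw [Fin.fin_one_eq_zero i]; exact hww',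
      fun x => ⟨fun _ => x, rfl⟩⟩ _ _ fun w => rfl

/-- `C_2 = a² − 2k` (for weights with `χ(x)χ(x⁻¹) = 1`). [folklore] -/
theorem weightedCount_two {k : ℕ} (χ : Fin k × Bool → R) (hχ : ∀ x, χ x * χ (x.1, !x.2) = 1) :
    ∑ w ∈ reducedWords k 2, ∏ i, χ (w i) = (∑ x : Fin k × Bool, χ x) ^ 2 - 2 * k := by
  rw [weightedCount_eq_sum_last, Finset.sum_congr rfl fun y _ => weightedLast_succ χ y,
    weightedCount_one]
  have hD0 : ∀ y : Fin k × Bool,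
      ∑ u ∈ (reducedWords k 1).filter (fun u => u (Fin.last 0) = (y.1, !y.2)), ∏ i, χ (u i) =
        χ (y.1, !y.2) := by
    intro y
    have h1 : (reducedWords k 1).filter (fun u => u (Fin.last 0) = (y.1, !y.2)) =
        {fun _ => (y.1, !y.2)} := by
      ext u
      simp only [Finset.mem_filter, mem_reducedWords_iff, reduce_ofFn_eq_self_iff,
        Finset.mem_singleton, Fin.last_zero]
      constructor
      · rintro ⟨-, hu⟩
        funext i
        rw [Fin.fin_one_eq_zero i, hu]
      · rintro rfl
        exact ⟨fun i hi => absurd hi (by omega), rfl⟩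
    rw [h1, Finset.sum_singleton, Fin.prod_univ_one]
  simp only [hD0, mul_sub, hχ, Finset.sum_sub_distrib, Finset.sum_const, Finset.card_univ,
    Fintype.card_prod, Fintype.card_fin, Fintype.card_bool, ← Finset.sum_mul]
  ring

end WeightedCounts

/-! ### Towards Lemmas 3.4–3.5 (surfaces ⇄ commutators): functoriality and handle reduction

Two algebraic ingredients of the "admissible surface ⇒ commutator bound" direction used in the proof
of Prop. 4.2: `cl` does not increase under homomorphisms (so one may compute with the quadratic
"edge word" of a fatgraph and then specialise the edge letters), and the **handle reduction**
identity of the classification of surfaces, valid in every group: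
`x A y B x⁻¹ C y⁻¹ D = (CB) · ([(CB)⁻¹x, AyB] · ADCB) · (CB)⁻¹`, whence
`cl(xAyBx⁻¹Cy⁻¹D) ≤ cl(ADCB) + 1` — cutting off the handle spanned by a linked pair `x … y … x⁻¹ … y⁻¹`
costs one commutator and leaves the remaining segments in the order `A D C B`. -/

section HandleReduction

variable {G H : Type*} [Group G] [Group H]

/-- A homomorphism maps a product of commutators to the product of the image commutators.
[folklore] -/
theorem map_prod_map_commutator (f : G →* H) (l : List (G × G)) :
    f (l.map fun p => p.1 * p.2 * p.1⁻¹ * p.2⁻¹).prod =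
      ((l.map fun p => (f p.1, f p.2)).map fun p => p.1 * p.2 * p.1⁻¹ * p.2⁻¹).prod := by
  rw [map_list_prod, List.map_map, List.map_map]
  congr 1
  refine List.map_congr_left fun p _ => ?_
  simp [map_mul, map_inv]

/-- Homomorphisms map the commutator subgroup into the commutator subgroup. [folklore] -/
theorem map_mem_commutator (f : G →* H) {g : G} (hg : g ∈ commutator G) :
    f g ∈ commutator H := by
  obtain ⟨l, rfl⟩ := (exists_list_prod_eq_iff_mem_commutator g).mpr hg
  rw [map_prod_map_commutator]
  exact prod_map_commutator_mem _

/-- **`cl` is functorial**: `cl(f(g)) ≤ cl(g)` for a homomorphism `f` and `g ∈ [G,G]`. [folklore] -/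
theorem commutatorLength_map_le (f : G →* H) {g : G} (hg : g ∈ commutator G) :
    commutatorLength (f g) ≤ commutatorLength g := by
  obtain ⟨l, hl, hprod⟩ := exists_list_length_eq_commutatorLength hg
  rw [← hl, ← hprod, map_prod_map_commutator]
  exact Nat.sInf_le ⟨_, by simp, rfl⟩

/-- **Handle reduction identity** (the algebraic form of the handle normalisation step in the
classification of surfaces), in any group: for all `x y A B C D`,
`x A y B x⁻¹ C y⁻¹ D = (CB) · ((CB)⁻¹x · AyB · ((CB)⁻¹x)⁻¹ · (AyB)⁻¹ · (A D C B)) · (CB)⁻¹`, i.e.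
substituting `x ↦ (CB)⁻¹x`, `y ↦ AyB` in `[x,y]·ADCB` gives `xAyBx⁻¹Cy⁻¹D` up to conjugation by
`CB`. [folklore] -/
theorem handle_eq_conj_commutator_mul (x y A B C D : G) :
    x * A * y * B * x⁻¹ * C * y⁻¹ * D =
      (C * B) * (((C * B)⁻¹ * x) * (A * y * B) * ((C * B)⁻¹ * x)⁻¹ * (A * y * B)⁻¹ *
        (A * D * C * B)) * (C * B)⁻¹ := by
  group

/-- If the remainder `A D C B` lies in `[G,G]` then so does the handle word `x A y B x⁻¹ C y⁻¹ D`.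
[folklore] -/
theorem handle_mem_commutator (x y A B C D : G) (h : A * D * C * B ∈ commutator G) :
    x * A * y * B * x⁻¹ * C * y⁻¹ * D ∈ commutator G := by
  rw [handle_eq_conj_commutator_mul]
  refine (inferInstance : (commutator G).Normal).conj_mem _ (mul_mem ?_ h) _
  simpa using prod_map_commutator_mem [((C * B)⁻¹ * x, A * y * B)]

/-- **Handle reduction bound**: `cl(x A y B x⁻¹ C y⁻¹ D) ≤ cl(A D C B) + 1` whenever
`A D C B ∈ [G,G]` — cutting off the handle spanned by the linked pair `x, y` costs one commutator
and reorders the remaining segments as `A D C B`. Iterating this (and deleting adjacent `x x⁻¹`)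
is the algebraic core of "a pairing / fatgraph of genus `g` writes its boundary word as a product
of `g` commutators" (Culler; loc. cit. Lemma 3.5). [folklore] -/
theorem commutatorLength_handle_le (x y A B C D : G) (h : A * D * C * B ∈ commutator G) :
    commutatorLength (x * A * y * B * x⁻¹ * C * y⁻¹ * D) ≤ commutatorLength (A * D * C * B) + 1 := by
  rw [handle_eq_conj_commutator_mul, commutatorLength_conj]
  have hc : ((C * B)⁻¹ * x) * (A * y * B) * ((C * B)⁻¹ * x)⁻¹ * (A * y * B)⁻¹ ∈ commutator G := by
    simpa using prod_map_commutator_mem [((C * B)⁻¹ * x, A * y * B)]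
  refine (commutatorLength_mul_le hc h).trans ?_
  rw [add_comm]
  exact Nat.add_le_add_left (commutatorLength_commutatorElement_le _ _) _

/-- The same with the linked pair oriented `x … y⁻¹ … x⁻¹ … y`. [folklore] -/
theorem commutatorLength_handle_le' (x y A B C D : G) (h : A * D * C * B ∈ commutator G) :
    commutatorLength (x * A * y⁻¹ * B * x⁻¹ * C * y * D) ≤ commutatorLength (A * D * C * B) + 1 := by
  simpa using commutatorLength_handle_le x y⁻¹ A B C D h

end HandleReduction

/-! ### §4.2, Lemma 4.4: tripod labels

"A triple `x, y, z` of reduced words of length `L` are the labels of a tripod if and only if their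
last letters are distinct. Consequently, for any reduced word `xY` of length `2L`, there are
`(2k−2)(2k−1)^{L−1}` choices for `z`" (loc. cit. Lemma 4.4): the edge labels `xY`, `yZ`, `zX` of the
tripod `T(x,y,z)` must be reduced, and `x y⁻¹` is reduced iff the last letters of `x` and `y` differ
(`isReduced_append_invRev_iff`); the reduced words of length `n + 1` with prescribed last letter
number `(2k−1)ⁿ` (`card_reducedWords_filter_last`) and those whose last letter avoids two given
distinct letters number `(2k−2)(2k−1)ⁿ` (`card_reducedWords_filter_last_ne_ne`). -/

section Tripods

open scoped Classical

/-- Reduced words of length `n + 1` with prescribed LAST letter number `(2k−1)ⁿ`. [folklore] -/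
theorem card_reducedWords_filter_last (k n : ℕ) (a : Fin k × Bool) :
    ((reducedWords k (n + 1)).filter fun w => w (Fin.last n) = a).card = (2 * k - 1) ^ n := by
  induction n with
  | zero =>
    have h := card_reducedWords_filter_head k 0 a
    rw [pow_zero] at h ⊢
    exact (congrArg Finset.card (Finset.filter_congr fun w _ => by rw [Fin.last_zero])).trans h
  | succ n ih =>
    have h := card_filter_tail k (N := n + 1) (by omega) (fun u => u (Fin.last n) = a)
    rw [ih] at h
    rw [pow_succ']
    exact h

/-- Reduced words of length `n + 1` whose last letter avoids two given distinct letters number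
`(2k−2)(2k−1)ⁿ` — "for any reduced word `xY` of length `2L` there are `(2k−2)(2k−1)^{L−1}` choices
for `z`" with `T(x,y,z)` a tripod (loc. cit. Lemma 4.4, `n = L − 1`, the avoided letters being the
last letters of `x` and `y`). [cite: CalegariWalker2013, Lemma 4.4] -/
theorem card_reducedWords_filter_last_ne_ne (k n : ℕ) {a b : Fin k × Bool} (hab : a ≠ b) :
    ((reducedWords k (n + 1)).filter fun w => w (Fin.last n) ≠ a ∧ w (Fin.last n) ≠ b).card =
      (2 * k - 2) * (2 * k - 1) ^ n := by
  have htot := card_reducedWords k (by omega : 1 ≤ n + 1)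
  rw [Nat.add_sub_cancel] at htot
  have hsplit := Finset.card_filter_add_card_filter_not (s := reducedWords k (n + 1))
    (fun w => w (Fin.last n) = a ∨ w (Fin.last n) = b)
  rw [Finset.filter_or, Finset.card_union_of_disjoint
      (Finset.disjoint_filter.mpr fun w _ h1 h2 => hab (h1.symm.trans h2)),
    card_reducedWords_filter_last, card_reducedWords_filter_last, htot] at hsplit
  have hcongr : ((reducedWords k (n + 1)).filter
      fun w => ¬ (w (Fin.last n) = a ∨ w (Fin.last n) = b)) =
      (reducedWords k (n + 1)).filter fun w => w (Fin.last n) ≠ a ∧ w (Fin.last n) ≠ b :=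
    Finset.filter_congr fun w _ => not_or
  rw [hcongr] at hsplit
  generalize (2 * k - 1) ^ n = P at hsplit ⊢
  rw [Nat.sub_mul]
  omega

/-- `p` may be followed by `c⁻¹` in a reduced word iff `p ≠ c`. [folklore] -/
theorem compatible_inv_iff_ne {α : Type*} (p c : α × Bool) :
    (p.1 = c.1 → p.2 = !c.2) ↔ p ≠ c := by
  obtain ⟨p1, p2⟩ := p
  obtain ⟨c1, c2⟩ := c
  cases p2 <;> cases c2 <;> simp

/-- **Calegari–Walker Lemma 4.4 (criterion).** For non-empty reduced words `x`, `y`, the word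
`x y⁻¹` is reduced iff the last letters of `x` and `y` are distinct; hence `x, y, z` are the incoming
labels of a tripod `T(x,y,z)` (edge labels `xY, yZ, zX` reduced) iff their last letters are
pairwise distinct. [cite: CalegariWalker2013, Lemma 4.4] -/
theorem isReduced_append_invRev_iff {α : Type*} [DecidableEq α] {x y : List (α × Bool)}
    (hx : FreeGroup.IsReduced x) (hy : FreeGroup.IsReduced y) (hx0 : x ≠ []) (hy0 : y ≠ []) :
    FreeGroup.IsReduced (x ++ FreeGroup.invRev y) ↔ x.getLast hx0 ≠ y.getLast hy0 := by
  have hy' : FreeGroup.IsReduced (FreeGroup.invRev y) := by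
    rw [FreeGroup.isReduced_iff_reduce_eq, FreeGroup.reduce_invRev, hy.reduce_eq]
  set c := y.getLast hy0 with hc
  have hy_eq : y = y.dropLast ++ [c] := (List.dropLast_concat_getLast hy0).symm
  have hinv : FreeGroup.invRev y = (c.1, !c.2) :: FreeGroup.invRev y.dropLast := by
    conv_lhs => rw [hy_eq]
    simp [FreeGroup.invRev]
  rw [FreeGroup.IsReduced, List.isChain_append, hinv]
  simp only [List.getLast?_eq_some_getLast hx0, List.head?_cons, Option.mem_def, Option.some.injEq,
    forall_eq', ← compatible_inv_iff_ne]
  rw [← hinv]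
  exact ⟨fun h => h.2.2, fun h => ⟨hx, hy', h⟩⟩

end Tripods

/-! ### Towards Lemma 3.5 (Culler): orientable quadratic words have `cl ≤ (#letter pairs)/2`

An *orientable quadratic word* is a word `Q` over letters `β × Bool` in which every letter that
occurs, occurs exactly once with each sign (`Q.count c ≤ 1` and `Q.count c = Q.count c⁻¹` for all
`c`). These are the boundary words of one-face orientable side pairings; the classification of
surfaces brings such a word to `[x₁,y₁]⋯[x_g,y_g]`. We prove the commutator-length half with no
topology: **`4 · cl(mk Q) ≤ |Q|`** (`commutatorLength_quadratic_le`), by induction — delete an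
adjacent pair `c c⁻¹`, or, when there is none, cut off the handle spanned by two *linked* pairs
`… x … y … x⁻¹ … y⁻¹ …` (`exists_linked_pairs`, `commutatorLength_handle_le`). -/

section QuadraticWords

variable {β : Type*} [DecidableEq β]

omit [DecidableEq β] in
/-- `mk [c⁻¹] = (mk [c])⁻¹` for a single letter `c`. [folklore] -/
theorem mk_singleton_inv_letter (c : β × Bool) :
    FreeGroup.mk [(c.1, !c.2)] = (FreeGroup.mk [c])⁻¹ := by
  rw [FreeGroup.inv_mk]
  simp [FreeGroup.invRev]

omit [DecidableEq β] in
/-- Deleting an adjacent cancelling pair `c c⁻¹` does not change the element of the free group.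
[folklore] -/
theorem mk_append_cancel_eq (P S : List (β × Bool)) (c : β × Bool) :
    FreeGroup.mk (P ++ c :: (c.1, !c.2) :: S) = FreeGroup.mk (P ++ S) := by
  obtain ⟨x, b⟩ := c
  exact Quot.sound FreeGroup.Red.Step.not

omit [DecidableEq β] in
/-- `u = c⁻¹ ↔ u⁻¹ = c` for letters. [folklore] -/
theorem letter_eq_inv_iff (u c : β × Bool) : u = (c.1, !c.2) ↔ (u.1, !u.2) = c := by
  obtain ⟨u1, u2⟩ := u
  obtain ⟨c1, c2⟩ := c
  cases u2 <;> cases c2 <;> simp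

/-- The two-letter word `c c⁻¹` is inverse-symmetric in its letter counts. [folklore] -/
theorem count_pair_inv_symm (x c : β × Bool) :
    [x, (x.1, !x.2)].count c = [x, (x.1, !x.2)].count (c.1, !c.2) := by
  obtain ⟨x1, x2⟩ := x
  obtain ⟨c1, c2⟩ := c
  simp only [List.count_cons, List.count_nil, beq_iff_eq, Prod.mk.injEq]
  cases x2 <;> cases c2 <;> simp

/-- In an orientable quadratic word every position has a partner: the unique other position
carrying the inverse letter. [folklore] -/
theorem exists_partner (Q : List (β × Bool)) (h2 : ∀ c, Q.count c = Q.count (c.1, !c.2))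
    (i : ℕ) (hi : i < Q.length) :
    ∃ (j : ℕ) (hj : j < Q.length), j ≠ i ∧ Q[j] = ((Q[i]).1, !(Q[i]).2) := by
  have hmem : ((Q[i]).1, !(Q[i]).2) ∈ Q := by
    rw [← List.one_le_count_iff, ← h2]
    exact List.one_le_count_iff.mpr (List.getElem_mem hi)
  obtain ⟨j, hj, hjq⟩ := List.getElem_of_mem hmem
  refine ⟨j, hj, ?_, hjq⟩
  rintro rfl
  have h := congrArg Prod.snd hjq
  simp at h

/-- **Linked pairs exist.** In a non-empty orientable quadratic word without an adjacent
cancelling pair `c c⁻¹`, some two letter pairs are linked: there are positions `i < p < j < q`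
with `Q[j] = Q[i]⁻¹` and `Q[q] = Q[p]⁻¹` (take a pair `(i, j)` at minimal distance and
`p = i + 1`). [folklore] -/
theorem exists_linked_pairs (Q : List (β × Bool)) (hQ : Q ≠ [])
    (h1 : ∀ c, Q.count c ≤ 1) (h2 : ∀ c, Q.count c = Q.count (c.1, !c.2))
    (hna : ∀ (i : ℕ) (hi : i + 1 < Q.length), Q[i + 1] ≠ ((Q[i]).1, !(Q[i]).2)) :
    ∃ (i p j q : ℕ) (hq : q < Q.length) (_ : i < p ∧ p < j ∧ j < q),
      Q[j]'(by omega) = ((Q[i]'(by omega)).1, !(Q[i]'(by omega)).2) ∧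
        Q[q] = ((Q[p]'(by omega)).1, !(Q[p]'(by omega)).2) := by
  classical
  have hnd : Q.Nodup := List.nodup_iff_count_le_one.mpr h1
  -- pairs `i < j` with `Q[j] = Q[i]⁻¹`, by distance
  let Pd : ℕ → Prop := fun d => ∃ (i j : ℕ) (hj : j < Q.length) (hij : i < j),
    j - i = d ∧ Q[j] = ((Q[i]'(by omega)).1, !(Q[i]'(by omega)).2)
  have hex : ∃ d, Pd d := by
    obtain ⟨j, hj, hj0, hjq⟩ := exists_partner Q h2 0 (List.length_pos_iff.mpr hQ)
    exact ⟨j - 0, 0, j, hj, by omega, rfl, hjq⟩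
  obtain ⟨i, j, hj, hij, hd, hji⟩ := Nat.find_spec hex
  have hmin : ∀ d < Nat.find hex, ¬ Pd d := fun d hd => Nat.find_min hex hd
  -- the pair `(i, j)` is not adjacent
  have hd2 : i + 1 < j := by
    by_contra hle
    have hj1 : j = i + 1 := by omega
    subst hj1
    exact hna i hj hji
  -- the partner `q` of `p = i + 1`
  obtain ⟨q, hq, hqp, hqQ⟩ := exists_partner Q h2 (i + 1) (by omega)
  rcases Nat.lt_or_ge q i with hqi | hqi
  · -- `q < i < i + 1 < j`: the pairs `(q, i+1)` and `(i, j)` are linked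
    refine ⟨q, i, i + 1, j, hj, ⟨hqi, by omega, hd2⟩, ?_, hji⟩
    rw [hqQ]
    simp
  rcases Nat.lt_or_ge q j with hqj | hqj
  · exfalso
    rcases Nat.lt_or_ge q (i + 1) with hq1 | hq1
    · -- `q = i`: then `Q[j] = Q[i]⁻¹ = Q[i+1]`, contradicting `Nodup`
      have hqi' : q = i := by omega
      subst hqi'
      have e1 : Q[j] = Q[q + 1] := by
        rw [hji, hqQ]
        simp
      have := (hnd.getElem_inj_iff).mp e1
      omega
    · -- `i + 1 < q < j`: the pair `(i+1, q)` is closer than `(i, j)`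
      have hq2 : i + 1 < q := lt_of_le_of_ne hq1 (Ne.symm hqp)
      exact hmin (q - (i + 1)) (by omega) ⟨i + 1, q, hq, hq2, rfl, hqQ⟩
  rcases Nat.eq_or_lt_of_le hqj with hqj' | hqj'
  · -- `q = j`: then `Q[i]⁻¹ = Q[j] = Q[i+1]⁻¹`, contradicting `Nodup`
    exfalso
    subst hqj'
    have h := hji.symm.trans hqQ
    rw [Prod.mk.injEq] at h
    have e1 : Q[i] = Q[i + 1] := Prod.ext h.1 (Bool.not_inj h.2)
    have := (hnd.getElem_inj_iff).mp e1
    omega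
  · exact ⟨i, i + 1, j, q, hq, ⟨by omega, hd2, hqj'⟩, hji, hqQ⟩

/-- Removing an inverse-symmetric set of letters preserves the orientable quadratic property.
[folklore] -/
theorem quadratic_of_count_eq_add {Q Q' R : List (β × Bool)}
    (hc : ∀ c, Q.count c = Q'.count c + R.count c) (hR : ∀ c, R.count c = R.count (c.1, !c.2))
    (h1 : ∀ c, Q.count c ≤ 1) (h2 : ∀ c, Q.count c = Q.count (c.1, !c.2)) :
    (∀ c, Q'.count c ≤ 1) ∧ ∀ c, Q'.count c = Q'.count (c.1, !c.2) := by
  refine ⟨fun c => ?_, fun c => ?_⟩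
  · have h := h1 c
    rw [hc] at h
    omega
  · have h := h2 c
    rw [hc, hc, hR] at h
    omega

/-- An orientable quadratic word represents an element of the commutator subgroup. [folklore] -/
theorem mk_mem_commutator_of_quadratic {Q : List (β × Bool)}
    (h2 : ∀ c, Q.count c = Q.count (c.1, !c.2)) : FreeGroup.mk Q ∈ commutator (FreeGroup β) :=
  (mk_mem_commutator_iff_count Q).mpr fun a => h2 (a, true)

/-- **Orientable quadratic words have `cl ≤ (#letter pairs)/2`.** If every letter of `Q` occurs at
most once and as often as its inverse, then `4 · cl(mk Q) ≤ |Q|`. This is the commutator-length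
content of the classification of orientable surfaces with one boundary polygon (the word of a
genus-`g` one-vertex one-face gluing has `2g` letter pairs); the proof deletes adjacent pairs
`c c⁻¹` and cuts off handles of linked pairs (`commutatorLength_handle_le`). [folklore] -/
theorem commutatorLength_quadratic_le (Q : List (β × Bool))
    (h1 : ∀ c, Q.count c ≤ 1) (h2 : ∀ c, Q.count c = Q.count (c.1, !c.2)) :
    4 * commutatorLength (FreeGroup.mk Q) ≤ Q.length := by
  obtain ⟨n, hn⟩ : ∃ n, Q.length = n := ⟨_, rfl⟩
  induction n using Nat.strong_induction_on generalizing Q with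
  | _ n ih =>
  by_cases hQ : Q = []
  · subst hQ
    rw [← FreeGroup.one_eq_mk, commutatorLength_one]
    simp
  by_cases hadj : ∃ (i : ℕ) (hi : i + 1 < Q.length), Q[i + 1] = ((Q[i]).1, !(Q[i]).2)
  · -- delete an adjacent cancelling pair
    obtain ⟨i, hi, hci⟩ := hadj
    obtain ⟨Q', hQ'⟩ : ∃ Q', Q' = Q.take i ++ Q.drop (i + 2) := ⟨_, rfl⟩
    have hsplit : Q = Q.take i ++ Q[i] :: ((Q[i]).1, !(Q[i]).2) :: Q.drop (i + 2) := by
      conv_lhs => rw [← List.take_append_drop i Q,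
        List.drop_eq_getElem_cons (show i < Q.length by omega), List.drop_eq_getElem_cons hi, hci]
    have hmk : FreeGroup.mk Q = FreeGroup.mk Q' := by
      conv_lhs => rw [hsplit]
      rw [hQ']
      exact mk_append_cancel_eq _ _ _
    have hcount : ∀ c, Q.count c = Q'.count c + [Q[i], ((Q[i]).1, !(Q[i]).2)].count c := by
      intro c
      conv_lhs => rw [hsplit]
      simp only [hQ', List.count_append, List.count_cons, List.count_nil]
      ring
    obtain ⟨h1', h2'⟩ := quadratic_of_count_eq_add hcount (count_pair_inv_symm (Q[i])) h1 h2
    have hlen : Q'.length = n - 2 := by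
      simp only [hQ', List.length_append, List.length_take, List.length_drop]
      omega
    have h := ih (n - 2) (by omega) Q' h1' h2' hlen
    rw [hmk]
    omega
  · -- no adjacent pair: cut off the handle of two linked pairs
    have hna : ∀ (i : ℕ) (hi : i + 1 < Q.length), Q[i + 1] ≠ ((Q[i]).1, !(Q[i]).2) :=
      fun i hi h => hadj ⟨i, hi, h⟩
    obtain ⟨i, p, j, q, hq, ⟨hip, hpj, hjq⟩, hji, hqp⟩ := exists_linked_pairs Q hQ h1 h2 hna
    obtain ⟨T, hT⟩ : ∃ T, T = Q.take i := ⟨_, rfl⟩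
    obtain ⟨A, hA⟩ : ∃ A, A = (Q.drop (i + 1)).take (p - i - 1) := ⟨_, rfl⟩
    obtain ⟨B, hB⟩ : ∃ B, B = (Q.drop (p + 1)).take (j - p - 1) := ⟨_, rfl⟩
    obtain ⟨C, hC⟩ : ∃ C, C = (Q.drop (j + 1)).take (q - j - 1) := ⟨_, rfl⟩
    obtain ⟨D, hD⟩ : ∃ D, D = Q.drop (q + 1) := ⟨_, rfl⟩
    obtain ⟨x, hx⟩ : ∃ x, x = Q[i]'(by omega) := ⟨_, rfl⟩
    obtain ⟨y, hy⟩ : ∃ y, y = Q[p]'(by omega) := ⟨_, rfl⟩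
    -- `Q = T x A y B x⁻¹ C y⁻¹ D`
    have eT : Q = T ++ Q.drop i := by rw [hT, List.take_append_drop]
    have ei : Q.drop i = x :: Q.drop (i + 1) := by rw [hx]; exact List.drop_eq_getElem_cons _
    have eA : Q.drop (i + 1) = A ++ Q.drop p := by
      rw [hA]
      conv_lhs => rw [← List.take_append_drop (p - i - 1) (Q.drop (i + 1)), List.drop_drop,
        show i + 1 + (p - i - 1) = p by omega]
    have ep : Q.drop p = y :: Q.drop (p + 1) := by rw [hy]; exact List.drop_eq_getElem_cons _
    have eB : Q.drop (p + 1) = B ++ Q.drop j := by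
      rw [hB]
      conv_lhs => rw [← List.take_append_drop (j - p - 1) (Q.drop (p + 1)), List.drop_drop,
        show p + 1 + (j - p - 1) = j by omega]
    have ej : Q.drop j = (x.1, !x.2) :: Q.drop (j + 1) := by
      rw [hx, ← hji]; exact List.drop_eq_getElem_cons _
    have eC : Q.drop (j + 1) = C ++ Q.drop q := by
      rw [hC]
      conv_lhs => rw [← List.take_append_drop (q - j - 1) (Q.drop (j + 1)), List.drop_drop,
        show j + 1 + (q - j - 1) = q by omega]
    have eq' : Q.drop q = (y.1, !y.2) :: D := by
      rw [hy, ← hqp, hD]; exact List.drop_eq_getElem_cons _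
    have hsplit : Q = T ++ [x] ++ A ++ [y] ++ B ++ [(x.1, !x.2)] ++ C ++ [(y.1, !y.2)] ++ D := by
      conv_lhs => rw [eT, ei, eA, ep, eB, ej, eC, eq']
      simp only [List.append_assoc, List.cons_append, List.nil_append]
    -- the remainder `A D T C B`
    obtain ⟨Q₂, hQ₂⟩ : ∃ Q₂, Q₂ = A ++ (D ++ T) ++ C ++ B := ⟨_, rfl⟩
    have hcount : ∀ c, Q.count c = Q₂.count c +
        ([x, (x.1, !x.2)] ++ [y, (y.1, !y.2)]).count c := by
      intro c
      conv_lhs => rw [hsplit]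
      simp only [hQ₂, List.count_append, List.count_cons, List.count_nil]
      ring
    have hR : ∀ c, ([x, (x.1, !x.2)] ++ [y, (y.1, !y.2)]).count c =
        ([x, (x.1, !x.2)] ++ [y, (y.1, !y.2)]).count (c.1, !c.2) := fun c => by
      rw [List.count_append, List.count_append, count_pair_inv_symm x c, count_pair_inv_symm y c]
    obtain ⟨h1', h2'⟩ := quadratic_of_count_eq_add hcount hR h1 h2
    have hlen : Q₂.length = n - 4 := by
      have h := congrArg List.length hsplit
      simp only [List.length_append, List.length_cons, List.length_nil] at h
      simp only [hQ₂, List.length_append]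
      omega
    have hIH := ih (n - 4) (by omega) Q₂ h1' h2' hlen
    have hmem : FreeGroup.mk Q₂ ∈ commutator (FreeGroup β) := mk_mem_commutator_of_quadratic h2'
    -- group elements
    have hmkQ : FreeGroup.mk Q = FreeGroup.mk T * FreeGroup.mk [x] * FreeGroup.mk A *
        FreeGroup.mk [y] * FreeGroup.mk B * (FreeGroup.mk [x])⁻¹ * FreeGroup.mk C *
        (FreeGroup.mk [y])⁻¹ * FreeGroup.mk D := by
      conv_lhs => rw [hsplit]
      simp only [← FreeGroup.mul_mk, mk_singleton_inv_letter]
    have hmkQ₂ : FreeGroup.mk Q₂ = FreeGroup.mk A * (FreeGroup.mk D * FreeGroup.mk T) *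
        FreeGroup.mk C * FreeGroup.mk B := by
      rw [hQ₂]
      simp only [← FreeGroup.mul_mk]
    set t := FreeGroup.mk T
    set X := FreeGroup.mk [x]
    set Y := FreeGroup.mk [y]
    set a := FreeGroup.mk A
    set b := FreeGroup.mk B
    set c := FreeGroup.mk C
    set d := FreeGroup.mk D
    have hconj : commutatorLength (FreeGroup.mk Q) =
        commutatorLength (X * a * Y * b * X⁻¹ * c * Y⁻¹ * (d * t)) := by
      rw [hmkQ, ← commutatorLength_conj (X * a * Y * b * X⁻¹ * c * Y⁻¹ * (d * t)) t]
      congr 1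
      group
    rw [hmkQ₂] at hmem hIH
    have hle := commutatorLength_handle_le X Y a b c (d * t) hmem
    rw [hconj]
    omega

end QuadraticWords

/-! ### Lemma 3.5 (Culler), commutator-length half: a pairing of a word bounds its `cl`

Setting: a word `w`, a *pairing* `π` of its positions (a fixed-point-free involution with
`w(π i) = w(i)⁻¹`, as in `IsPairing`), and a labelling `vert` of the corners of the boundary
polygon (corner `i` = start of side `i`) invariant under the corner identifications of the side
pairing, `vert (π i + 1) = vert i`. The finest such labelling is the orbit map of
`τ = rot ∘ π`, whose number of values `V` is the number of vertices of the glued surface, and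
Euler's formula reads `2 − 2g = V − |w|/2 + 1`. We prove **`2 cl(mk w) + V ≤ |w|/2 + 1`**, i.e.
`cl(w) ≤ g`, for every invariant labelling (`commutatorLength_le_of_pairing`) — with no topology:
`mk w` is the image of the universal quadratic word `U` of the pairing under the labelling
homomorphism (so `cl(mk w) ≤ cl(mk U)`); a potential on the corner classes, grown along the walk
`0, 1, …, n` (first visits = `V − 1` tree darts), defines an endomorphism `θ` of the free group on
the darts fixing `mk U` up to conjugation and killing the tree letters, so `cl(mk U) ≤ cl(mk U')`
for the quadratic word `U'` with `|w|/2 − (V − 1)` letter pairs, and `commutatorLength_quadratic_le`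
finishes. -/

section PairingBound

/-- Telescoping in a group: `∏_{i<n} aᵢ gᵢ aᵢ₊₁⁻¹ = a₀ (∏_{i<n} gᵢ) aₙ⁻¹` (list products).
[folklore] -/
theorem prod_range_map_telescope {G : Type*} [Group G] (a g : ℕ → G) (n : ℕ) :
    ((List.range n).map fun i => a i * g i * (a (i + 1))⁻¹).prod =
      a 0 * ((List.range n).map g).prod * (a n)⁻¹ := by
  induction n with
  | zero => simp
  | succ n ih =>
    rw [List.range_succ, List.map_append, List.prod_append, ih, List.map_append,
      List.prod_append]
    simp only [List.map_cons, List.map_nil, List.prod_cons, List.prod_nil, mul_one]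
    group

/-- `mk L` is the product of the one-letter elements `mk [c]`. [folklore] -/
theorem mk_eq_prod_map_singleton {β : Type*} (L : List (β × Bool)) :
    FreeGroup.mk L = (L.map fun c => FreeGroup.mk [c]).prod := by
  induction L with
  | nil => rfl
  | cons c L ih =>
    rw [List.map_cons, List.prod_cons, ← ih, FreeGroup.mul_mk]
    rfl

/-- Dropping factors equal to `1` from a list product. [folklore] -/
theorem prod_map_filter_of_eq_one {ι G : Type*} [Monoid G] (l : List ι) (p : ι → Bool)
    (f : ι → G) (h : ∀ i ∈ l, p i = false → f i = 1) :
    ((l.filter p).map f).prod = (l.map f).prod := by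
  induction l with
  | nil => simp
  | cons a l ih =>
    have ih' := ih fun i hi => h i (List.mem_cons_of_mem a hi)
    cases hp : p a
    · rw [List.filter_cons_of_neg (by simp [hp]), List.map_cons, List.prod_cons,
        h a List.mem_cons_self hp, one_mul, ih']
    · rw [List.filter_cons_of_pos hp, List.map_cons, List.map_cons, List.prod_cons,
        List.prod_cons, ih']

/-- `(range n).map g = (finRange n).map (g ∘ val)`. [folklore] -/
theorem map_range_eq_map_finRange {δ : Type*} (n : ℕ) (g : ℕ → δ) :
    (List.range n).map g = (List.finRange n).map fun i => g i.val := by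
  apply List.ext_getElem
  · simp
  · intro i h1 h2
    simp

/-- The length of a filtered `finRange` is the cardinality of the corresponding filter of
`univ`. [folklore] -/
theorem length_filter_finRange {n : ℕ} (p : Fin n → Bool) :
    ((List.finRange n).filter p).length = (Finset.univ.filter fun i => p i).card := by
  rw [Fin.univ_def, Finset.card_def, Finset.filter_val]
  simp [Multiset.filter_coe]

/-- The rotation of `Fin n` adds one modulo `n`. [folklore] -/
theorem val_finRotate {n : ℕ} (hn : 0 < n) (j : Fin n) :
    ((finRotate n j : Fin n) : ℕ) = (j + 1) % n := by
  obtain ⟨k, rfl⟩ : ∃ k, n = k + 1 := ⟨n - 1, by omega⟩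
  rw [coe_finRotate]
  split_ifs with h
  · subst h
    simp
  · have := Fin.val_lt_last h
    rw [Nat.mod_eq_of_lt (by omega)]

/-- **Tree potentials along a walk.** Let corners `0, 1, 2, …` carry classes `cv m : γ` and let the
dart from corner `m` to corner `m + 1` carry `ℓ m ∈ G`. Then for every `m` there are a potential
`P : γ → G` and a set `T₀` of darts `< m`, one ending at each class met by the corners `≤ m` other
than the class of corner `0`, each being the FIRST visit of its end class, with
`P(cv(i+1)) = P(cv i) · ℓ i` on `T₀`. [folklore] -/
theorem exists_tree_potential {γ G : Type*} [DecidableEq γ] [Group G] (cv : ℕ → γ) (ℓ : ℕ → G)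
    (m : ℕ) :
    ∃ (P : γ → G) (T₀ : Finset ℕ),
      (∀ i ∈ T₀, i < m ∧ P (cv (i + 1)) = P (cv i) * ℓ i ∧ ∀ m' ≤ i, cv m' ≠ cv (i + 1)) ∧
        T₀.card + 1 = ((Finset.range (m + 1)).image cv).card := by
  induction m with
  | zero => exact ⟨fun _ => 1, ∅, by simp, by simp⟩
  | succ m ih =>
    obtain ⟨P, T₀, hT, hc⟩ := ih
    by_cases hmem : cv (m + 1) ∈ (Finset.range (m + 1)).image cv
    · refine ⟨P, T₀, fun i hi => ⟨by have := (hT i hi).1; omega, (hT i hi).2⟩, ?_⟩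
      rw [Finset.range_add_one, Finset.image_insert, Finset.insert_eq_of_mem hmem]
      exact hc
    · have hne : ∀ m' ≤ m, cv m' ≠ cv (m + 1) := by
        intro m' hm' h
        exact hmem (Finset.mem_image.mpr ⟨m', Finset.mem_range.mpr (by omega), h⟩)
      refine ⟨Function.update P (cv (m + 1)) (P (cv m) * ℓ m), insert m T₀, ?_, ?_⟩
      · intro i hi
        rcases Finset.mem_insert.mp hi with rfl | hi
        · refine ⟨by omega, ?_, hne⟩
          rw [Function.update_self, Function.update_of_ne (hne i le_rfl)]
        · obtain ⟨him, hPi, hfirst⟩ := hT i hi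
          refine ⟨by omega, ?_, hfirst⟩
          rw [Function.update_of_ne (hne (i + 1) (by omega)), Function.update_of_ne (hne i (by omega))]
          exact hPi
      · have hm : m ∉ T₀ := fun h => by have := (hT m h).1; omega
        rw [Finset.card_insert_of_notMem hm, Finset.range_add_one, Finset.image_insert,
          Finset.card_insert_of_notMem hmem, hc]

/-- The universal quadratic word of a fixed-point-free involution `π` of `Fin n`:
`U i = (i, tt)` if `i < π i` and `(π i, ff)` otherwise; with a `π`-closed set `S` of positions
removed it is an orientable quadratic word. [folklore] -/
theorem quadratic_universalWord {n : ℕ} (π : Equiv.Perm (Fin n)) (hπ : ∀ i, π (π i) = i)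
    (hπ' : ∀ i, π i ≠ i) (S : Finset (Fin n)) (hS : ∀ i, i ∈ S ↔ π i ∈ S) :
    (∀ c, (((List.finRange n).filter fun i => decide (i ∉ S)).map fun i =>
        if i < π i then (i, true) else (π i, false)).count c ≤ 1) ∧
      ∀ c, (((List.finRange n).filter fun i => decide (i ∉ S)).map fun i =>
          if i < π i then (i, true) else (π i, false)).count c =
        (((List.finRange n).filter fun i => decide (i ∉ S)).map fun i =>
          if i < π i then (i, true) else (π i, false)).count (c.1, !c.2) := by
  set U : Fin n → Fin n × Bool := fun i => if i < π i then (i, true) else (π i, false) with hUdef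
  have hU : ∀ i, U (π i) = ((U i).1, !(U i).2) := by
    intro i
    simp only [hUdef, hπ]
    by_cases h : i < π i
    · rw [if_neg (lt_asymm h), if_pos h]
      rfl
    · have h' : π i < i := lt_of_le_of_ne (not_lt.mp h) (hπ' i)
      rw [if_pos h', if_neg h]
      rfl
  have hUinj : Function.Injective U := by
    intro i j hij
    have e : (if i < π i then (i, true) else (π i, false)) =
        (if j < π j then (j, true) else (π j, false)) := hij
    by_cases hi : i < π i
    · by_cases hj : j < π j
      · rw [if_pos hi, if_pos hj] at e
        exact congrArg Prod.fst e
      · rw [if_pos hi, if_neg hj] at e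
        exact absurd (congrArg Prod.snd e) (by simp)
    · by_cases hj : j < π j
      · rw [if_neg hi, if_pos hj] at e
        exact absurd (congrArg Prod.snd e) (by simp)
      · rw [if_neg hi, if_neg hj] at e
        exact π.injective (congrArg Prod.fst e)
  have hcount : ∀ c, (((List.finRange n).filter fun i => decide (i ∉ S)).map U).count c =
      (Finset.univ.filter fun i => U i = c ∧ i ∉ S).card := by
    intro c
    rw [List.count_eq_countP, List.countP_map, List.countP_filter, List.countP_eq_length_filter,
      length_filter_finRange]
    exact congrArg Finset.card (Finset.filter_congr fun i _ => by simp)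
  refine ⟨fun c => ?_, fun c => ?_⟩
  · rw [hcount]
    refine Finset.card_le_one.mpr fun i hi j hj => ?_
    simp only [Finset.mem_filter, Finset.mem_univ, true_and] at hi hj
    exact hUinj (hi.1.trans hj.1.symm)
  · rw [hcount, hcount]
    refine Finset.card_nbij' (fun j => π j) (fun j => π j) ?_ ?_ (fun j _ => hπ j) (fun j _ => hπ j)
    · intro j hj
      simp only [Finset.coe_filter, Set.mem_setOf_eq, Finset.mem_univ, true_and] at hj ⊢
      exact ⟨by rw [hU, hj.1], fun h => hj.2 ((hS j).mpr h)⟩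
    · intro j hj
      simp only [Finset.coe_filter, Set.mem_setOf_eq, Finset.mem_univ, true_and] at hj ⊢
      refine ⟨by rw [hU, hj.1]; simp, fun h => hj.2 ((hS j).mpr h)⟩

/-- **Culler's bound (pairing ⇒ commutators; Lemma 3.5 in one direction).** Let `π` be a pairing of
the word `w` — a fixed-point-free involution of its positions with `w(π i) = w(i)⁻¹` — and `vert` a
labelling of the corners invariant under the side-pairing identifications, `vert(π i + 1) = vert i`,
with `V` values. Then `2 · cl(mk w) + V ≤ |w|/2 + 1`. For the orbit labelling of `rot ∘ π` (whose
orbits are the vertices of the glued surface) this is `cl(w) ≤ g(π) = |w|/4 − V/2 + 1/2`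
(Culler 1981; Bardakov's formula, `≤`; loc. cit. Lemma 3.5 for one boundary component): the genus
of any one-face pairing surface of `w` bounds `cl(w)`. Proved with no topology (universal quadratic
word, tree potential, `commutatorLength_quadratic_le`). [cite: CalegariWalker2013, Lemma 3.5] -/
theorem commutatorLength_le_of_pairing {α γ : Type*} [DecidableEq α] [DecidableEq γ]
    (w : List (α × Bool)) (π : Equiv.Perm (Fin w.length))
    (hπ : ∀ i, π (π i) = i) (hπ' : ∀ i, π i ≠ i)
    (hw : ∀ i, w.get (π i) = ((w.get i).1, !(w.get i).2))
    (vert : Fin w.length → γ) (hvert : ∀ i, vert (finRotate _ (π i)) = vert i) :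
    2 * commutatorLength (FreeGroup.mk w) + (Finset.univ.image vert).card ≤ w.length / 2 + 1 := by
  rcases Nat.eq_zero_or_pos w.length with hn0 | hn0
  · -- the empty word
    have hV : (Finset.univ.image vert).card = 0 := by
      apply Nat.eq_zero_of_le_zero
      calc (Finset.univ.image vert).card ≤ (Finset.univ : Finset (Fin w.length)).card :=
            Finset.card_image_le
        _ = 0 := by simp [hn0]
    have hcl : commutatorLength (FreeGroup.mk w) = 0 := by
      rw [List.length_eq_zero_iff.mp hn0, ← FreeGroup.one_eq_mk, commutatorLength_one]
    omega
  -- indices modulo `w.length`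
  have hmod : ∀ m, m % w.length < w.length := fun m => Nat.mod_lt _ hn0
  set fin : ℕ → Fin w.length := fun m => ⟨m % w.length, hmod m⟩ with hfindef
  have hfin : ∀ i : Fin w.length, fin i.val = i := fun i => Fin.ext (Nat.mod_eq_of_lt i.isLt)
  have hfin_val : ∀ m, m < w.length → (fin m).val = m := fun m hm => Nat.mod_eq_of_lt hm
  have hfin_succ : ∀ m, finRotate w.length (fin m) = fin (m + 1) := fun m =>
    Fin.ext (by rw [val_finRotate hn0]; exact Nat.mod_add_mod m w.length 1)
  -- corner classes
  set cv : ℕ → γ := fun m => vert (fin m) with hcvdef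
  have hcv1 : ∀ m, cv ((π (fin m)).val + 1) = cv m := by
    intro m
    show vert (fin ((π (fin m)).val + 1)) = vert (fin m)
    rw [← hfin_succ, hfin, hvert]
  have hcv2 : ∀ m, cv (π (fin m)).val = cv (m + 1) := by
    intro m
    show vert (fin (π (fin m)).val) = vert (fin (m + 1))
    rw [hfin, ← hfin_succ, ← hvert (π (fin m)), hπ]
  -- universal letters
  set U : Fin w.length → Fin w.length × Bool := fun i => if i < π i then (i, true) else (π i, false) with hUdef
  have hU : ∀ i, U (π i) = ((U i).1, !(U i).2) := by
    intro i
    simp only [hUdef, hπ]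
    by_cases h : i < π i
    · rw [if_neg (lt_asymm h), if_pos h]
      rfl
    · have h' : π i < i := lt_of_le_of_ne (not_lt.mp h) (hπ' i)
      rw [if_pos h', if_neg h]
      rfl
  -- letters as elements of the free group on the darts
  set ℓ : ℕ → FreeGroup (Fin w.length) := fun m => FreeGroup.mk [U (fin m)] with hℓdef
  have hℓ : ∀ m, ℓ (π (fin m)).val = (ℓ m)⁻¹ := by
    intro m
    show FreeGroup.mk [U (fin (π (fin m)).val)] = (FreeGroup.mk [U (fin m)])⁻¹
    rw [hfin, hU, mk_singleton_inv_letter]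
  -- tree potential and the transition elements `f`
  obtain ⟨P, T₀, hT, hcard⟩ := exists_tree_potential cv ℓ w.length
  set Pc : ℕ → FreeGroup (Fin w.length) := fun m => P (cv m) with hPcdef
  set f : ℕ → FreeGroup (Fin w.length) := fun m => Pc m * ℓ m * (Pc (m + 1))⁻¹ with hfdef
  have hf_inv : ∀ m, f (π (fin m)).val = (f m)⁻¹ := by
    intro m
    show P (cv (π (fin m)).val) * ℓ (π (fin m)).val * (P (cv ((π (fin m)).val + 1)))⁻¹ =
      (P (cv m) * ℓ m * (P (cv (m + 1)))⁻¹)⁻¹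
    rw [hcv2, hℓ, hcv1]
    group
  have hf_tree : ∀ i ∈ T₀, f i = 1 := by
    intro i hi
    obtain ⟨-, hPi, -⟩ := hT i hi
    show P (cv i) * ℓ i * (P (cv (i + 1)))⁻¹ = 1
    rw [hPi]
    group
  -- the endomorphism `θ`
  set θ : FreeGroup (Fin w.length) →* FreeGroup (Fin w.length) := FreeGroup.lift fun e => f e.val with hθdef
  have hθℓ : ∀ m, m < w.length → θ (ℓ m) = f m := by
    intro m hm
    show FreeGroup.lift (fun e : Fin w.length => f e.val) (FreeGroup.mk [U (fin m)]) = f m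
    rw [FreeGroup.lift_mk]
    simp only [List.map_cons, List.map_nil, List.prod_cons, List.prod_nil, mul_one]
    by_cases h : fin m < π (fin m)
    · have hU1 : U (fin m) = (fin m, true) := if_pos h
      rw [hU1]
      show f (fin m).val = f m
      rw [hfin_val m hm]
    · have hU1 : U (fin m) = (π (fin m), false) := if_neg h
      rw [hU1]
      show (f (π (fin m)).val)⁻¹ = f m
      rw [hf_inv, inv_inv]
  -- the universal word as a product, and `θ` fixes it up to conjugation
  have hUlist : FreeGroup.mk (List.ofFn U) = ((List.range w.length).map ℓ).prod := by
    rw [mk_eq_prod_map_singleton, List.ofFn_eq_map, List.map_map, map_range_eq_map_finRange]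
    congr 1
    refine List.map_congr_left fun i _ => ?_
    show FreeGroup.mk [U i] = FreeGroup.mk [U (fin i.val)]
    rw [hfin]
  have hθU : θ (FreeGroup.mk (List.ofFn U)) =
      Pc 0 * FreeGroup.mk (List.ofFn U) * (Pc 0)⁻¹ := by
    rw [hUlist, map_list_prod, List.map_map]
    have e1 : (List.range w.length).map (⇑θ ∘ ℓ) = (List.range w.length).map f :=
      List.map_congr_left fun m hm => hθℓ m (List.mem_range.mp hm)
    rw [e1]
    have e2 := prod_range_map_telescope Pc ℓ w.length
    have e3 : (List.range w.length).map f =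
        (List.range w.length).map fun i => Pc i * ℓ i * (Pc (i + 1))⁻¹ := rfl
    rw [e3, e2]
    have hcn : Pc w.length = Pc 0 := by
      show P (vert (fin w.length)) = P (vert (fin 0))
      congr 2
      exact Fin.ext (show w.length % w.length = 0 % w.length by simp)
    rw [hcn]
  -- removed darts: tree darts and their partners
  have hT₀lt : ∀ i ∈ T₀, i < w.length := fun i hi => (hT i hi).1
  set T₀f : Finset (Fin w.length) := T₀.attachFin hT₀lt with hT₀fdef
  have hmemT₀f : ∀ i : Fin w.length, i ∈ T₀f ↔ i.val ∈ T₀ := fun i => Finset.mem_attachFin hT₀lt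
  have hcardT₀f : T₀f.card = T₀.card := Finset.card_attachFin _ _
  have hforward : ∀ i ∈ T₀f, i < π i := by
    intro i hi
    rw [hmemT₀f] at hi
    obtain ⟨-, -, hfirst⟩ := hT i.val hi
    by_contra hle
    refine hfirst (π i).val (not_lt.mp hle) ?_
    have h := hcv2 i.val
    rwa [hfin] at h
  set Rm : Finset (Fin w.length) := T₀f ∪ T₀f.image π with hRmdef
  have hRm_disj : Disjoint T₀f (T₀f.image π) := by
    rw [Finset.disjoint_left]
    intro i hi hi'
    obtain ⟨j, hj, hji⟩ := Finset.mem_image.mp hi'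
    have h1 := hforward i hi
    have h2 := hforward j hj
    rw [← hji, hπ] at h1
    exact lt_asymm h1 h2
  have hRm_card : Rm.card = 2 * T₀.card := by
    rw [hRmdef, Finset.card_union_of_disjoint hRm_disj,
      Finset.card_image_of_injective _ π.injective, hcardT₀f]
    ring
  have hRm_le : Rm.card ≤ w.length := by
    simpa using Finset.card_le_univ Rm
  have hRm_inv : ∀ i, i ∈ Rm ↔ π i ∈ Rm := by
    intro i
    simp only [hRmdef, Finset.mem_union, Finset.mem_image]
    constructor
    · rintro (h | ⟨j, hj, rfl⟩)
      · exact Or.inr ⟨i, h, rfl⟩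
      · rw [hπ]
        exact Or.inl hj
    · rintro (h | ⟨j, hj, hji⟩)
      · exact Or.inr ⟨π i, h, hπ i⟩
      · exact Or.inl (π.injective hji ▸ hj)
  have hf_Rm : ∀ i ∈ Rm, f i.val = 1 := by
    intro i hi
    rcases Finset.mem_union.mp hi with h | h
    · exact hf_tree i.val ((hmemT₀f i).mp h)
    · obtain ⟨j, hj, rfl⟩ := Finset.mem_image.mp h
      have h' := hf_inv j.val
      rw [hfin] at h'
      rw [h', hf_tree j.val ((hmemT₀f j).mp hj), inv_one]
  -- the reduced universal word `U'`
  set U' : List (Fin w.length × Bool) :=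
    ((List.finRange w.length).filter fun i => decide (i ∉ Rm)).map U with hU'def
  have hU'prod : FreeGroup.mk U' =
      (((List.finRange w.length).filter fun i => decide (i ∉ Rm)).map fun i => ℓ i.val).prod := by
    rw [hU'def, mk_eq_prod_map_singleton, List.map_map]
    congr 1
    refine List.map_congr_left fun i _ => ?_
    show FreeGroup.mk [U i] = FreeGroup.mk [U (fin i.val)]
    rw [hfin]
  have hθU' : θ (FreeGroup.mk U') = θ (FreeGroup.mk (List.ofFn U)) := by
    rw [hU'prod, hUlist, map_list_prod, map_list_prod, List.map_map, List.map_map,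
      map_range_eq_map_finRange w.length (⇑θ ∘ ℓ)]
    exact prod_map_filter_of_eq_one (List.finRange w.length) (fun i => decide (i ∉ Rm))
      (fun i => θ (ℓ i.val)) fun i _ hk => by
        have hi : i ∈ Rm := by simpa using hk
        show θ (ℓ i.val) = 1
        rw [hθℓ i.val i.isLt, hf_Rm i hi]
  -- the labelling homomorphism
  set lab : FreeGroup (Fin w.length) →* FreeGroup α :=
    FreeGroup.lift fun e => FreeGroup.mk [w.get e] with hlabdef
  have hlabℓ : ∀ m, m < w.length → lab (ℓ m) = FreeGroup.mk [w.get (fin m)] := by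
    intro m _
    show FreeGroup.lift (fun e : Fin w.length => FreeGroup.mk [w.get e]) (FreeGroup.mk [U (fin m)]) = _
    rw [FreeGroup.lift_mk]
    simp only [List.map_cons, List.map_nil, List.prod_cons, List.prod_nil, mul_one]
    by_cases h : fin m < π (fin m)
    · have hU1 : U (fin m) = (fin m, true) := if_pos h
      rw [hU1]
      rfl
    · have hU1 : U (fin m) = (π (fin m), false) := if_neg h
      rw [hU1]
      show (FreeGroup.mk [w.get (π (fin m))])⁻¹ = FreeGroup.mk [w.get (fin m)]
      rw [hw, mk_singleton_inv_letter, inv_inv]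
  have hw_prod : FreeGroup.mk w =
      ((List.finRange w.length).map fun i => FreeGroup.mk [w.get i]).prod := by
    have e : (List.finRange w.length).map (fun i => FreeGroup.mk [w.get i]) =
        ((List.finRange w.length).map w.get).map fun c => FreeGroup.mk [c] := by
      rw [List.map_map]
      rfl
    rw [e, ← List.ofFn_eq_map, List.ofFn_get, ← mk_eq_prod_map_singleton]
  have hlabU : lab (FreeGroup.mk (List.ofFn U)) = FreeGroup.mk w := by
    rw [hUlist, map_list_prod, List.map_map]
    have e1 : (List.range w.length).map (⇑lab ∘ ℓ) =
        (List.range w.length).map fun m => FreeGroup.mk [w.get (fin m)] :=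
      List.map_congr_left fun m hm => hlabℓ m (List.mem_range.mp hm)
    rw [e1, map_range_eq_map_finRange, hw_prod]
    congr 1
    refine List.map_congr_left fun i _ => ?_
    show FreeGroup.mk [w.get (fin i.val)] = FreeGroup.mk [w.get i]
    rw [hfin]
  -- quadratic words
  obtain ⟨hU1, hU2⟩ := quadratic_universalWord π hπ hπ' ∅ (by simp)
  have hL0 : ((List.finRange w.length).filter fun i => decide (i ∉ (∅ : Finset (Fin w.length)))).map U =
      List.ofFn U := by
    rw [List.ofFn_eq_map, List.filter_eq_self.mpr (by simp)]
  rw [hL0] at hU1 hU2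
  obtain ⟨hU'1, hU'2⟩ := quadratic_universalWord π hπ hπ' Rm hRm_inv
  have hUmem : FreeGroup.mk (List.ofFn U) ∈ commutator (FreeGroup (Fin w.length)) :=
    mk_mem_commutator_of_quadratic hU2
  have hU'mem : FreeGroup.mk U' ∈ commutator (FreeGroup (Fin w.length)) :=
    mk_mem_commutator_of_quadratic hU'2
  -- the chain of inequalities
  have h1 : commutatorLength (FreeGroup.mk w) ≤ commutatorLength (FreeGroup.mk (List.ofFn U)) := by
    rw [← hlabU]
    exact commutatorLength_map_le lab hUmem
  have h2 : commutatorLength (FreeGroup.mk (List.ofFn U)) ≤ commutatorLength (FreeGroup.mk U') := by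
    have e : FreeGroup.mk (List.ofFn U) = (Pc 0)⁻¹ * θ (FreeGroup.mk U') * (Pc 0)⁻¹⁻¹ := by
      rw [hθU', hθU]
      group
    rw [e, commutatorLength_conj]
    exact commutatorLength_map_le θ hU'mem
  have h3 := commutatorLength_quadratic_le U' hU'1 hU'2
  have hlenU' : U'.length = w.length - 2 * T₀.card := by
    rw [hU'def, List.length_map, length_filter_finRange, ← hRm_card,
      show (Finset.univ.filter fun i => decide (i ∉ Rm) = true) = Finset.univ \ Rm by ext i; simp,
      Finset.card_univ_sdiff, Fintype.card_fin]
  have hV : (Finset.univ.image vert).card = T₀.card + 1 := by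
    rw [hcard]
    congr 1
    ext v
    simp only [Finset.mem_image, Finset.mem_univ, true_and, Finset.mem_range]
    constructor
    · rintro ⟨i, rfl⟩
      exact ⟨i.val, by omega, by show vert (fin i.val) = vert i; rw [hfin]⟩
    · rintro ⟨m, -, rfl⟩
      exact ⟨fin m, rfl⟩
  omega

/-- **Culler's bound, orbit form.** For a pairing `π` of `w`, with `V` the number of orbits of
`τ = rot ∘ π` on the positions (= the vertices of the pairing surface; `V = o(σπ)` of Bardakov's
formula), `2 · cl(mk w) + V ≤ |w|/2 + 1`, i.e. `cl(w) ≤ |w|/4 − V/2 + 1/2` — the `≤` half of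
Bardakov's formula / Culler's theorem (loc. cit. Lemma 3.5 with one boundary component).
[cite: CalegariWalker2013, Lemma 3.5] -/
theorem commutatorLength_le_of_pairing_orbits {α : Type*} [DecidableEq α]
    (w : List (α × Bool)) (π : Equiv.Perm (Fin w.length))
    (hπ : ∀ i, π (π i) = i) (hπ' : ∀ i, π i ≠ i)
    (hw : ∀ i, w.get (π i) = ((w.get i).1, !(w.get i).2)) :
    2 * commutatorLength (FreeGroup.mk w) +
        Nat.card (MulAction.orbitRel.Quotient
          (Subgroup.zpowers (π.trans (finRotate w.length))) (Fin w.length)) ≤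
      w.length / 2 + 1 := by
  classical
  rw [Nat.card_eq_fintype_card]
  set τ : Equiv.Perm (Fin w.length) := π.trans (finRotate w.length) with hτ
  let vert : Fin w.length → MulAction.orbitRel.Quotient (Subgroup.zpowers τ) (Fin w.length) :=
    Quotient.mk _
  have hvert : ∀ i, vert (finRotate _ (π i)) = vert i := by
    intro i
    show vert (τ i) = vert i
    apply Quotient.sound
    exact MulAction.orbitRel_apply.mpr
      (MulAction.mem_orbit i (⟨τ, Subgroup.mem_zpowers τ⟩ : Subgroup.zpowers τ))
  have h := commutatorLength_le_of_pairing w π hπ hπ' hw vert hvert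
  have hV : (Finset.univ.image vert).card =
      Fintype.card (MulAction.orbitRel.Quotient (Subgroup.zpowers τ) (Fin w.length)) := by
    rw [Finset.image_univ_of_surjective (Quotient.mk_surjective), Finset.card_univ]
  rw [hV] at h
  convert h

/-- **Several boundary components (towards Lemma 3.4 for fatgraphs with `b` boundaries).** If the
corner labelling `u` is invariant for a MODIFIED rotation `ρ⁻¹ ∘ rot` (e.g. `u` = the vertices of a
fatgraph whose `b` boundary words are the blocks of `w`, `ρ` the `b`-cycle of the block starts, so
that `ρ⁻¹ ∘ rot` is the rotation inside the blocks), then `2 · cl(mk w) + #values(u) ≤ |w|/2 + #supp(ρ)`: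
merging the `u`-classes met by the support of `ρ` into one class gives a `rot ∘ π`-invariant
labelling with at least `#values(u) − #supp(ρ) + 1` values. With `ρ` a `b`-cycle this reads
`2 cl(w₁⋯w_b) ≤ E − V + b` (`E = |w|/2`), the algebraic form of `χ = V − E`, genus
`(2 − χ − b)/2`, plus the tubing of `commutatorLength_pow_sum_le`. [cite: CalegariWalker2013, Lemma 3.5] -/
theorem commutatorLength_le_of_pairing_perturbed {α γ : Type*} [DecidableEq α] [DecidableEq γ]
    (w : List (α × Bool)) (π : Equiv.Perm (Fin w.length))
    (hπ : ∀ i, π (π i) = i) (hπ' : ∀ i, π i ≠ i)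
    (hw : ∀ i, w.get (π i) = ((w.get i).1, !(w.get i).2))
    (ρ : Equiv.Perm (Fin w.length)) (hρ : ρ ≠ 1) (u : Fin w.length → γ)
    (hu : ∀ i, u (ρ.symm (finRotate _ (π i))) = u i) :
    2 * commutatorLength (FreeGroup.mk w) + (Finset.univ.image u).card ≤
      w.length / 2 + ρ.support.card := by
  classical
  set bad : Finset γ := ρ.support.image u with hbad
  set vert : Fin w.length → Option γ := fun x => if u x ∈ bad then none else some (u x) with hvertdef
  have hvert : ∀ i, vert (finRotate _ (π i)) = vert i := by
    intro i
    set y := ρ.symm (finRotate _ (π i)) with hy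
    have e : finRotate _ (π i) = ρ y := by simp [hy]
    have huy : u y = u i := hu i
    rw [e]
    show (if u (ρ y) ∈ bad then none else some (u (ρ y))) =
      (if u i ∈ bad then none else some (u i))
    by_cases hys : y ∈ ρ.support
    · have h1 : u (ρ y) ∈ bad :=
        Finset.mem_image_of_mem u (Equiv.Perm.apply_mem_support.mpr hys)
      have h2 : u i ∈ bad := by
        rw [← huy]
        exact Finset.mem_image_of_mem u hys
      rw [if_pos h1, if_pos h2]
    · rw [Equiv.Perm.notMem_support.mp hys, huy]
  have hmain := commutatorLength_le_of_pairing w π hπ hπ' hw vert hvert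
  -- counting the merged classes
  obtain ⟨x₀, hx₀⟩ : ρ.support.Nonempty := by
    rw [Finset.nonempty_iff_ne_empty, Ne, Equiv.Perm.support_eq_empty_iff]
    exact hρ
  have hnone : none ∈ Finset.univ.image vert := by
    refine Finset.mem_image.mpr ⟨x₀, Finset.mem_univ _, ?_⟩
    show (if u x₀ ∈ bad then none else some (u x₀)) = none
    rw [if_pos (Finset.mem_image_of_mem u hx₀)]
  have h1 : ((Finset.univ.image u) \ bad).card ≤ ((Finset.univ.image vert).erase none).card := by
    refine Finset.card_le_card_of_injOn some (fun c hc => ?_) (fun c _ c' _ h => Option.some.inj h)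
    rw [Finset.coe_sdiff, Set.mem_sdiff, Finset.mem_coe, Finset.mem_coe, Finset.mem_image] at hc
    obtain ⟨⟨x, -, rfl⟩, hxbad⟩ := hc
    rw [Finset.coe_erase, Set.mem_sdiff, Finset.mem_coe, Finset.mem_image]
    refine ⟨⟨x, Finset.mem_univ _, ?_⟩, by simp⟩
    show (if u x ∈ bad then none else some (u x)) = some (u x)
    rw [if_neg hxbad]
  have h2 : ((Finset.univ.image u) ∩ bad).card ≤ ρ.support.card :=
    (Finset.card_le_card Finset.inter_subset_right).trans Finset.card_image_le
  have h3 := Finset.card_sdiff_add_card_inter (Finset.univ.image u) bad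
  have h4 := Finset.card_erase_of_mem hnone
  have h5 : 0 < (Finset.univ.image vert).card := Finset.card_pos.mpr ⟨none, hnone⟩
  omega

end PairingBound

/-! ### Bardakov's formula, the `≤` half (via `IsPairing` and `orbitCount` of `CommutatorLength.lean`)

`orbitCount σ = #cycles(σ) + #fixed points(σ)` is the number of orbits of `σ`; we realise it as the
number of values of the `σ`-invariant labelling `x ↦ (σ.cycleOf x, [σ x = x] ? x)` and obtain, for
every pairing `π` of `w`, `4 cl(mk w) + 2 orbitCount(σπ) ≤ |w| + 2` (`commutatorLength_le_of_isPairing`),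
hence `cl(w) ≤ |w|/4 − o/2 + 1/2` with `o` the maximal orbit count over pairings — one inequality
of `BardakovFormula` (Heuer 2020, Thm 2.4; Bardakov 2000; Culler 1981), proved
(`commutatorLength_le_bardakov`). -/

section Bardakov

open scoped Classical

/-- The cycles of `σ` are the `cycleOf` of the points it moves. [folklore] -/
theorem image_cycleOf_support {δ : Type*} [Fintype δ] [DecidableEq δ] (σ : Equiv.Perm δ) :
    σ.support.image σ.cycleOf = σ.cycleFactorsFinset := by
  ext c
  simp only [Finset.mem_image]
  constructor
  · rintro ⟨x, hx, rfl⟩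
    exact Equiv.Perm.cycleOf_mem_cycleFactorsFinset_iff.mpr hx
  · intro hc
    obtain ⟨a, ha⟩ :=
      Equiv.Perm.IsCycle.nonempty_support (Equiv.Perm.mem_cycleFactorsFinset_iff.mp hc).1
    exact ⟨a, Equiv.Perm.mem_cycleFactorsFinset_support_le hc ha,
      (Equiv.Perm.cycle_is_cycleOf ha hc).symm⟩

/-- `orbitCount σ` (number of cycles plus number of fixed points) is the number of values of the
`σ`-invariant labelling `x ↦ (σ.cycleOf x, if σ x = x then some x else none)`. [folklore] -/
theorem card_image_cycleLabel {n : ℕ} (σ : Equiv.Perm (Fin n)) :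
    (Finset.univ.image fun x => (σ.cycleOf x, if σ x = x then some x else none)).card =
      orbitCount σ := by
  set lab : Fin n → Equiv.Perm (Fin n) × Option (Fin n) :=
    fun x => (σ.cycleOf x, if σ x = x then some x else none) with hlab
  have hsplit : (Finset.univ : Finset (Fin n)) =
      σ.support ∪ Finset.univ.filter fun x => σ x = x := by
    ext x
    simp only [Finset.mem_univ, Finset.mem_union, Equiv.Perm.mem_support, Finset.mem_filter,
      true_and, true_iff]
    exact ne_or_eq _ _
  rw [hsplit, Finset.image_union, Finset.card_union_of_disjoint, orbitCount]
  · congr 1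
    · -- moved points: one label per cycle
      have h1 : σ.support.image lab = (σ.support.image σ.cycleOf).image fun c => (c, none) := by
        rw [Finset.image_image]
        refine Finset.image_congr fun x hx => ?_
        rw [Finset.mem_coe, Equiv.Perm.mem_support] at hx
        simp [hlab, hx]
      rw [h1, Finset.card_image_of_injective _ fun c c' h => (Prod.mk.injEq _ _ _ _ ▸ h :).1,
        image_cycleOf_support, Equiv.Perm.cycleType_def, Multiset.card_map, Finset.card_def]
    · -- fixed points: one label each
      refine Finset.card_image_of_injOn fun x hx y hy hxy => ?_
      rw [Finset.mem_coe, Finset.mem_filter] at hx hy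
      have h := congrArg Prod.snd hxy
      simp only [hlab, if_pos hx.2, if_pos hy.2, Option.some.injEq] at h
      exact h
  · rw [Finset.disjoint_left]
    intro p hp hp'
    obtain ⟨x, hx, rfl⟩ := Finset.mem_image.mp hp
    obtain ⟨y, hy, hxy⟩ := Finset.mem_image.mp hp'
    rw [Equiv.Perm.mem_support] at hx
    rw [Finset.mem_filter] at hy
    have h := congrArg Prod.snd hxy
    simp [hlab, if_neg hx, if_pos hy.2] at h

/-- **Bardakov's formula, `≤` half; Culler's theorem.** For every pairing `π` of the word `w`
(`IsPairing w π`), `4 · cl(mk w) + 2 · orbitCount(σπ) ≤ |w| + 2`, where `σπ` is the composite of the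
cyclic shift and `π` as in `BardakovFormula` — i.e. `cl(w) ≤ g(π) = |w|/4 − o(σπ)/2 + 1/2`, the
genus of the pairing surface. [cite: Heuer2020, Thm 2.4 (one inequality); Culler1981] -/
theorem commutatorLength_le_of_isPairing {α : Type*} [DecidableEq α] (w : List (α × Bool))
    (π : Equiv.Perm (Fin w.length)) (h : IsPairing w π) :
    4 * commutatorLength (FreeGroup.mk w) + 2 * orbitCount ((finRotate w.length).trans π) ≤
      w.length + 2 := by
  set σ : Equiv.Perm (Fin w.length) := (finRotate w.length).trans π with hσ
  set lab : Fin w.length → Equiv.Perm (Fin w.length) × Option (Fin w.length) :=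
    fun x => (σ.cycleOf x, if σ x = x then some x else none) with hlab
  have hlabσ : ∀ x, lab (σ x) = lab x := by
    intro x
    simp only [hlab, Equiv.Perm.cycleOf_self_apply, EmbeddingLike.apply_eq_iff_eq]
    by_cases hx : σ x = x
    · rw [if_pos hx, if_pos hx, hx]
    · rw [if_neg hx, if_neg hx]
  have hvert : ∀ i, (lab ∘ π) (finRotate _ (π i)) = (lab ∘ π) i := fun i => hlabσ (π i)
  have hmain := commutatorLength_le_of_pairing w π h.1 h.2.1 h.2.2 (lab ∘ π) hvert
  have hcard : (Finset.univ.image (lab ∘ π)).card = orbitCount σ := by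
    rw [← Finset.image_image, Finset.image_univ_of_surjective π.surjective, hlab,
      card_image_cycleLabel]
  rw [hcard] at hmain
  omega

/-- **One inequality of `BardakovFormula`, proved**: for a word `w` in the commutator subgroup,
`cl(w) ≤ |w|/4 − o/2 + 1/2` where `o = max {orb(σπ) : π a pairing of w}` — literally the right-hand
side of `BardakovFormula` (`CommutatorLength.lean`; [Heuer2020, Thm 2.4], `k = 1`). The reverse
inequality (existence of a pairing realising `cl`) is the remaining content of that named fact.
[cite: Heuer2020, Thm 2.4 (one inequality)] -/
theorem commutatorLength_le_bardakov {α : Type} (w : List (α × Bool))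
    (hmem : FreeGroup.mk w ∈ commutator (FreeGroup α)) :
    (commutatorLength (FreeGroup.mk w) : ℚ) ≤
      (w.length : ℚ) / 4 -
        (((Finset.univ.filter (IsPairing w)).sup
            fun π => orbitCount ((finRotate w.length).trans π) : ℕ) : ℚ) / 2 + 1 / 2 := by
  have hne : (Finset.univ.filter (IsPairing w)).Nonempty := by
    obtain ⟨π, hπ⟩ := exists_isPairing_of_mk_mem_commutator w hmem
    exact ⟨π, Finset.mem_filter.mpr ⟨Finset.mem_univ _, hπ⟩⟩
  obtain ⟨π, hπ, hsup⟩ := Finset.exists_mem_eq_sup _ hne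
    fun π => orbitCount ((finRotate w.length).trans π)
  rw [hsup]
  have h := commutatorLength_le_of_isPairing w π (Finset.mem_filter.mp hπ).2
  have h' : (4 : ℚ) * commutatorLength (FreeGroup.mk w) +
      2 * orbitCount ((finRotate w.length).trans π) ≤ w.length + 2 := by
    exact_mod_cast h
  linarith

end Bardakov

end Literature.GroupTheory.CombinatorialGroupTheory

end
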